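import Mathlib.Data.List.Basic
import Mathlib.Data.List.InsertIdx
import Mathlib.Tactic

/-!
# `Lines/toric_sgame_termination.lean` — TERMINATION OF THE TORIC S-GAME FROM EVERY STATE (S4 of the (T″) sheet) in the kernel
(res-B-lens-2 g10; rev 2 — rev 1 = commit b78c7c4d0812 + §T6–§T7: mode `u` under the historical rule sets `topj ≤ 1`)

Crux `stmt-ResolutionOfSingularities-0549` (`Theses.Descent.DescentPerfectToAll`), sub-line `giraud-weak-normal-form`.
LABELS: bears_on LADDER-RESOLUTION:B · [OURS · CANDIDATE] counted 0 · de-risking scaffolding for the Giraud-normal-form sub-line,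
NOT rung-B progress · nothing here proves resolution in char p · resolution in char p NOT proved · AI-written, weaker than expert
review · PURE COMBINATORICS: a termination theorem for the b-graded toric S-GAME of loop note `giraud-weak-normal-form-RFINE-loop.md`
§9 / sheet `giraud-double-cubic-Tpp-sheet.md` §2 (a MODEL of the S-visible part of a resolution engine on ONE local normal form
`f = z³/3 + y³/3 + y²g₂ + yg₁ + g₀` near a smooth surface `S` with snc boundary), NOT any statement about schemes. It is a crux
WORKFILE, not a skeleton: no `sorry`, registers no stub, never to be `ledger skeleton check`ed against 0549/0550.

WHAT THIS FILE SETTLES. Row S4 of the (T″) sheet («the S-game terminates from every state») was, up to g9, certified only in BOXES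
(`decide` / `native_decide` all-orders explorations of `Lines/toric_sgame.lean` §C, weights ≤ a bound) and rated «by hand» beyond them
(crit-1 TRIAGE-126e: «by hand still S1, S4, S5 (+G)»). Here S4 becomes a KERNEL THEOREM FOR ALL WEIGHTS AND ALL CHAINS, for the rule
sets the sheet uses: `G_mult` (indeed any `topj ≥ 2`) for every chain, and mode `uv` (all curves boundary) for ANY rule set:

* `no_infinite_play topj ch : Good ch → ModeOK topj ch → ∀ f : ℕ → Move, ¬ IsInfinitePlay topj ch f` — no infinite sequence of moves
  is legal at every step (`IsInfinitePlay topj ch f := ∀ n, f n ∈ legalMoves topj (playState ch f n)`);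
* `legalPlays_bounded topj ch : Good ch → ModeOK topj ch → ∃ N, ∀ l, isLegalPlay topj ch l = true → l.length ≤ N` (König over the
  finite move lists: the legal plays from a state have bounded length);
* `no_infinite_legal_prefixes` (the same phrased with `isLegalPlay` on all finite prefixes), and the instances for the sheet's initial
  states `terminates_uv` (`[V(t), V(s)]`, any `topj`, all weights with a common non-empty set of finite grades) and `terminates_u`
  (`[R, V(s)]`, `topj ≥ 2`, residual exponents `c` not deep — if `c ≥ θ` the residual branch is a deep curve that is never accepted and
  the top T-point is blown up for ever, correctly an infinite play of the MODEL; in the engine this is the case `R ⊂ Sing_top`, handled by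
  the curve move on `R`'s stratum, outside the S-game).

HYPOTHESES (the invariant `Good`, preserved by every legal move: `Good_applyMove`). (G1) all curves of the chain have the SAME set of
finite grades, and it is non-empty: `w_b(K) = ∞` means the class part `g_b` of `f` vanishes identically, a property of `f`, not of
the curve, so every state of one game satisfies it; it is NEEDED — with mixed patterns the model has infinite legal plays (e.g. the chain
`(∞,1,1) — (0,5,5)`, python `cas/potcheck.py`), and with all three grades infinite every point is top for ever. (G2) residual
branches (`bd = false`) are not deep (see `terminates_u`). MODE (`ModeOK`): `2 ≤ topj` or all curves boundary — exactly the modes in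
which an accepted curve never passes through a top point (`AccFacts_of_topj`, `AccFacts_of_bd` of the all-chains file). REV 2 (g10, same day) ADDS §T6–§T7: mode `u` (a residual branch `R` first) under the HISTORICAL rule sets `topj = 1` (loop-note rev 3)
and `topj = 0` (rev 2), where `A`/`AL` accepts through a TOP non-jump T-point ARE legal: `no_infinite_play_u` / `legalPlays_bounded_u` /
`terminates_u_hist`, hence `terminates_u_all` (mode `u`, EVERY `topj`); so S4 now holds in the kernel for every mode and every rule set of the
loop note, for all weights (hypotheses (G1), (G2) as before; `GoodU` = `Good` ∧ `R` first ∧ all other curves boundary, an invariant: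
`GoodU_applyMove`). Row S2 (all maximal legal plays have the same length / lead to the same final state) is NOT touched here.

THE PROOF (new; found and validated numerically this generation, then kernel-checked — §T1–§T5; rev 2 adds §T6–§T7). A lexicographic potential
`pot ch = (Φ, PD, S0, T) ∈ ℕ⁴` strictly decreases at every legal move (`pot_step`), whence well-foundedness.
* Scaled values `x_b = (6/θ_b)·w_b ∈ {2w₀, 3w₁, 6w₂}` (all thresholds become 6); `m(w)` = min over the finite grades; a weight is deep iff
  `m ≥ 6`. SETTLING: `settle w` = `w` minus `⌊m/6⌋` deep accepts `(3,2,1)` — the weight the curve will have after its forced `D`-accepts;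
  `PD` = Σ pending deep accepts `⌊m/6⌋`. A newborn of an exponent-3 blow-up at a top point of non-deep curves `a, b` has scaled values
  `x(a) + x(b) − 6`, and settles to `x(a) + x(b) − 6k`.
* PAIR MEASURE (§T1/§T2): for a node with branches `a, b` (settled values `x, y`) put `E_{bb'} = |Δ_{bb'}x| + |Δ_{bb'}y|` if the grade
  differences `Δ_{bb'}x = x_b − x_b'` and `Δ_{bb'}y` have STRICTLY OPPOSITE signs, else 0 (a subtractive-Euclid term: the differences are
  additive in the newborn, `Δ(child) = Δx + Δy`), and `M′(a,b) = 6·Σ_{b<b'} E_{bb'} + min(m(a), m(b))`. CORE LEMMA `Mp_child` (from the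
  arithmetic `M3_child` / `M2_child` / `M1_child`, one per pattern of finite grades): at a TOP node of two non-deep same-pattern weights the
  settled newborn `c` has `M′(a,c) < M′(a,b)` and `M′(c,b) < M′(a,b)`. With `φ(a,b) = [a+b deep]·(2^{M′(a,b)} − 1)` this gives the SPLITTING
  INEQUALITY `phi_split : φ(a,c) + φ(c,b) + 1 ≤ φ(a,b)`.
* CHAIN LAYER (§T3/§T4): `Φ` = Σ over adjacent pairs of `φ(settle a, settle b)`; `S0` = Σ finite `w₀`; `T` = Σ over Sing₂ points of
  `o₁ + 1`. Per move (componentwise, hence lexicographic): `D`: `Φ` unchanged (settled weights unchanged, `settle_deep`), `PD` drops;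
  `A`/`AL` (only emitted with no deep curve and, in the covered modes, no top point on the centre): `Φ, PD` do not increase (the two
  adjacent `φ` vanish before and after, `settleK_sub210_le`), `S0` drops by 2 (`w₀ = 2` at the centre: `w0_of_borderline`, (F2));
  `I` / top `P` (exponent 3): `Φ` drops (`phi_split` at the node, the rest of the sum unchanged: `pairSum_insert`); non-top `P` (exponent
  2, `o₀ = 2`, newborn `w₀ = 0`): `Φ, PD, S0` do not increase and `T` drops (`tterm_P2`: both branches unhandled ⇒ boundary branches are
  outside class 𝒞 ⇒ the two new points carry less than `o₁ + 1`).
* §T5: `LT4_wf` (lex on ℕ⁴) ⇒ `no_infinite_play`; `Step_wf` + finiteness of `legalMoves` ⇒ `legalPlays_bounded`.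
* §T6/§T7 (rev 2; mode `u`, `topj ≤ 1`). Under `topj = 1` the only new event is the accept of a BORDERLINE `K₁` through a top non-jump
  T-point: then `c₀ = 1`, `w₀(K₁) = 2` and the point dies (`A_T_after`), so the standard potential still drops (`pot_step_u1`; the accept
  lemma `pot_acc_le` checks the no-top condition at each point before OR after the move). Under `topj = 0` a relevant LIGHT `K₁` may also be
  accepted through a top non-jump T-point; either the point dies (tight grade 0: `S0` drops; tight grade 1: the point leaves Sing₂ and `T`
  drops — `AL_T_after`), or it is a T-RUN configuration `badW c K₁` (`c₂ = 1`, `w₂(K₁) = 0`, `K₁ ∈ 𝒞`, `o ≥ θ`): the point stays top with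
  `o₂ = 1`, is never a jump point, and `K₁` is light-accepted until `w₀` or `w₁` runs out. `Φ` is NOT monotone along a T-run (`c = (100,1,1)`,
  `K₁ = (3,2,0)`: `M′` jumps 9 → 204), so `pot₀ = (Φ_T, PD + PT, S0, T)` T-SETTLES node 0: `Φ_T` replaces `φ(c, K₁)` by `φ(c, trun c K₁)`
  where `trun` applies the pending light accepts `(2,1,0)` while `badW` holds (well-founded on `w₀ + w₁`), and `PT = tlen` = the pending run
  length. A T-run step leaves `Φ_T` fixed and drops `PT` (`trun_bad`); every other move is handled as before (`PhiT_congr`: away from node 0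
  `Φ_T` moves with `Φ`; `PhiT_eq_Phi`: no pending run ⇒ `Φ_T = Φ`), except the exponent-3 blow-up of node 0, which needs the T-SHIFTED
  SPLITTING INEQUALITY `phi_splitT : φ(c, S − t·(2,1,0)) + φ(S, K₁) + 1 ≤ φ(c, K₁)` for the settled newborn `S` and every feasible run length
  `t` (arithmetic core `M3_childT` / `M2_childT`: with `c₂ = 1` scaled to `x₂ = 6` and `S₂ = 0`, the shift `(−4t, −3t, 0)` of the scaled
  values lowers every `E`-term when `x₀ ≤ x₁`, and when `x₁ < x₀` raises `E₀₁` by at most `t` while lowering `E₁₂` by at least `t + 1`).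
  A jump T-point, an unhandled `K₁` and a non-top point are never T-run configurations (`notBad_of_jump`, `notBad_of_notCW`,
  `notBad_of_notTop`), which is what makes the `I 0` / `P 0` cases go through.
NUMERICAL VALIDATION BEFORE FORMALISATION (python, this folder's `cas/`; not evidence, recorded for provenance): `mprime_check.py` — all
92 654 top pairs of non-deep same-pattern weights ≤ 8 (7 patterns): `Mp_child` holds in every case (max `M′` = 864); `potcheck.py` (exact
port of the move generator + the potential) — 1 200 random chains (weights ≤ 20, length ≤ 6, residual branches with prob. 0.3, seeds
1–3, `topj` per `ModeOK`): strict lexicographic decrease at every legal move of a random legal play, all plays terminate (max 130 moves). Rev 2: `trun_check.py` — all 14 826 top T-configurations `(c, v)` with `c₂ = 1`, weights ≤ 9: the T-shifted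
inequality `Mp c (trun c (settle (nb3 c v))) < Mp c v` holds in every case (1 006 genuine runs, max run length 6); `potcheck0.py` — 1 200 random +
3 000 T-run-biased mode-`u` plays under `topj ∈ {0, 1}` (36 807 moves, 11 639 T-run steps): strict lexicographic decrease of `pot₀` (resp. `pot`)
at every move, 0 failures.

RELATION TO THE OTHER WORKFILES. §B (copy) re-declares the MODEL CORE of `Lines/toric_sgame.lean` §B VERBATIM (definitions `Wt …
isLegalPlay`; namespace `….ToricSGame.Termination`, so nothing clashes — crux workfiles are not importable modules); §L (copy) repeats
VERBATIM the lemmas of `Lines/toric_sgame_allchains.lean` §B′–§B‴ that are used here (threshold arithmetic, what the move generator can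
emit, `List.modify` / `List.insertIdx` transport, `AccFacts`). §T1–§T7 are new (§T6–§T7 in rev 2). Plain tactic proofs (`omega` on linear facts after
case splits on the patterns; `min`-atoms hidden by hand), no `sorry`, no axioms beyond the standard three, no custom syntax,
`maxHeartbeats 1600000` as in the sibling files.

## Contents
* §B (copy) model core · §L (copy) lemmas from the all-chains file.
* §T1 arithmetic core: `E`, `M3/M2/M1`, `M3_child/M2_child/M1_child` (the pair measure drops for both halves of a split top node).
* §T2 weight vectors: `pat`, `mval`, `settleK`, `settle`, `Mp`, `phi`, `nb3`, `Mp_child`, `phi_split`, settling lemmas.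
* §T3 chain potentials `Phi/PD/S0/TT/pot`, `pairSum` calculus, list plumbing, `Good`/`ModeOK`, threshold lemmas (`topN_eq`: top = `o ≥ θ`
  at every node), `legal_noDeep`, `nb2_facts`, `tterm_P2`.
* §T4 `pot_D`, `pot_acc`, `pot_blowup3`, `pot_blowup2`, `pot_step`; invariance `Good_applyMove`, `ModeOK_applyMove`.
* §T5 `no_infinite_play`, `no_infinite_legal_prefixes`, `Step_wf`, `legalPlays_bounded`, `Good_init_uv/u`, `terminates_uv/u`.
* §T6 (rev 2; placed right after §T2 in the file — weight-level arithmetic) T-shift arithmetic `M3_childT/M2_childT`; T-runs `badW/tfuel/trun/tlen`, `trun_spec`, `Mp_childT`, `phi_splitT`.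
* §T7 (rev 2) `pot_acc_le`, `S0_acc`, T-node lemmas (`A_T_after`, `AL_T_after`, `notBad_of_*`), `GoodU`/`GoodU_applyMove`, the T-settled
  potential `PhiT/PT/pot0`, `PhiT_blowup3`, `pot0_step` (`topj = 0`), `pot_step_u1` (`topj = 1`), `no_infinite_play_u`, `StepU_wf`,
  `legalPlays_bounded_u`, `GoodU_init`, `terminates_u_hist`, `terminates_u_all`.

-/

set_option linter.unusedVariables false
set_option linter.unusedSectionVars false
set_option linter.style.longLine false
set_option linter.style.longFile 0
set_option maxHeartbeats 1600000
set_option linter.unusedSimpArgs false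
set_option linter.dupNamespace false

namespace Summit.ResolutionOfSingularities.ResolutionOfSingularities.Cruxes.DescentPerfectToAll.ToricSGame.Termination

/-! ## §B (copy). The b-graded toric S-game — model core, VERBATIM from `Lines/toric_sgame.lean` §B (= `Lines/toric_sgame_allchains.lean` §B copy). -/

/-- One grade weight `w_b = ord_C(g_b)`; `none` = ∞ (the class part `g_b` is identically zero). -/
abbrev Wt := Option ℕ

/-- `w ≥ t` for a grade weight (`∞ ≥ t` always). -/
def wge (w : Wt) (t : ℕ) : Bool := match w with | none => true | some n => Nat.ble t n

/-- `1 ≤ c < ∞`. -/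
def finPos (c : Wt) : Bool := match c with | none => false | some n => Nat.ble 1 n

/-- Sum of grade weights (∞ absorbing). -/
def wadd : Wt → Wt → Wt
  | some x, some y => some (x + y)
  | _, _ => none

/-- The weight vector `(w₀, w₁, w₂)` of a curve (orders of the three class parts `g₀, g₁, g₂`). -/
structure W3 where
  w0 : Wt
  w1 : Wt
  w2 : Wt
deriving DecidableEq, Repr, Inhabited, Hashable

namespace W3
/-- componentwise `w ≥ (t₀,t₁,t₂)` -/
def ge (w : W3) (t0 t1 t2 : ℕ) : Bool := wge w.w0 t0 && wge w.w1 t1 && wge w.w2 t2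
/-- node order `o = w' + w''` -/
def add (a b : W3) : W3 := ⟨wadd a.w0 b.w0, wadd a.w1 b.w1, wadd a.w2 b.w2⟩
/-- accept: `w ↦ w − (d₀,d₁,d₂)` -/
def sub (w : W3) (d0 d1 d2 : ℕ) : W3 := ⟨w.w0.map (· - d0), w.w1.map (· - d1), w.w2.map (· - d2)⟩
end W3

/-- thresholds: `θ = (3,2,1)` (TOP / DEEP), `(2,2,1)` (Sing₂), `(2,1,0)` (class 𝒞). -/
def isDeepW (w : W3) : Bool := w.ge 3 2 1
def isSingW (w : W3) : Bool := w.ge 2 2 1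
def isCW (w : W3) : Bool := w.ge 2 1 0

/-- A curve of the chain: class weights `w`, the CUBIC weight `w3 = ord_C` of the class-3 part `(z³+y³)/3` (θ₃ = 3; it never
influences legality — bookkeeping for the (OFF-S) census of §9.12/9.14), and the flag `bd` (`true` = boundary/exceptional curve, a legal
centre; `false` = the residual transversal branch `R` of mode `u`, never a centre; its weights are the residual exponents `c`). -/
structure Curve where
  w : W3
  w3 : ℕ
  bd : Bool
deriving DecidableEq, Repr, Inhabited, Hashable

/-- The state: the chain of curves `K₀ — K₁ — ⋯ — K_n`; point `i` is the node between `K_i` and `K_{i+1}`. -/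
abbrev Chain := List Curve

/-- Moves: `D k` accept the deep curve `k` (α = 3); `A k` / `AL k` accept the borderline / relevant light curve `k` (α = 2);
`I i` blow up the jump (or, under `G_mult`, top) point `i` of a handled curve (α = 3); `P i` blow up the isolated Sing₂ point `i`
(α = 3 if top, else 2). -/
inductive Move
  | D (k : ℕ) | A (k : ℕ) | AL (k : ℕ) | I (i : ℕ) | P (i : ℕ)
deriving DecidableEq, Repr

inductive Kind | resid | deep | borderline | light | none
deriving DecidableEq, Repr

def kindOf (c : Curve) : Kind :=
  if !c.bd then .resid else if isDeepW c.w then .deep else if isSingW c.w then .borderline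
  else if isCW c.w then .light else .none

/-- the two branches at point `i` -/
def nodeAt (ch : Chain) (i : ℕ) : Option (Curve × Curve) :=
  match ch[i]?, ch[i+1]? with
  | some a, some b => some (a, b)
  | _, _ => none

/-- residual exponents at a T-point (`none` at a 𝒟-node) -/
def resid (a b : Curve) : Option W3 := if !a.bd then some a.w else if !b.bd then some b.w else none

/-- `x ∈ Sing₂` (multiplicity / ν dictionary 9.3′, T-point rule rev 2: `c₀ ≥ 1 ⇒ o₀ ≥ 3`, `c₁ ≥ 1 ⇒ o₁ ≥ 2`, `c₂ ≥ 1 ⇒ o₂ ≥ 1`). -/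
def sing2N (a b : Curve) : Bool :=
  let o := a.w.add b.w
  isSingW o &&
  (match resid a b with
   | none => true
   | some c => (!finPos c.w0 || wge o.w0 3) && (!finPos c.w1 || wge o.w1 2) && (!finPos c.w2 || wge o.w2 1))

/-- `x` TOP (multiplicity 3): Sing₂ and `o ≥ θ`. -/
def topN (a b : Curve) : Bool := sing2N a b && isDeepW (a.w.add b.w)

/-- `x` a JUMP point of a (non-deep, class-𝒞) curve through it: top, and at a T-point `c_b ≥ 1 ⇒ o_b ≥ 4 − b`. -/
def jumpN (a b : Curve) : Bool :=
  let o := a.w.add b.w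
  topN a b &&
  (match resid a b with
   | none => true
   | some c => (!finPos c.w0 || wge o.w0 4) && (!finPos c.w1 || wge o.w1 3) && (!finPos c.w2 || wge o.w2 2))

def sing2At (ch : Chain) (i : ℕ) : Bool := match nodeAt ch i with | some (a, b) => sing2N a b | none => false
def topAt (ch : Chain) (i : ℕ) : Bool := match nodeAt ch i with | some (a, b) => topN a b | none => false
def jumpAt (ch : Chain) (i : ℕ) : Bool := match nodeAt ch i with | some (a, b) => jumpN a b | none => false
def kindAt (ch : Chain) (k : ℕ) : Kind := match ch[k]? with | some c => kindOf c | none => .none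

/-- the points (node indices) of curve `k` in a chain of length `n` -/
def ptsOf (n k : ℕ) : List ℕ := (if 1 ≤ k then [k - 1] else []) ++ (if k + 1 < n then [k] else [])

/-- a light curve is RELEVANT iff one of its points is in Sing₂ -/
def relevantLight (ch : Chain) (k : ℕ) : Bool := kindAt ch k == .light && (ptsOf ch.length k).any (sing2At ch)

/-- curves that HANDLE their points (curves first at points): deep, borderline, relevant light -/
def handled (ch : Chain) (k : ℕ) : Bool :=
  kindAt ch k == .deep || kindAt ch k == .borderline || relevantLight ch k

/-- The LEGAL MOVES under STRICT legality (deep-first; curves first at points), variant `topj`: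
`topj = 0` = loop-note rev 2; `topj = 1` = rev 3 (top points on relevant light curves are blown up first);
`topj = 2` = `G_mult` (top points on borderline curves too). The list is the SET of legal moves (any order = rule `free`). -/
def legalMoves (topj : ℕ) (ch : Chain) : List Move :=
  let n := ch.length
  let idx := List.range n
  match idx.filter (fun k => kindAt ch k == .deep) with
  | k :: _ => [Move.D k]
  | [] =>
    let curveMoves := idx.flatMap (fun k =>
      match kindAt ch k with
      | .borderline =>
          let js := (ptsOf n k).filter (fun i => jumpAt ch i || (Nat.ble 2 topj && topAt ch i))
          if js.isEmpty then [Move.A k] else js.map Move.I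
      | .light =>
          if (ptsOf n k).any (sing2At ch) then
            let js := (ptsOf n k).filter (fun i => jumpAt ch i || (Nat.ble 1 topj && topAt ch i))
            if js.isEmpty then [Move.AL k] else js.map Move.I
          else []
      | _ => [])
    let pMoves := ((List.range (n - 1)).filter
      (fun i => sing2At ch i && !handled ch i && !handled ch (i + 1))).map Move.P
    curveMoves ++ pMoves

/-- LOOSE legality (for contrast only; = `coupled_sim3`'s `free2`): isolated point blow-ups are also allowed at points of
relevant light curves. It admits an infinite legal play (§C). -/
def looseMoves (topj : ℕ) (ch : Chain) : List Move :=
  let n := ch.length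
  legalMoves topj ch ++ ((List.range (n - 1)).filter
      (fun i => sing2At ch i && relevantLight ch i || sing2At ch i && relevantLight ch (i + 1))).map Move.P

/-- TERMINAL: no deep/borderline curve and no Sing₂ point. -/
def terminalB (ch : Chain) : Bool :=
  (List.range ch.length).all (fun k => kindAt ch k != .deep && kindAt ch k != .borderline) &&
  (List.range (ch.length - 1)).all (fun i => !sing2At ch i)

/-- blow up point `i` with exponent `α`: newborn curve with `w_b = o_b + b − α`, inserted between the two branches. -/
def blowup (ch : Chain) (i α : ℕ) : Chain :=
  match nodeAt ch i with
  | none => ch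
  | some (a, b) =>
    let o := a.w.add b.w
    ch.insertIdx (i + 1) ⟨⟨o.w0.map (· - α), o.w1.map (· + 1 - α), o.w2.map (· + 2 - α)⟩, a.w3 + b.w3 + 3 - α, true⟩

/-- play one move -/
def applyMove (ch : Chain) : Move → Chain
  | .D k => ch.modify k (fun c => { c with w := c.w.sub 3 2 1 })
  | .A k => ch.modify k (fun c => { c with w := c.w.sub 2 1 0, w3 := c.w3 + 1 })
  | .AL k => ch.modify k (fun c => { c with w := c.w.sub 2 1 0, w3 := c.w3 + 1 })
  | .I i => blowup ch i 3
  | .P i => blowup ch i (if topAt ch i then 3 else 2)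

/-- play a list of moves -/
def applyMoves (ch : Chain) (l : List Move) : Chain := l.foldl applyMove ch

/-- is `l` a legal play from `ch` (every move legal when played)? -/
def isLegalPlay (topj : ℕ) : Chain → List Move → Bool
  | _, [] => true
  | ch, m :: l => (legalMoves topj ch).contains m && isLegalPlay topj (applyMove ch m) l


/-! ## §L (copy). Lemmas about the model, VERBATIM from `Lines/toric_sgame_allchains.lean` §B′/§B″/§B‴ (threshold arithmetic, what the
move generator can emit, transport through `List.modify` / `List.insertIdx`, class arithmetic, plays). -/

theorem wge_some (n t : ℕ) : wge (some n) t = decide (t ≤ n) := by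
  simp only [wge]
  rw [Bool.eq_iff_iff, Nat.ble_eq, decide_eq_true_eq]
theorem wge_none (t : ℕ) : wge none t = true := rfl
theorem wadd_some (x y : ℕ) : wadd (some x) (some y) = some (x + y) := rfl
theorem wadd_none_l (y : Wt) : wadd none y = none := by cases y <;> rfl
theorem wadd_none_r (x : Wt) : wadd x none = none := by cases x <;> rfl

/-- a borderline curve has `w₀ = 2` -/
theorem w0_of_borderline (c : Curve) (h : kindOf c = .borderline) : c.w.w0 = some 2 := by
  rcases c with ⟨w, w3, bd⟩
  cases hD : isDeepW w <;> cases hS : isSingW w <;> cases hC : isCW w <;> cases bd <;> simp [kindOf, hD, hS, hC] at h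
  all_goals
    rcases w with ⟨_ | a, _ | b, _ | c⟩ <;> (simp only [isDeepW, isSingW, isCW, W3.ge, W3.add, wge_some, wge_none, wadd_some, wadd_none_l, wadd_none_r, Bool.and_eq_true, Bool.and_eq_false_eq_eq_false_or_eq_false, decide_eq_true_eq, decide_eq_false_iff_not, not_le, Bool.true_and, Bool.and_true, true_and, and_true, Bool.false_eq_true, Bool.true_eq_false, false_or, or_false, Option.some.injEq, reduceCtorEq, false_and, and_false, or_true, true_or, exists_and_left, exists_and_right, exists_eq_left, exists_eq_left', exists_eq_right, exists_eq_right', exists_eq', exists_false, exists_const, false_iff, iff_false, not_false_eq_true, not_true_eq_false] at *) <;> omega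

/-- a light curve has `2 ≤ w₀` when `w₀` is finite -/
theorem w0_of_light (c : Curve) (h : kindOf c = .light) (x : ℕ) (hx : c.w.w0 = some x) : 2 ≤ x := by
  rcases c with ⟨w, w3, bd⟩
  cases hD : isDeepW w <;> cases hS : isSingW w <;> cases hC : isCW w <;> cases bd <;> simp [kindOf, hD, hS, hC] at h
  all_goals
    rcases w with ⟨_ | a, _ | b, _ | c⟩ <;> simp only at hx <;> (simp only [isDeepW, isSingW, isCW, W3.ge, W3.add, wge_some, wge_none, wadd_some, wadd_none_l, wadd_none_r, Bool.and_eq_true, Bool.and_eq_false_eq_eq_false_or_eq_false, decide_eq_true_eq, decide_eq_false_iff_not, not_le, Bool.true_and, Bool.and_true, true_and, and_true, Bool.false_eq_true, Bool.true_eq_false, false_or, or_false, Option.some.injEq, reduceCtorEq, false_and, and_false, or_true, true_or, exists_and_left, exists_and_right, exists_eq_left, exists_eq_left', exists_eq_right, exists_eq_right', exists_eq', exists_false, exists_const, false_iff, iff_false, not_false_eq_true, not_true_eq_false] at *) <;> omega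

/-- at a Sing₂ point that is NOT top the order `o₀` is exactly 2: both branches have finite `w₀`, summing to 2 -/
theorem o0_of_sing2_not_top (a b : Curve) (hs : sing2N a b = true) (ht : topN a b = false) :
    ∃ x y : ℕ, a.w.w0 = some x ∧ b.w.w0 = some y ∧ x + y = 2 := by
  have ht' : isDeepW (a.w.add b.w) = false := by
    unfold topN at ht; rw [hs] at ht; simpa using ht
  have hs' : isSingW (a.w.add b.w) = true := by
    unfold sing2N at hs; simp only [Bool.and_eq_true] at hs; exact hs.1
  clear hs ht
  rcases a with ⟨⟨_ | a0, _ | a1, _ | a2⟩, a3, abd⟩ <;> rcases b with ⟨⟨_ | b0, _ | b1, _ | b2⟩, b3, bbd⟩ <;> (simp only [isDeepW, isSingW, isCW, W3.ge, W3.add, wge_some, wge_none, wadd_some, wadd_none_l, wadd_none_r, Bool.and_eq_true, Bool.and_eq_false_eq_eq_false_or_eq_false, decide_eq_true_eq, decide_eq_false_iff_not, not_le, Bool.true_and, Bool.and_true, true_and, and_true, Bool.false_eq_true, Bool.true_eq_false, false_or, or_false, Option.some.injEq, reduceCtorEq, false_and, and_false, or_true, true_or, exists_and_left, exists_and_right,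 exists_eq_left, exists_eq_left', exists_eq_right, exists_eq_right', exists_eq', exists_false, exists_const, false_iff, iff_false, not_false_eq_true, not_true_eq_false] at *) <;> omega


/-- An `A k` move is emitted only for a BORDERLINE curve `k` none of whose points is a jump (or, when `2 ≤ topj`, top). -/
theorem A_mem_legalMoves (topj : ℕ) (ch : Chain) (k : ℕ) (h : Move.A k ∈ legalMoves topj ch) :
    kindAt ch k = .borderline ∧
      ∀ i ∈ ptsOf ch.length k, (jumpAt ch i || (Nat.ble 2 topj && topAt ch i)) = false := by
  unfold legalMoves at h
  dsimp only at h
  split at h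
  · simp at h
  · simp only [List.mem_append, List.mem_flatMap, List.mem_map, List.mem_filter, List.mem_range] at h
    rcases h with ⟨k', hk', hm⟩ | ⟨i, _, hi⟩
    · split at hm
      · rename_i hkind
        split at hm
        · rename_i hjs
          simp only [List.mem_singleton, Move.A.injEq] at hm
          subst hm
          refine ⟨hkind, ?_⟩
          intro i hi
          have := List.isEmpty_iff.mp hjs
          rw [List.filter_eq_nil_iff] at this
          have h2 := this i hi
          simpa using h2
        · simp at hm
      · split at hm <;> [split at hm <;> simp at hm; simp at hm]
      · simp at hm
    · simp at hi

/-- An `AL k` move is emitted only for a RELEVANT LIGHT curve `k` none of whose points is a jump (or, when `1 ≤ topj`, top). -/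
theorem AL_mem_legalMoves (topj : ℕ) (ch : Chain) (k : ℕ) (h : Move.AL k ∈ legalMoves topj ch) :
    kindAt ch k = .light ∧ (ptsOf ch.length k).any (sing2At ch) = true ∧
      ∀ i ∈ ptsOf ch.length k, (jumpAt ch i || (Nat.ble 1 topj && topAt ch i)) = false := by
  unfold legalMoves at h
  dsimp only at h
  split at h
  · simp at h
  · simp only [List.mem_append, List.mem_flatMap, List.mem_map, List.mem_filter, List.mem_range] at h
    rcases h with ⟨k', hk', hm⟩ | ⟨i, _, hi⟩
    · split at hm
      · split at hm <;> simp at hm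
      · rename_i hkind
        split at hm
        · rename_i hrel
          split at hm
          · rename_i hjs
            simp only [List.mem_singleton, Move.AL.injEq] at hm
            subst hm
            refine ⟨hkind, hrel, ?_⟩
            intro i hi
            have := List.isEmpty_iff.mp hjs
            rw [List.filter_eq_nil_iff] at this
            have h2 := this i hi
            simpa using h2
          · simp at hm
        · simp at hm
      · simp at hm
    · simp at hi


/-- A `P i` move is emitted only at a Sing₂ point `i` none of whose two branches is a handled curve. -/
theorem P_mem_legalMoves (topj : ℕ) (ch : Chain) (i : ℕ) (h : Move.P i ∈ legalMoves topj ch) :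
    sing2At ch i = true ∧ handled ch i = false ∧ handled ch (i + 1) = false := by
  unfold legalMoves at h
  dsimp only at h
  split at h
  · simp at h
  · simp only [List.mem_append, List.mem_flatMap, List.mem_map, List.mem_filter, List.mem_range] at h
    rcases h with ⟨k', hk', hm⟩ | ⟨j, hj, hji⟩
    · split at hm
      · split at hm <;> simp at hm
      · split at hm <;> [split at hm <;> simp at hm; simp at hm]
      · simp at hm
    · simp only [Move.P.injEq] at hji
      subst hji
      have h2 : (sing2At ch j = true ∧ handled ch j = false) ∧ handled ch (j + 1) = false := by simpa using hj.2
      exact ⟨h2.1.1, h2.1.2, h2.2⟩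

theorem nodeAt_some {ch : Chain} {i : ℕ} {a b : Curve} (h : nodeAt ch i = some (a, b)) :
    ch[i]? = some a ∧ ch[i+1]? = some b := by
  unfold nodeAt at h
  cases h1 : ch[i]? <;> cases h2 : ch[i+1]? <;> simp [h1, h2] at h
  obtain ⟨rfl, rfl⟩ := h
  exact ⟨rfl, rfl⟩

theorem mem_ptsOf {n k i : ℕ} (h : i ∈ ptsOf n k) : (1 ≤ k ∧ i + 1 = k) ∨ (k + 1 < n ∧ i = k) := by
  unfold ptsOf at h
  rw [List.mem_append] at h
  rcases h with h | h
  · split at h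
    · simp at h; omega
    · simp at h
  · split at h
    · simp at h; omega
    · simp at h

theorem kindAt_some {ch : Chain} {k : ℕ} {κ : Kind} (h : kindAt ch k = κ) (hκ : κ ≠ .none) :
    ∃ c, ch[k]? = some c ∧ kindOf c = κ := by
  unfold kindAt at h
  cases hc : ch[k]? with
  | none => simp [hc] at h; exact absurd h.symm hκ
  | some c => simp [hc] at h; exact ⟨c, rfl, h⟩

theorem jumpN_of_bd {a b : Curve} (ha : a.bd = true) (hb : b.bd = true) : jumpN a b = topN a b := by
  simp [jumpN, resid, ha, hb]


theorem F2_P (topj : ℕ) (ch : Chain) (i : ℕ) (h : Move.P i ∈ legalMoves topj ch) (ht : topAt ch i = false) :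
    ∃ a b, nodeAt ch i = some (a, b) ∧ ∃ x y : ℕ, a.w.w0 = some x ∧ b.w.w0 = some y ∧ x + y = 2 ∧
      (blowup ch i 2)[i + 1]? = some ⟨⟨some 0, (a.w.add b.w).w1.map (· + 1 - 2), (a.w.add b.w).w2.map (· + 2 - 2)⟩,
        a.w3 + b.w3 + 3 - 2, true⟩ := by
  obtain ⟨hs, _, _⟩ := P_mem_legalMoves topj ch i h
  unfold sing2At at hs; unfold topAt at ht
  cases hn : nodeAt ch i with
  | none => simp [hn] at hs
  | some ab =>
    obtain ⟨a, b⟩ := ab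
    simp only [hn] at hs ht
    obtain ⟨x, y, hx, hy, hxy⟩ := o0_of_sing2_not_top a b hs ht
    obtain ⟨ha, hb⟩ := nodeAt_some hn
    refine ⟨a, b, rfl, x, y, hx, hy, hxy, ?_⟩
    have hlen : i + 1 ≤ ch.length := by
      have := List.getElem?_eq_some_iff.mp hb
      obtain ⟨hlt, _⟩ := this
      omega
    unfold blowup
    simp only [hn]
    rw [List.getElem?_insertIdx_self, if_pos hlen]
    simp [W3.add, hx, hy, wadd_some, hxy]

theorem jumpN_topN {a b : Curve} (h : jumpN a b = true) : topN a b = true := by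
  unfold jumpN at h; simp only [Bool.and_eq_true] at h; exact h.1

theorem topAt_of_jumpAt {ch : Chain} {i : ℕ} (h : jumpAt ch i = true) : topAt ch i = true := by
  unfold jumpAt at h; unfold topAt
  cases hn : nodeAt ch i with
  | none => simp [hn] at h
  | some ab => obtain ⟨a, b⟩ := ab; simp only [hn] at h ⊢; exact jumpN_topN h

/-- An `I i` move is emitted only at a TOP point. -/
theorem I_mem_legalMoves (topj : ℕ) (ch : Chain) (i : ℕ) (h : Move.I i ∈ legalMoves topj ch) : topAt ch i = true := by
  unfold legalMoves at h
  dsimp only at h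
  split at h
  · simp at h
  · simp only [List.mem_append, List.mem_flatMap, List.mem_map, List.mem_filter, List.mem_range] at h
    rcases h with ⟨k', hk', hm⟩ | ⟨j, hj, hji⟩
    · split at hm
      · split at hm
        · simp at hm
        · simp only [List.mem_map, List.mem_filter, Move.I.injEq] at hm
          obtain ⟨i', ⟨_, hc⟩, rfl⟩ := hm
          rcases Bool.or_eq_true_iff.mp hc with hc | hc
          · exact topAt_of_jumpAt hc
          · exact (Bool.and_eq_true_iff.mp hc).2
      · split at hm
        · split at hm
          · simp at hm
          · simp only [List.mem_map, List.mem_filter, Move.I.injEq] at hm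
            obtain ⟨i', ⟨_, hc⟩, rfl⟩ := hm
            rcases Bool.or_eq_true_iff.mp hc with hc | hc
            · exact topAt_of_jumpAt hc
            · exact (Bool.and_eq_true_iff.mp hc).2
        · simp at hm
      · simp at hm
    · simp at hji

/-- A `D k` move is emitted only for a DEEP curve `k`. -/
theorem D_mem_legalMoves (topj : ℕ) (ch : Chain) (k : ℕ) (h : Move.D k ∈ legalMoves topj ch) : kindAt ch k = .deep := by
  unfold legalMoves at h
  dsimp only at h
  generalize hf : List.filter (fun k => kindAt ch k == Kind.deep) (List.range ch.length) = fl at h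
  cases fl with
  | cons k' tl =>
    simp only [List.mem_singleton, Move.D.injEq] at h
    subst h
    have : k ∈ List.filter (fun k => kindAt ch k == Kind.deep) (List.range ch.length) := by rw [hf]; exact List.mem_cons_self
    simpa using (List.mem_filter.mp this).2
  | nil =>
    simp only [List.mem_append, List.mem_flatMap, List.mem_map, List.mem_filter, List.mem_range] at h
    rcases h with ⟨k', hk', hm⟩ | ⟨j, hj, hji⟩
    · split at hm
      · split at hm <;> simp at hm
      · split at hm <;> [split at hm <;> simp at hm; simp at hm]
      · simp at hm
    · simp at hji

theorem kindOf_deep {c : Curve} (h : kindOf c = .deep) : c.bd = true ∧ isDeepW c.w = true := by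
  unfold kindOf at h
  cases hbd : c.bd <;> cases hD : isDeepW c.w <;> cases hS : isSingW c.w <;> cases hC : isCW c.w <;> simp [hbd, hD, hS, hC] at h ⊢

theorem kindOf_bd {c : Curve} (h : kindOf c = .borderline ∨ kindOf c = .light) : c.bd = true := by
  unfold kindOf at h
  cases hbd : c.bd <;> cases hD : isDeepW c.w <;> cases hS : isSingW c.w <;> cases hC : isCW c.w <;> simp [hbd, hD, hS, hC] at h ⊢

theorem ble_false_iff (t n : ℕ) : Nat.ble t n = false ↔ n < t := by
  rw [Bool.eq_false_iff, Ne, Nat.ble_eq, not_le]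

theorem sing2N_mono_left {a a' b : Curve} (ha : a.bd = true) (ha' : a'.bd = true) (d0 d1 d2 : ℕ) (hw : a'.w = a.w.sub d0 d1 d2)
    (h : sing2N a b = false) : sing2N a' b = false := by
  rw [Bool.eq_false_iff] at h ⊢
  intro h'; apply h
  unfold sing2N resid at h' ⊢
  rw [hw] at h'
  rcases a with ⟨⟨_ | a0, _ | a1, _ | a2⟩, a3, abd⟩ <;> rcases a' with ⟨w', a3', abd'⟩ <;> rcases b with ⟨⟨_ | b0, _ | b1, _ | b2⟩, b3, _ | _⟩ <;>
    simp only at ha ha' hw <;> subst ha ha' hw <;> (simp only [ble_false_iff, Nat.ble_eq, isDeepW, isSingW, isCW, W3.ge, W3.add, W3.sub, finPos, wge_some, wge_none, wadd_some, wadd_none_l, wadd_none_r, Option.map_some, Option.map_none, Option.map, Bool.and_eq_true, Bool.or_eq_true, Bool.not_eq_true', Bool.not_eq_eq_eq_not, Bool.not_true, Bool.not_false, Bool.and_eq_false_eq_eq_false_or_eq_false, decide_eq_true_eq, decide_eq_false_iff_not, not_le, Bool.true_and, Bool.and_true, true_and, and_true, Bool.false_eq_true, Bool.true_eq_false, false_or,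 or_false, Option.some.injEq, reduceCtorEq, false_and, and_false, or_true, true_or, exists_and_left, exists_and_right, exists_eq_left, exists_eq_left', exists_eq_right, exists_eq_right', exists_eq', exists_false, exists_const, false_iff, iff_false, not_false_eq_true, not_true_eq_false, ite_true, ite_false, if_true, if_false, Bool.true_or, Bool.or_true, Bool.false_or, Bool.or_false, imp_false, not_lt] at *) <;> omega

theorem sing2N_mono_right {a b b' : Curve} (hb : b.bd = true) (hb' : b'.bd = true) (d0 d1 d2 : ℕ) (hw : b'.w = b.w.sub d0 d1 d2)
    (h : sing2N a b = false) : sing2N a b' = false := by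
  rw [Bool.eq_false_iff] at h ⊢
  intro h'; apply h
  unfold sing2N resid at h' ⊢
  rw [hw] at h'
  rcases b with ⟨⟨_ | b0, _ | b1, _ | b2⟩, b3, bbd⟩ <;> rcases b' with ⟨w', b3', bbd'⟩ <;> rcases a with ⟨⟨_ | a0, _ | a1, _ | a2⟩, a3, _ | _⟩ <;>
    simp only at hb hb' hw <;> subst hb hb' hw <;> (simp only [ble_false_iff, Nat.ble_eq, isDeepW, isSingW, isCW, W3.ge, W3.add, W3.sub, finPos, wge_some, wge_none, wadd_some, wadd_none_l, wadd_none_r, Option.map_some, Option.map_none, Option.map, Bool.and_eq_true, Bool.or_eq_true, Bool.not_eq_true', Bool.not_eq_eq_eq_not, Bool.not_true, Bool.not_false, Bool.and_eq_false_eq_eq_false_or_eq_false, decide_eq_true_eq, decide_eq_false_iff_not, not_le, Bool.true_and, Bool.and_true, true_and, and_true, Bool.false_eq_true, Bool.true_eq_false, false_or, or_false, Option.some.injEq, reduceCtorEq, false_and, and_false, or_true, true_or, exists_and_left, exists_and_right, exists_eq_left, exists_eq_left', exists_eq_right, exists_eq_right', exists_eq', exists_false, exists_const, false_iff, iff_false,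 not_false_eq_true, not_true_eq_false, ite_true, ite_false, if_true, if_false, Bool.true_or, Bool.or_true, Bool.false_or, Bool.or_false, imp_false, not_lt] at *) <;> omega


theorem mem_modify_cases {ch : Chain} {k : ℕ} {f : Curve → Curve} {c : Curve} (h : c ∈ ch.modify k f) :
    c ∈ ch ∨ ∃ c₀, ch[k]? = some c₀ ∧ c = f c₀ := by
  obtain ⟨j, hj⟩ := List.mem_iff_getElem?.mp h
  rw [List.getElem?_modify] at hj
  cases hc : ch[j]? with
  | none => simp [hc] at hj
  | some c₀ =>
    simp [hc] at hj
    by_cases hkj : k = j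
    · subst hkj; simp at hj; exact Or.inr ⟨c₀, hc, hj.symm⟩
    · simp [hkj] at hj; subst hj; exact Or.inl (List.mem_of_getElem? hc)

theorem nodeAt_modify_cases {ch : Chain} {k : ℕ} {f : Curve → Curve} {j : ℕ} {a' b' : Curve}
    (h : nodeAt (ch.modify k f) j = some (a', b')) :
    ∃ a b, nodeAt ch j = some (a, b) ∧ a' = (if k = j then f a else a) ∧ b' = (if k = j + 1 then f b else b) := by
  unfold nodeAt at h ⊢
  rw [List.getElem?_modify, List.getElem?_modify] at h
  cases ha : ch[j]? with
  | none => simp [ha] at h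
  | some a =>
    cases hb : ch[j+1]? with
    | none => simp [ha, hb] at h
    | some b =>
      refine ⟨a, b, rfl, ?_, ?_⟩
      · by_cases h1 : k = j
        · subst h1; simp [ha, hb] at h; rw [if_pos rfl]; exact h.1.symm
        · simp [ha, hb, h1] at h; rw [if_neg h1]; exact h.1.symm
      · by_cases h2 : k = j + 1
        · subst h2; simp [ha, hb] at h; rw [if_pos rfl]; exact h.2.symm
        · simp [ha, hb, h2] at h; rw [if_neg h2]; exact h.2.symm

theorem nodeAt_insertIdx_cases {ch : Chain} {i : ℕ} {Γ : Curve} {j : ℕ} {a' b' : Curve} (hi : i + 1 ≤ ch.length)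
    (h : nodeAt (ch.insertIdx (i + 1) Γ) j = some (a', b')) :
    nodeAt ch j = some (a', b') ∨ (j = i ∧ ch[i]? = some a' ∧ b' = Γ) ∨ (j = i + 1 ∧ a' = Γ ∧ ch[i+1]? = some b') ∨
      (i + 2 ≤ j ∧ nodeAt ch (j - 1) = some (a', b')) := by
  unfold nodeAt at h ⊢
  rw [List.getElem?_insertIdx, List.getElem?_insertIdx] at h
  rcases Nat.lt_trichotomy j i with hlt | heq | hgt
  · rw [if_pos (by omega : j < i + 1), if_pos (by omega : j + 1 < i + 1)] at h
    exact Or.inl h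
  · subst heq
    rw [if_pos (by omega : j < j + 1), if_neg (lt_irrefl _), if_pos rfl, if_pos hi] at h
    cases ha : ch[j]? with
    | none => simp [ha] at h
    | some a => simp [ha] at h; exact Or.inr (Or.inl ⟨rfl, by rw [h.1], h.2.symm⟩)
  · rcases Nat.lt_or_ge j (i + 2) with hj | hj
    · have hji : j = i + 1 := by omega
      subst hji
      rw [if_neg (lt_irrefl _), if_pos rfl, if_pos hi, if_neg (by omega : ¬ i + 1 + 1 < i + 1),
        if_neg (by omega : i + 1 + 1 ≠ i + 1), Nat.add_sub_cancel] at h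
      cases hb : ch[i+1]? with
      | none => simp [hb] at h
      | some b => simp [hb] at h; exact Or.inr (Or.inr (Or.inl ⟨rfl, h.1.symm, by rw [h.2]⟩))
    · rw [if_neg (by omega : ¬ j < i + 1), if_neg (by omega : j ≠ i + 1), if_neg (by omega : ¬ j + 1 < i + 1),
        if_neg (by omega : j + 1 ≠ i + 1), Nat.add_sub_cancel] at h
      refine Or.inr (Or.inr (Or.inr ⟨hj, ?_⟩))
      rw [Nat.sub_add_cancel (by omega : 1 ≤ j)]
      exact h

theorem applyMoves_cons (ch : Chain) (m : Move) (l : List Move) : applyMoves ch (m :: l) = applyMoves (applyMove ch m) l := rfl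

theorem isLegalPlay_cons {topj : ℕ} {ch : Chain} {m : Move} {l : List Move} (h : isLegalPlay topj ch (m :: l) = true) :
    m ∈ legalMoves topj ch ∧ isLegalPlay topj (applyMove ch m) l = true := by
  simp only [isLegalPlay, Bool.and_eq_true] at h
  exact ⟨by simpa using h.1, h.2⟩

theorem isLegalPlay_append {topj : ℕ} : ∀ (l₁ l₂ : List Move) (ch : Chain),
    isLegalPlay topj ch (l₁ ++ l₂) = true → isLegalPlay topj ch l₁ = true ∧ isLegalPlay topj (applyMoves ch l₁) l₂ = true := by
  intro l₁
  induction l₁ with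
  | nil => intro l₂ ch h; exact ⟨rfl, h⟩
  | cons m l ih =>
    intro l₂ ch h
    rw [List.cons_append] at h
    obtain ⟨hm, hl⟩ := isLegalPlay_cons h
    obtain ⟨h1, h2⟩ := ih l₂ (applyMove ch m) hl
    refine ⟨?_, by rw [applyMoves_cons]; exact h2⟩
    simp only [isLegalPlay, Bool.and_eq_true]
    exact ⟨by simpa using hm, h1⟩

theorem bd_applyMove {ch : Chain} (hbd : ∀ c ∈ ch, c.bd = true) (m : Move) : ∀ c ∈ applyMove ch m, c.bd = true := by
  intro c hc
  have hmod : ∀ (k : ℕ) (f : Curve → Curve), (∀ c, (f c).bd = c.bd) → c ∈ ch.modify k f → c.bd = true := by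
    intro k f hf hc
    rcases mem_modify_cases hc with hc | ⟨c₀, hc₀, rfl⟩
    · exact hbd c hc
    · rw [hf]; exact hbd c₀ (List.mem_of_getElem? hc₀)
  have hbl : ∀ (i α : ℕ), c ∈ blowup ch i α → c.bd = true := by
    intro i α hc
    unfold blowup at hc
    cases hn : nodeAt ch i with
    | none => simp only [hn] at hc; exact hbd c hc
    | some ab =>
      obtain ⟨a, b⟩ := ab
      simp only [hn] at hc
      rcases List.eq_or_mem_of_mem_insertIdx hc with rfl | hc
      · rfl
      · exact hbd c hc
  cases m with
  | D k => exact hmod k (fun c => { c with w := c.w.sub 3 2 1 }) (fun _ => rfl) hc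
  | A k => exact hmod k (fun c => { c with w := c.w.sub 2 1 0, w3 := c.w3 + 1 }) (fun _ => rfl) hc
  | AL k => exact hmod k (fun c => { c with w := c.w.sub 2 1 0, w3 := c.w3 + 1 }) (fun _ => rfl) hc
  | I i => exact hbl i 3 hc
  | P i => exact hbl i _ hc


theorem kindOf_borderline {c : Curve} (h : kindOf c = .borderline) : c.bd = true ∧ isSingW c.w = true ∧ isDeepW c.w = false := by
  unfold kindOf at h
  cases hbd : c.bd <;> cases hD : isDeepW c.w <;> cases hS : isSingW c.w <;> cases hC : isCW c.w <;> simp [hbd, hD, hS, hC] at h ⊢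

theorem kindOf_light {c : Curve} (h : kindOf c = .light) : c.bd = true ∧ isCW c.w = true ∧ isSingW c.w = false := by
  unfold kindOf at h
  cases hbd : c.bd <;> cases hD : isDeepW c.w <;> cases hS : isSingW c.w <;> cases hC : isCW c.w <;> simp [hbd, hD, hS, hC] at h ⊢

theorem kindOf_of_singW {c : Curve} (hb : c.bd = true) (hs : isSingW c.w = true) : kindOf c = .deep ∨ kindOf c = .borderline := by
  unfold kindOf
  cases hD : isDeepW c.w <;> simp [hb, hD, hs]

theorem kindOf_of_CW {c : Curve} (hb : c.bd = true) (hc : isCW c.w = true) :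
    kindOf c = .deep ∨ kindOf c = .borderline ∨ kindOf c = .light := by
  unfold kindOf
  cases hD : isDeepW c.w <;> cases hS : isSingW c.w <;> simp [hb, hD, hS, hc]

theorem singW_of_deepW {w : W3} (h : isDeepW w = true) : isSingW w = true := by
  rcases w with ⟨_ | a, _ | b, _ | c⟩ <;> (simp only [ble_false_iff, Nat.ble_eq, isDeepW, isSingW, isCW, W3.ge, W3.add, W3.sub, finPos, wge_some, wge_none, wadd_some, wadd_none_l, wadd_none_r, Option.map_some, Option.map_none, Option.map, Bool.and_eq_true, Bool.or_eq_true, Bool.not_eq_true', Bool.not_eq_eq_eq_not, Bool.not_true, Bool.not_false, Bool.and_eq_false_eq_eq_false_or_eq_false, decide_eq_true_eq, decide_eq_false_iff_not, not_le, Bool.true_and, Bool.and_true, true_and, and_true, Bool.false_eq_true, Bool.true_eq_false, false_or, or_false, Option.some.injEq, reduceCtorEq, false_and, and_false, or_true, true_or, exists_and_left, exists_and_right, exists_eq_left, exists_eq_left', exists_eq_right, exists_eq_right', exists_eq', exists_false, exists_const, false_iff, iff_false, not_false_eq_true, not_true_eq_false, ite_true, ite_false, if_true, if_false, Bool.true_or,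 Bool.or_true, Bool.false_or, Bool.or_false, imp_false, not_lt] at *) <;> omega

theorem CW_of_singW {w : W3} (h : isSingW w = true) : isCW w = true := by
  rcases w with ⟨_ | a, _ | b, _ | c⟩ <;> (simp only [ble_false_iff, Nat.ble_eq, isDeepW, isSingW, isCW, W3.ge, W3.add, W3.sub, finPos, wge_some, wge_none, wadd_some, wadd_none_l, wadd_none_r, Option.map_some, Option.map_none, Option.map, Bool.and_eq_true, Bool.or_eq_true, Bool.not_eq_true', Bool.not_eq_eq_eq_not, Bool.not_true, Bool.not_false, Bool.and_eq_false_eq_eq_false_or_eq_false, decide_eq_true_eq, decide_eq_false_iff_not, not_le, Bool.true_and, Bool.and_true, true_and, and_true, Bool.false_eq_true, Bool.true_eq_false, false_or, or_false, Option.some.injEq, reduceCtorEq, false_and, and_false, or_true, true_or, exists_and_left, exists_and_right, exists_eq_left, exists_eq_left', exists_eq_right, exists_eq_right', exists_eq', exists_false, exists_const, false_iff, iff_false, not_false_eq_true, not_true_eq_false, ite_true, ite_false, if_true, if_false, Bool.true_or, Bool.or_true, Bool.false_or, Bool.or_false, imp_false, not_lt] at *) <;> omega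


theorem handled_of_singW {ch : Chain} {k : ℕ} {c : Curve} (hc : ch[k]? = some c) (hb : c.bd = true) (hs : isSingW c.w = true) :
    handled ch k = true := by
  unfold handled
  have hk : kindAt ch k = kindOf c := by unfold kindAt; simp only [hc]
  rcases kindOf_of_singW hb hs with h | h <;> simp [hk, h]

theorem handled_of_CW_sing2 {ch : Chain} {k i : ℕ} {c : Curve} (hc : ch[k]? = some c) (hb : c.bd = true) (hcw : isCW c.w = true)
    (hi : i ∈ ptsOf ch.length k) (hs : sing2At ch i = true) : handled ch k = true := by
  unfold handled relevantLight
  have hk : kindAt ch k = kindOf c := by unfold kindAt; simp only [hc]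
  have hany : (ptsOf ch.length k).any (sing2At ch) = true := List.any_eq_true.mpr ⟨i, hi, hs⟩
  rcases kindOf_of_CW hb hcw with h | h | h <;> simp [hk, h, hany]

/-! ### no top point on an accepted curve -/

/-- what the neighbours' step needs from legality: an `A`/`AL`-accepted curve has no TOP point (true under `G_mult`, and in mode `uv`
for any rule set) -/
def AccFacts (topj : ℕ) (ch : Chain) : Prop :=
  ∀ k, (Move.A k ∈ legalMoves topj ch ∨ Move.AL k ∈ legalMoves topj ch) → ∀ i ∈ ptsOf ch.length k, topAt ch i = false

theorem AccFacts_of_topj {topj : ℕ} (htop : 2 ≤ topj) (ch : Chain) : AccFacts topj ch := by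
  intro k hk i hi
  have hb2 : Nat.ble 2 topj = true := by simpa [Nat.ble_eq] using htop
  have hb1 : Nat.ble 1 topj = true := by simp [Nat.ble_eq]; omega
  rcases hk with hk | hk
  · have := (A_mem_legalMoves topj ch k hk).2 i hi
    rw [hb2] at this; exact ((by simpa using this) : jumpAt ch i = false ∧ topAt ch i = false).2
  · have := (AL_mem_legalMoves topj ch k hk).2.2 i hi
    rw [hb1] at this; exact ((by simpa using this) : jumpAt ch i = false ∧ topAt ch i = false).2

theorem topAt_false_of_bd {ch : Chain} (hbd : ∀ c ∈ ch, c.bd = true) {i : ℕ} (hj : jumpAt ch i = false) : topAt ch i = false := by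
  unfold jumpAt at hj; unfold topAt
  cases hn : nodeAt ch i with
  | none => simp [hn]
  | some ab =>
    obtain ⟨a, b⟩ := ab
    simp only [hn] at hj ⊢
    obtain ⟨ha, hb'⟩ := nodeAt_some hn
    rw [jumpN_of_bd (hbd a (List.mem_of_getElem? ha)) (hbd b (List.mem_of_getElem? hb'))] at hj
    exact hj

theorem AccFacts_of_bd (topj : ℕ) (ch : Chain) (hbd : ∀ c ∈ ch, c.bd = true) : AccFacts topj ch := by
  intro k hk i hi
  rcases hk with hk | hk
  · have := (A_mem_legalMoves topj ch k hk).2 i hi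
    exact topAt_false_of_bd hbd (by simpa using (Bool.or_eq_false_iff.mp this).1)
  · have := (AL_mem_legalMoves topj ch k hk).2.2 i hi
    exact topAt_false_of_bd hbd (by simpa using (Bool.or_eq_false_iff.mp this).1)

/-! ### node invariants: generic transport -/



theorem mem_ptsOf_left {n k j : ℕ} (h : j + 1 = k) : j ∈ ptsOf n k := by
  unfold ptsOf; rw [List.mem_append]; left; rw [if_pos (by omega)]; simp; omega

theorem mem_ptsOf_right {n k : ℕ} (h : k + 1 < n) : k ∈ ptsOf n k := by
  unfold ptsOf; rw [List.mem_append]; right; rw [if_pos h]; simp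


/-- CORE OF (F2): if curve `k` is light or borderline with finite `w₀ = x ≥ 2`… precisely: at a Sing₂, non-top point `i` of a curve
`k` whose `w₀` is finite and `≥ 2`, the node order is `o₀ = 2`: the curve has `w₀ = 2` and the partner `w₀ = 0`. -/
theorem node_of_sing2_not_top {ch : Chain} {k i : ℕ} {c : Curve} (hc : ch[k]? = some c) (hw : ∀ x, c.w.w0 = some x → 2 ≤ x)
    (hi : i ∈ ptsOf ch.length k) (hs : sing2At ch i = true) (ht : topAt ch i = false) :
    c.w.w0 = some 2 ∧ ∃ a b, nodeAt ch i = some (a, b) ∧ ∃ x y : ℕ, a.w.w0 = some x ∧ b.w.w0 = some y ∧ x + y = 2 := by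
  unfold sing2At at hs; unfold topAt at ht
  cases hn : nodeAt ch i with
  | none => simp [hn] at hs
  | some ab =>
    obtain ⟨a, b⟩ := ab
    simp only [hn] at hs ht
    obtain ⟨x, y, hx, hy, hxy⟩ := o0_of_sing2_not_top a b hs ht
    obtain ⟨ha, hb⟩ := nodeAt_some hn
    rcases mem_ptsOf hi with ⟨h1, hik⟩ | ⟨_, rfl⟩
    · -- i + 1 = k : the curve is `b`
      subst hik
      rw [hc] at hb
      obtain rfl : c = b := by simpa using hb
      have := hw y hy
      refine ⟨by rw [hy]; congr 1; omega, a, c, rfl, x, y, hx, hy, by omega⟩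
    · -- i = k : the curve is `a`
      rw [hc] at ha
      obtain rfl : c = a := by simpa using ha
      have := hw x hx
      refine ⟨by rw [hx]; congr 1; omega, c, b, rfl, x, y, hx, hy, by omega⟩

/-! ## §T1. The pair measure — arithmetic core (scaled values `x_b = (6/θ_b)·w_b`, all thresholds become 6). -/

/-- Euclid term of one pair of grades: `|Δa| + |Δb|` if the defects `Δa = x − x'`, `Δb = y − y'` have strictly opposite signs, else 0. -/
def E (x x' y y' : ℕ) : ℕ :=
  if x' < x ∧ y < y' then (x - x') + (y' - y) else if x < x' ∧ y' < y then (x' - x) + (y - y') else 0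

theorem E_child_left_le (x x' y y' j : ℕ) (hj : j ≤ x + y) (hj' : j ≤ x' + y') :
    E x x' (x + y - j) (x' + y' - j) ≤ E x x' y y' := by
  unfold E; split_ifs <;> omega

theorem E_child_right_le (x x' y y' j : ℕ) (hj : j ≤ x + y) (hj' : j ≤ x' + y') :
    E (x + y - j) (x' + y' - j) y y' ≤ E x x' y y' := by
  unfold E; split_ifs <;> omega

theorem E_child_left_lt (x x' y y' j : ℕ) (hj : j ≤ x + y) (hj' : j ≤ x' + y')
    (hopp : (x' < x ∧ y < y') ∨ (x < x' ∧ y' < y)) : E x x' (x + y - j) (x' + y' - j) < E x x' y y' := by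
  unfold E; split_ifs <;> omega

theorem E_child_right_lt (x x' y y' j : ℕ) (hj : j ≤ x + y) (hj' : j ≤ x' + y')
    (hopp : (x' < x ∧ y < y') ∨ (x < x' ∧ y' < y)) : E (x + y - j) (x' + y' - j) y y' < E x x' y y' := by
  unfold E; split_ifs <;> omega

theorem E_of_not_opp (x x' y y' : ℕ) (h : ¬ ((x' < x ∧ y < y') ∨ (x < x' ∧ y' < y))) : E x x' y y' = 0 := by
  unfold E; split_ifs <;> omega

/-- compatible orders (no pair of grades with strictly opposite defects): one grade minimises `x`, `y` and `x + y` at once -/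
theorem min3_add_of_compat (x0 x1 x2 y0 y1 y2 : ℕ) (o01 : ¬ ((x1 < x0 ∧ y0 < y1) ∨ (x0 < x1 ∧ y1 < y0)))
    (o02 : ¬ ((x2 < x0 ∧ y0 < y2) ∨ (x0 < x2 ∧ y2 < y0))) (o12 : ¬ ((x2 < x1 ∧ y1 < y2) ∨ (x1 < x2 ∧ y2 < y1))) :
    min (x0 + y0) (min (x1 + y1) (x2 + y2)) = min x0 (min x1 x2) + min y0 (min y1 y2) := by
  simp only [Nat.min_def]; split_ifs <;> omega

theorem min2_add_of_compat (x0 x1 y0 y1 : ℕ) (o01 : ¬ ((x1 < x0 ∧ y0 < y1) ∨ (x0 < x1 ∧ y1 < y0))) :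
    min (x0 + y0) (x1 + y1) = min x0 x1 + min y0 y1 := by
  simp only [Nat.min_def]; split_ifs <;> omega

theorem min3_sub (a b c j : ℕ) : min (a - j) (min (b - j) (c - j)) = min a (min b c) - j := by
  simp only [Nat.min_def]; split_ifs <;> omega

theorem min2_sub (a b j : ℕ) : min (a - j) (b - j) = min a b - j := by
  simp only [Nat.min_def]; split_ifs <;> omega

/-- the pair measure for THREE finite grades -/
def M3 (x0 x1 x2 y0 y1 y2 : ℕ) : ℕ :=
  6 * (E x0 x1 y0 y1 + E x0 x2 y0 y2 + E x1 x2 y1 y2) + min (min x0 (min x1 x2)) (min y0 (min y1 y2))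

/-- the pair measure for TWO finite grades -/
def M2 (x0 x1 y0 y1 : ℕ) : ℕ := 6 * E x0 x1 y0 y1 + min (min x0 x1) (min y0 y1)

/-- the pair measure for ONE finite grade -/
def M1 (x0 y0 : ℕ) : ℕ := min x0 y0

/-- CORE LEMMA, three grades: at a TOP pair of settled curves (`min x < 6`, `min y < 6`, `x_b + y_b ≥ 6` for all `b`) the settled
newborn `z = x + y − 6⌊min_b (x_b + y_b)/6⌋·(1,1,1)` makes both new pairs strictly smaller in the measure. -/
theorem M3_child (x0 x1 x2 y0 y1 y2 : ℕ) (hx : min x0 (min x1 x2) < 6) (hy : min y0 (min y1 y2) < 6)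
    (h0 : 6 ≤ x0 + y0) (h1 : 6 ≤ x1 + y1) (h2 : 6 ≤ x2 + y2) (j : ℕ)
    (hj : j = 6 * (min (x0 + y0) (min (x1 + y1) (x2 + y2)) / 6)) (z0 z1 z2 : ℕ) (hz0 : z0 = x0 + y0 - j)
    (hz1 : z1 = x1 + y1 - j) (hz2 : z2 = x2 + y2 - j) :
    M3 x0 x1 x2 z0 z1 z2 < M3 x0 x1 x2 y0 y1 y2 ∧ M3 z0 z1 z2 y0 y1 y2 < M3 x0 x1 x2 y0 y1 y2 := by
  subst hz0 hz1 hz2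
  have hzmin := min3_sub (x0 + y0) (x1 + y1) (x2 + y2) j
  unfold M3
  rw [hzmin]
  set mx := min x0 (min x1 x2) with hmx
  set my := min y0 (min y1 y2) with hmy
  set s := min (x0 + y0) (min (x1 + y1) (x2 + y2)) with hs
  have hs0 : s ≤ x0 + y0 := Nat.min_le_left _ _
  have hs1 : s ≤ x1 + y1 := le_trans (Nat.min_le_right _ _) (Nat.min_le_left _ _)
  have hs2 : s ≤ x2 + y2 := le_trans (Nat.min_le_right _ _) (Nat.min_le_right _ _)
  have hs6 : 6 ≤ s := le_min h0 (le_min h1 h2)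
  have hjs : j ≤ s := by rw [hj]; exact Nat.mul_div_le s 6
  have hj0 : j ≤ x0 + y0 := le_trans hjs hs0
  have hj1 : j ≤ x1 + y1 := le_trans hjs hs1
  have hj2 : j ≤ x2 + y2 := le_trans hjs hs2
  have a01 := E_child_left_le x0 x1 y0 y1 j hj0 hj1
  have a02 := E_child_left_le x0 x2 y0 y2 j hj0 hj2
  have a12 := E_child_left_le x1 x2 y1 y2 j hj1 hj2
  have b01 := E_child_right_le x0 x1 y0 y1 j hj0 hj1
  have b02 := E_child_right_le x0 x2 y0 y2 j hj0 hj2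
  have b12 := E_child_right_le x1 x2 y1 y2 j hj1 hj2
  have u1 : min mx (s - j) ≤ mx := Nat.min_le_left _ _
  have u2 : min (s - j) my ≤ my := Nat.min_le_right _ _
  set mz1 := min mx (s - j) with hmz1
  set mz2 := min (s - j) my with hmz2
  set mxy := min mx my with hmxy
  by_cases o01 : (x1 < x0 ∧ y0 < y1) ∨ (x0 < x1 ∧ y1 < y0)
  · have c := E_child_left_lt x0 x1 y0 y1 j hj0 hj1 o01
    have d := E_child_right_lt x0 x1 y0 y1 j hj0 hj1 o01
    constructor <;> omega
  by_cases o02 : (x2 < x0 ∧ y0 < y2) ∨ (x0 < x2 ∧ y2 < y0)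
  · have c := E_child_left_lt x0 x2 y0 y2 j hj0 hj2 o02
    have d := E_child_right_lt x0 x2 y0 y2 j hj0 hj2 o02
    constructor <;> omega
  by_cases o12 : (x2 < x1 ∧ y1 < y2) ∨ (x1 < x2 ∧ y2 < y1)
  · have c := E_child_left_lt x1 x2 y1 y2 j hj1 hj2 o12
    have d := E_child_right_lt x1 x2 y1 y2 j hj1 hj2 o12
    constructor <;> omega
  -- compatible orders: one grade minimises x, y and x + y simultaneously, so s = mx + my < 12, j = 6, and mz = mx + my − 6 < min mx my
  have hsum : s = mx + my := by rw [hs, hmx, hmy]; exact min3_add_of_compat x0 x1 x2 y0 y1 y2 o01 o02 o12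
  have hj6 : j = 6 := by omega
  have hz1 : mz1 ≤ s - j := Nat.min_le_right _ _
  have hz2 : mz2 ≤ s - j := Nat.min_le_left _ _
  have hlt : s - j < mxy := lt_min (by omega) (by omega)
  constructor <;> omega

theorem M2_child (x0 x1 y0 y1 : ℕ) (hx : min x0 x1 < 6) (hy : min y0 y1 < 6) (h0 : 6 ≤ x0 + y0) (h1 : 6 ≤ x1 + y1) (j : ℕ)
    (hj : j = 6 * (min (x0 + y0) (x1 + y1) / 6)) (z0 z1 : ℕ) (hz0 : z0 = x0 + y0 - j) (hz1 : z1 = x1 + y1 - j) :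
    M2 x0 x1 z0 z1 < M2 x0 x1 y0 y1 ∧ M2 z0 z1 y0 y1 < M2 x0 x1 y0 y1 := by
  subst hz0 hz1
  have hzmin := min2_sub (x0 + y0) (x1 + y1) j
  unfold M2
  rw [hzmin]
  set mx := min x0 x1 with hmx
  set my := min y0 y1 with hmy
  set s := min (x0 + y0) (x1 + y1) with hs
  have hs0 : s ≤ x0 + y0 := Nat.min_le_left _ _
  have hs1 : s ≤ x1 + y1 := Nat.min_le_right _ _
  have hs6 : 6 ≤ s := le_min h0 h1
  have hjs : j ≤ s := by rw [hj]; exact Nat.mul_div_le s 6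
  have hj0 : j ≤ x0 + y0 := le_trans hjs hs0
  have hj1 : j ≤ x1 + y1 := le_trans hjs hs1
  have a01 := E_child_left_le x0 x1 y0 y1 j hj0 hj1
  have b01 := E_child_right_le x0 x1 y0 y1 j hj0 hj1
  have u1 : min mx (s - j) ≤ mx := Nat.min_le_left _ _
  have u2 : min (s - j) my ≤ my := Nat.min_le_right _ _
  set mz1 := min mx (s - j) with hmz1
  set mz2 := min (s - j) my with hmz2
  set mxy := min mx my with hmxy
  by_cases o01 : (x1 < x0 ∧ y0 < y1) ∨ (x0 < x1 ∧ y1 < y0)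
  · have c := E_child_left_lt x0 x1 y0 y1 j hj0 hj1 o01
    have d := E_child_right_lt x0 x1 y0 y1 j hj0 hj1 o01
    constructor <;> omega
  have hsum : s = mx + my := by rw [hs, hmx, hmy]; exact min2_add_of_compat x0 x1 y0 y1 o01
  have hj6 : j = 6 := by omega
  have hz1 : mz1 ≤ s - j := Nat.min_le_right _ _
  have hz2 : mz2 ≤ s - j := Nat.min_le_left _ _
  have hlt : s - j < mxy := lt_min (by omega) (by omega)
  constructor <;> omega

theorem M1_child (x0 y0 : ℕ) (hx : x0 < 6) (hy : y0 < 6) (h0 : 6 ≤ x0 + y0) (j : ℕ) (hj : j = 6 * ((x0 + y0) / 6)) :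
    M1 x0 (x0 + y0 - j) < M1 x0 y0 ∧ M1 (x0 + y0 - j) y0 < M1 x0 y0 := by
  unfold M1; constructor <;> omega


/-! ## §T2. The pair measure on weight vectors: scaled values, settling, `Mp`, `phi`, and the splitting inequality. -/

/-- pattern of finite grades (`g_b ≢ 0`); it is the same for all curves of a chain (an invariant of the game) -/
def pat (w : W3) : Bool × Bool × Bool := (w.w0.isSome, w.w1.isSome, w.w2.isSome)

/-- `min` over the finite grades of the SCALED values `(2w₀, 3w₁, 6w₂)` (so that every threshold `θ_b` becomes 6); 0 if no grade is finite -/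
def mval (w : W3) : ℕ :=
  match w.w0, w.w1, w.w2 with
  | some a, some b, some c => min (2 * a) (min (3 * b) (6 * c))
  | some a, some b, none => min (2 * a) (3 * b)
  | some a, none, some c => min (2 * a) (6 * c)
  | none, some b, some c => min (3 * b) (6 * c)
  | some a, none, none => 2 * a
  | none, some b, none => 3 * b
  | none, none, some c => 6 * c
  | none, none, none => 0

/-- number of deep accepts (`D` moves, `w ↦ w − θ`) a curve takes before it is non-deep -/
def settleK (w : W3) : ℕ := mval w / 6

/-- the SETTLED weight `w − ⌊ν(w)⌋·θ` -/
def settle (w : W3) : W3 := w.sub (3 * settleK w) (2 * settleK w) (settleK w)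

/-- the PAIR MEASURE `M′(a,b) = 6·Σ_{b<b′} E_{bb′}(a,b) + min(m(a), m(b))` of two weight vectors with the same pattern (0 on mixed patterns) -/
def Mp (a b : W3) : ℕ :=
  match a.w0, a.w1, a.w2, b.w0, b.w1, b.w2 with
  | some a0, some a1, some a2, some b0, some b1, some b2 => M3 (2 * a0) (3 * a1) (6 * a2) (2 * b0) (3 * b1) (6 * b2)
  | some a0, some a1, none, some b0, some b1, none => M2 (2 * a0) (3 * a1) (2 * b0) (3 * b1)
  | some a0, none, some a2, some b0, none, some b2 => M2 (2 * a0) (6 * a2) (2 * b0) (6 * b2)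
  | none, some a1, some a2, none, some b1, some b2 => M2 (3 * a1) (6 * a2) (3 * b1) (6 * b2)
  | some a0, none, none, some b0, none, none => M1 (2 * a0) (2 * b0)
  | none, some a1, none, none, some b1, none => M1 (3 * a1) (3 * b1)
  | none, none, some a2, none, none, some b2 => M1 (6 * a2) (6 * b2)
  | _, _, _, _, _, _ => 0

/-- the node potential `φ(a,b) = [a + b ≥ θ]·(2^{M′(a,b)} − 1)` -/
def phi (a b : W3) : ℕ := if isDeepW (a.add b) = true then 2 ^ Mp a b - 1 else 0

/-- the newborn weight of an exponent-3 blow-up of the node `(a, b)`, literally as `blowup` builds it -/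
def nb3 (a b : W3) : W3 := ⟨(a.add b).w0.map (· - 3), (a.add b).w1.map (· + 1 - 3), (a.add b).w2.map (· + 2 - 3)⟩

theorem Mp_child (a b : W3) (hp : pat a = pat b) (hne : pat a ≠ (false, false, false)) (ha : isDeepW a = false)
    (hb : isDeepW b = false) (ht : isDeepW (a.add b) = true) :
    Mp a (settle (nb3 a b)) < Mp a b ∧ Mp (settle (nb3 a b)) b < Mp a b := by
  rcases a with ⟨_ | a0, _ | a1, _ | a2⟩ <;> rcases b with ⟨_ | b0, _ | b1, _ | b2⟩ <;>
    simp only [pat, Option.isSome_some, Option.isSome_none, Prod.mk.injEq, Bool.true_eq_false, Bool.false_eq_true,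
      and_true, true_and, and_false, false_and, ne_eq, not_true_eq_false, not_false_eq_true, and_self] at hp hne <;>
    simp only [isDeepW, W3.ge, W3.add, wge_some, wge_none, wadd_some, wadd_none_l, wadd_none_r, Bool.and_eq_true, Bool.true_and,
      Bool.and_true, decide_eq_true_eq, Bool.and_eq_false_eq_eq_false_or_eq_false, decide_eq_false_iff_not, not_le,
      Bool.true_eq_false, or_false, false_or] at ha hb ht <;>
    simp only [Mp, settle, settleK, mval, nb3, W3.add, W3.sub, wadd_some, wadd_none_l, wadd_none_r, Option.map_some,
      Option.map_none]
  case some.some.some.some.some.some =>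
    have e0 : 2 * (a0 + b0 - 3) = (2 * a0 + 2 * b0) - 6 := by omega
    have e1 : 3 * (a1 + b1 + 1 - 3) = (3 * a1 + 3 * b1) - 6 := by omega
    have e2 : 6 * (a2 + b2 + 2 - 3) = (6 * a2 + 6 * b2) - 6 := by omega
    rw [e0, e1, e2, min3_sub]
    have hS0 : min (2 * a0 + 2 * b0) (min (3 * a1 + 3 * b1) (6 * a2 + 6 * b2)) ≤ 2 * a0 + 2 * b0 := Nat.min_le_left _ _
    have hS1 : min (2 * a0 + 2 * b0) (min (3 * a1 + 3 * b1) (6 * a2 + 6 * b2)) ≤ 3 * a1 + 3 * b1 :=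
      le_trans (Nat.min_le_right _ _) (Nat.min_le_left _ _)
    have hS2 : min (2 * a0 + 2 * b0) (min (3 * a1 + 3 * b1) (6 * a2 + 6 * b2)) ≤ 6 * a2 + 6 * b2 :=
      le_trans (Nat.min_le_right _ _) (Nat.min_le_right _ _)
    have hS6 : 6 ≤ min (2 * a0 + 2 * b0) (min (3 * a1 + 3 * b1) (6 * a2 + 6 * b2)) := le_min (by omega) (le_min (by omega) (by omega))
    generalize hS : min (2 * a0 + 2 * b0) (min (3 * a1 + 3 * b1) (6 * a2 + 6 * b2)) = S at hS0 hS1 hS2 hS6 ⊢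
    exact M3_child (2 * a0) (3 * a1) (6 * a2) (2 * b0) (3 * b1) (6 * b2) (by omega) (by omega) (by omega) (by omega) (by omega)
      (6 * (S / 6)) (by rw [hS]) _ _ _ (by omega) (by omega) (by omega)
  case some.some.none.some.some.none =>
    have e0 : 2 * (a0 + b0 - 3) = (2 * a0 + 2 * b0) - 6 := by omega
    have e1 : 3 * (a1 + b1 + 1 - 3) = (3 * a1 + 3 * b1) - 6 := by omega
    rw [e0, e1, min2_sub]
    have hS0 : min (2 * a0 + 2 * b0) (3 * a1 + 3 * b1) ≤ 2 * a0 + 2 * b0 := Nat.min_le_left _ _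
    have hS1 : min (2 * a0 + 2 * b0) (3 * a1 + 3 * b1) ≤ 3 * a1 + 3 * b1 := Nat.min_le_right _ _
    have hS6 : 6 ≤ min (2 * a0 + 2 * b0) (3 * a1 + 3 * b1) := le_min (by omega) (by omega)
    generalize hS : min (2 * a0 + 2 * b0) (3 * a1 + 3 * b1) = S at hS0 hS1 hS6 ⊢
    exact M2_child (2 * a0) (3 * a1) (2 * b0) (3 * b1) (by omega) (by omega) (by omega) (by omega)
      (6 * (S / 6)) (by rw [hS]) _ _ (by omega) (by omega)
  case some.none.some.some.none.some =>
    have e0 : 2 * (a0 + b0 - 3) = (2 * a0 + 2 * b0) - 6 := by omega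
    have e2 : 6 * (a2 + b2 + 2 - 3) = (6 * a2 + 6 * b2) - 6 := by omega
    rw [e0, e2, min2_sub]
    have hS0 : min (2 * a0 + 2 * b0) (6 * a2 + 6 * b2) ≤ 2 * a0 + 2 * b0 := Nat.min_le_left _ _
    have hS2 : min (2 * a0 + 2 * b0) (6 * a2 + 6 * b2) ≤ 6 * a2 + 6 * b2 := Nat.min_le_right _ _
    have hS6 : 6 ≤ min (2 * a0 + 2 * b0) (6 * a2 + 6 * b2) := le_min (by omega) (by omega)
    generalize hS : min (2 * a0 + 2 * b0) (6 * a2 + 6 * b2) = S at hS0 hS2 hS6 ⊢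
    exact M2_child (2 * a0) (6 * a2) (2 * b0) (6 * b2) (by omega) (by omega) (by omega) (by omega)
      (6 * (S / 6)) (by rw [hS]) _ _ (by omega) (by omega)
  case none.some.some.none.some.some =>
    have e1 : 3 * (a1 + b1 + 1 - 3) = (3 * a1 + 3 * b1) - 6 := by omega
    have e2 : 6 * (a2 + b2 + 2 - 3) = (6 * a2 + 6 * b2) - 6 := by omega
    rw [e1, e2, min2_sub]
    have hS1 : min (3 * a1 + 3 * b1) (6 * a2 + 6 * b2) ≤ 3 * a1 + 3 * b1 := Nat.min_le_left _ _
    have hS2 : min (3 * a1 + 3 * b1) (6 * a2 + 6 * b2) ≤ 6 * a2 + 6 * b2 := Nat.min_le_right _ _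
    have hS6 : 6 ≤ min (3 * a1 + 3 * b1) (6 * a2 + 6 * b2) := le_min (by omega) (by omega)
    generalize hS : min (3 * a1 + 3 * b1) (6 * a2 + 6 * b2) = S at hS1 hS2 hS6 ⊢
    exact M2_child (3 * a1) (6 * a2) (3 * b1) (6 * b2) (by omega) (by omega) (by omega) (by omega)
      (6 * (S / 6)) (by rw [hS]) _ _ (by omega) (by omega)
  case some.none.none.some.none.none => simp only [M1]; constructor <;> omega
  case none.some.none.none.some.none => simp only [M1]; constructor <;> omega
  case none.none.some.none.none.some => simp only [M1]; constructor <;> omega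

/-- THE SPLITTING INEQUALITY: at a top node of two non-deep curves (same pattern), `φ(a,b) ≥ 1 + φ(a,c) + φ(c,b)` for the settled newborn `c`. -/
theorem phi_split (a b : W3) (hp : pat a = pat b) (hne : pat a ≠ (false, false, false)) (ha : isDeepW a = false)
    (hb : isDeepW b = false) (ht : isDeepW (a.add b) = true) :
    phi a (settle (nb3 a b)) + phi (settle (nb3 a b)) b + 1 ≤ phi a b := by
  obtain ⟨h1, h2⟩ := Mp_child a b hp hne ha hb ht
  have p1 : 2 ^ (Mp a (settle (nb3 a b)) + 1) ≤ 2 ^ Mp a b := Nat.pow_le_pow_right (by norm_num) h1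
  have p2 : 2 ^ (Mp (settle (nb3 a b)) b + 1) ≤ 2 ^ Mp a b := Nat.pow_le_pow_right (by norm_num) h2
  rw [Nat.pow_succ] at p1 p2
  have q1 : 1 ≤ 2 ^ Mp a (settle (nb3 a b)) := Nat.one_le_two_pow
  have q2 : 1 ≤ 2 ^ Mp (settle (nb3 a b)) b := Nat.one_le_two_pow
  unfold phi
  rw [if_pos ht]
  split_ifs <;> omega

/-! ### settling -/

theorem sub_zero (w : W3) : w.sub 0 0 0 = w := by
  rcases w with ⟨_ | a, _ | b, _ | c⟩ <;> simp [W3.sub]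

/-- a non-deep weight is settled -/
theorem settle_of_not_deep (w : W3) (h : isDeepW w = false) : settle w = w := by
  have hk : settleK w = 0 := by
    unfold settleK mval
    rcases w with ⟨_ | a, _ | b, _ | c⟩ <;>
      simp only [isDeepW, W3.ge, wge_some, wge_none, Bool.and_eq_true, Bool.true_and, Bool.and_true, decide_eq_true_eq,
        Bool.and_eq_false_eq_eq_false_or_eq_false, decide_eq_false_iff_not, not_le, Bool.true_eq_false, or_false, false_or] at h ⊢ <;>
      omega
  unfold settle; rw [hk]; exact sub_zero w

/-- a deep accept does not change the settled weight and uses up one pending deep accept -/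
theorem settle_deep (w : W3) (hne : pat w ≠ (false, false, false)) (h : isDeepW w = true) :
    settle (w.sub 3 2 1) = settle w ∧ settleK (w.sub 3 2 1) + 1 = settleK w := by
  rcases w with ⟨_ | a, _ | b, _ | c⟩ <;>
    simp only [pat, Option.isSome_some, Option.isSome_none, Prod.mk.injEq, Bool.true_eq_false, Bool.false_eq_true,
      and_true, true_and, and_false, false_and, ne_eq, not_true_eq_false, not_false_eq_true, and_self] at hne <;>
    simp only [isDeepW, W3.ge, wge_some, wge_none, Bool.and_eq_true, Bool.true_and, Bool.and_true, decide_eq_true_eq] at h <;>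
    simp only [settle, settleK, mval, W3.sub, Option.map_some, Option.map_none, W3.mk.injEq, Option.some.injEq, and_true, true_and] <;>
    omega

/-- an `α = 2` accept never increases the number of pending deep accepts -/
theorem settleK_sub210_le (w : W3) : settleK (w.sub 2 1 0) ≤ settleK w := by
  rcases w with ⟨_ | a, _ | b, _ | c⟩ <;> simp only [settleK, mval, W3.sub, Option.map_some, Option.map_none] <;> omega

/-- the settled weight of a weight with a finite grade is not deep -/
theorem settle_not_deep (w : W3) (hne : pat w ≠ (false, false, false)) : isDeepW (settle w) = false := by
  rcases w with ⟨_ | a, _ | b, _ | c⟩ <;>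
    simp only [pat, Option.isSome_some, Option.isSome_none, Prod.mk.injEq, Bool.true_eq_false, Bool.false_eq_true,
      and_true, true_and, and_false, false_and, ne_eq, not_true_eq_false, not_false_eq_true, and_self] at hne <;>
    simp only [isDeepW, W3.ge, wge_some, wge_none, Bool.and_eq_true, Bool.true_and, Bool.and_true, decide_eq_true_eq,
        Bool.and_eq_false_eq_eq_false_or_eq_false, decide_eq_false_iff_not, not_le, Bool.true_eq_false, or_false, false_or,
        settle, settleK, mval, W3.sub, Option.map_some, Option.map_none] <;>
    omega

theorem pat_settle (w : W3) : pat (settle w) = pat w := by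
  rcases w with ⟨_ | a, _ | b, _ | c⟩ <;> simp [pat, settle, W3.sub]

theorem pat_sub (w : W3) (d0 d1 d2 : ℕ) : pat (w.sub d0 d1 d2) = pat w := by
  rcases w with ⟨_ | a, _ | b, _ | c⟩ <;> simp [pat, W3.sub]

theorem pat_nb3 (a b : W3) (hp : pat a = pat b) : pat (nb3 a b) = pat a := by
  rcases a with ⟨_ | a0, _ | a1, _ | a2⟩ <;> rcases b with ⟨_ | b0, _ | b1, _ | b2⟩ <;>
    simp [pat, nb3, W3.add, wadd_some, wadd_none_l, wadd_none_r] at hp ⊢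




/-! ## §T6. Mode `u`, rule sets rev 2 / rev 3 (`topj ∈ {0,1}`): T-settling. Arithmetic core of the T-shift. -/

/-- T-SHIFT CORE, three grades (`x2 = 6`, i.e. `c₂ = 1`): after the settled newborn `z = x + y − j` (with `z2 = 0`) is shifted by
`t` light accepts, `(z0 − 4t, z1 − 3t, 0)`, the pair with the residual branch `x` is still strictly below the parent pair. -/
theorem M3_childT (x0 x1 x2 y0 y1 y2 : ℕ) (hx2 : x2 = 6) (hx : min x0 (min x1 x2) < 6) (hy : min y0 (min y1 y2) < 6)
    (h0 : 6 ≤ x0 + y0) (h1 : 6 ≤ x1 + y1) (j : ℕ)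
    (hj : j = 6 * (min (x0 + y0) (min (x1 + y1) (x2 + y2)) / 6)) (z0 z1 : ℕ) (hz0 : z0 = x0 + y0 - j)
    (hz1 : z1 = x1 + y1 - j) (hz2 : x2 + y2 - j = 0) (t : ℕ) (ht0 : 4 * t ≤ z0) (ht1 : 3 * t ≤ z1) :
    M3 x0 x1 x2 (z0 - 4 * t) (z1 - 3 * t) 0 < M3 x0 x1 x2 y0 y1 y2 := by
  subst hx2
  have base := (M3_child x0 x1 6 y0 y1 y2 hx hy h0 h1 (by omega) j hj z0 z1 (6 + y2 - j) hz0 hz1 rfl).1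
  rw [hz2] at base
  have hS2 : min (x0 + y0) (min (x1 + y1) (6 + y2)) ≤ 6 + y2 := le_trans (Nat.min_le_right _ _) (Nat.min_le_right _ _)
  have hjle : j ≤ 6 + y2 := by rw [hj]; exact le_trans (Nat.mul_div_le _ 6) hS2
  have hjy : j = 6 + y2 := by omega
  have hm1 : min (min x0 (min x1 6)) (min (z0 - 4 * t) (min (z1 - 3 * t) 0)) = 0 := by simp
  have hm2 : min (min x0 (min x1 6)) (min z0 (min z1 0)) = 0 := by simp
  rcases Nat.lt_or_ge x1 x0 with hlt | hge
  · -- the residual branch prefers grade 1: compare with the parent directly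
    have hx1 : x1 < 6 := by simp only [Nat.min_def] at hx; split_ifs at hx <;> omega
    have e01 : E x0 x1 (z0 - 4 * t) (z1 - 3 * t) ≤ E x0 x1 y0 y1 + t := by unfold E; split_ifs <;> omega
    have e02 : E x0 6 (z0 - 4 * t) 0 ≤ E x0 6 y0 y2 := by unfold E; split_ifs <;> omega
    have e12 : E x1 6 (z1 - 3 * t) 0 + t + 1 ≤ E x1 6 y1 y2 := by unfold E; split_ifs <;> omega
    unfold M3
    rw [hm1]
    generalize min (min x0 (min x1 6)) (min y0 (min y1 y2)) = M
    omega
  · -- compatible on grades (0,1): the T-shift is monotone, then the settled-child inequality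
    have e01 : E x0 x1 (z0 - 4 * t) (z1 - 3 * t) ≤ E x0 x1 z0 z1 := by unfold E; split_ifs <;> omega
    have e02 : E x0 6 (z0 - 4 * t) 0 ≤ E x0 6 z0 0 := by unfold E; split_ifs <;> omega
    have e12 : E x1 6 (z1 - 3 * t) 0 ≤ E x1 6 z1 0 := by unfold E; split_ifs <;> omega
    unfold M3 at base ⊢
    rw [hm1]; rw [hm2] at base
    generalize min (min x0 (min x1 6)) (min y0 (min y1 y2)) = M at base ⊢
    omega

/-- T-SHIFT CORE, two grades (`x2 = 6` the grade-2 value; the other finite grade shifted by any `u ≤ z0`). -/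
theorem M2_childT (x0 x2 y0 y2 : ℕ) (hx2 : x2 = 6) (hx : min x0 x2 < 6) (hy : min y0 y2 < 6) (h0 : 6 ≤ x0 + y0) (j : ℕ)
    (hj : j = 6 * (min (x0 + y0) (x2 + y2) / 6)) (z0 : ℕ) (hz0 : z0 = x0 + y0 - j) (hz2 : x2 + y2 - j = 0)
    (u : ℕ) (hu : u ≤ z0) : M2 x0 x2 (z0 - u) 0 < M2 x0 x2 y0 y2 := by
  subst hx2
  have base := (M2_child x0 6 y0 y2 hx hy h0 (by omega) j hj z0 (6 + y2 - j) hz0 rfl).1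
  rw [hz2] at base
  have e02 : E x0 6 (z0 - u) 0 ≤ E x0 6 z0 0 := by unfold E; split_ifs <;> omega
  have hm1 : min (min x0 6) (min (z0 - u) 0) = 0 := by simp
  have hm2 : min (min x0 6) (min z0 0) = 0 := by simp
  unfold M2 at base ⊢
  rw [hm1]; rw [hm2] at base
  generalize min (min x0 6) (min y0 y2) = M at base ⊢
  omega


/-! ### T-runs: `badW`, `trun`, `tlen` -/

/-- a T-RUN configuration at the `T`-node `(c, v)` (`c` the residual branch): `c₂ = 1`, `v₂ = 0`, `v` can take a light accept, and the point is
top (`o ≥ θ`); under the rule sets rev 2/3 with `topj = 0` such a point is NOT a jump point (light `K₁`), so `K₁` is light-accepted through it -/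
def badW (c v : W3) : Bool := (c.w2 == some 1) && (v.w2 == some 0) && wge v.w0 2 && wge v.w1 1 && isDeepW (c.add v)

/-- fuel of a T-run: `w₀ + w₁` over the finite ones -/
def tfuel (v : W3) : ℕ := v.w0.getD 0 + v.w1.getD 0

/-- the T-SETTLED weight: apply light accepts `v ↦ v − (2,1,0)` while the configuration is a T-run configuration -/
def trun (c v : W3) : W3 :=
  if h : badW c v = true ∧ tfuel (v.sub 2 1 0) < tfuel v then trun c (v.sub 2 1 0) else v
termination_by tfuel v
decreasing_by exact h.2

/-- the length of the T-run -/
def tlen (c v : W3) : ℕ :=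
  if h : badW c v = true ∧ tfuel (v.sub 2 1 0) < tfuel v then tlen c (v.sub 2 1 0) + 1 else 0
termination_by tfuel v
decreasing_by exact h.2

theorem trun_of_not_bad (c v : W3) (h : badW c v = false) : trun c v = v ∧ tlen c v = 0 := by
  rw [trun, tlen]; simp [h]

theorem trun_bad (c v : W3) (hb : badW c v = true) (hf : tfuel (v.sub 2 1 0) < tfuel v) :
    trun c v = trun c (v.sub 2 1 0) ∧ tlen c v = tlen c (v.sub 2 1 0) + 1 := by
  rw [trun, tlen]; simp [hb, hf]

/-- in a T-run configuration of a good state the fuel drops -/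
theorem tfuel_lt_of_bad (c v : W3) (hb : badW c v = true) (hc : isDeepW c = false) (hp : pat c = pat v) :
    tfuel (v.sub 2 1 0) < tfuel v := by
  rcases c with ⟨_ | c0, _ | c1, _ | c2⟩ <;> rcases v with ⟨_ | v0, _ | v1, _ | v2⟩ <;>
    simp only [pat, Option.isSome_some, Option.isSome_none, Prod.mk.injEq, Bool.true_eq_false, Bool.false_eq_true,
      and_true, true_and, and_false, false_and] at hp <;>
    simp only [badW, isDeepW, W3.ge, W3.add, wge_some, wge_none, wadd_some, wadd_none_l, wadd_none_r, Bool.and_eq_true,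
      beq_iff_eq, decide_eq_true_eq, Option.some.injEq, reduceCtorEq, false_and, and_false, Bool.and_eq_false_eq_eq_false_or_eq_false,
      decide_eq_false_iff_not, not_le, Bool.true_eq_false, or_false, false_or, and_true, true_and] at hb hc <;>
    simp only [tfuel, W3.sub, Option.map_some, Option.map_none, Option.getD_some, Option.getD_none] <;> omega

theorem sub_sub (w : W3) (a b c a' b' c' : ℕ) : (w.sub a b c).sub a' b' c' = w.sub (a + a') (b + b') (c + c') := by
  rcases w with ⟨_ | x, _ | y, _ | z⟩ <;> simp [W3.sub] <;> omega

/-- the T-settled weight is `v − t·(2,1,0)` for the run length `t = tlen`, the run is feasible, and a non-empty run has `c₂ = 1`, `v₂ = 0` -/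
theorem trun_spec (c : W3) (hc : isDeepW c = false) : ∀ n v, tfuel v ≤ n → pat c = pat v →
    trun c v = v.sub (2 * tlen c v) (tlen c v) 0 ∧ (∀ x, v.w0 = some x → 2 * tlen c v ≤ x) ∧ (∀ y, v.w1 = some y → tlen c v ≤ y) ∧
      (1 ≤ tlen c v → c.w2 = some 1 ∧ v.w2 = some 0) := by
  intro n
  induction n with
  | zero =>
    intro v hv hp
    have hnb : ¬ (badW c v = true ∧ tfuel (v.sub 2 1 0) < tfuel v) := fun h => by omega
    have e1 : trun c v = v := by rw [trun]; simp [hnb]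
    have e2 : tlen c v = 0 := by rw [tlen]; simp [hnb]
    rw [e1, e2]; simp [sub_zero]
  | succ n ih =>
    intro v hv hp
    by_cases hb : badW c v = true
    · have hf := tfuel_lt_of_bad c v hb hc hp
      obtain ⟨e1, e2⟩ := trun_bad c v hb hf
      have hp' : pat c = pat (v.sub 2 1 0) := by rw [pat_sub]; exact hp
      obtain ⟨i1, i2, i3, _⟩ := ih (v.sub 2 1 0) (by omega) hp'
      rw [e1, e2, i1, sub_sub]
      refine ⟨by congr 1 <;> omega, ?_, ?_, ?_⟩
      · intro x hx
        have hx' : (v.sub 2 1 0).w0 = some (x - 2) := by simp [W3.sub, hx]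
        have := i2 (x - 2) hx'
        have h2 : 2 ≤ x := by
          simp only [badW, Bool.and_eq_true, hx, wge_some, decide_eq_true_eq] at hb; omega
        omega
      · intro y hy
        have hy' : (v.sub 2 1 0).w1 = some (y - 1) := by simp [W3.sub, hy]
        have := i3 (y - 1) hy'
        have h1 : 1 ≤ y := by
          simp only [badW, Bool.and_eq_true, hy, wge_some, decide_eq_true_eq] at hb; omega
        omega
      · intro _
        simp only [badW, Bool.and_eq_true, beq_iff_eq] at hb
        exact ⟨hb.1.1.1.1, hb.1.1.1.2⟩
    · have hb' : badW c v = false := by simpa using hb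
      obtain ⟨e1, e2⟩ := trun_of_not_bad c v hb'
      rw [e1, e2]; simp [sub_zero]

/-- T-SHIFTED SPLITTING, pair-measure form: the residual branch against the T-settled newborn is strictly below the parent pair -/
theorem Mp_childT (a b : W3) (hp : pat a = pat b) (hne : pat a ≠ (false, false, false)) (ha : isDeepW a = false)
    (hb : isDeepW b = false) (ht : isDeepW (a.add b) = true) (t : ℕ)
    (h2 : 1 ≤ t → a.w2 = some 1 ∧ (settle (nb3 a b)).w2 = some 0)
    (ht0 : ∀ x, (settle (nb3 a b)).w0 = some x → 2 * t ≤ x) (ht1 : ∀ y, (settle (nb3 a b)).w1 = some y → t ≤ y) :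
    Mp a ((settle (nb3 a b)).sub (2 * t) t 0) < Mp a b := by
  rcases Nat.eq_zero_or_pos t with rfl | htpos
  · rw [Nat.mul_zero, sub_zero]; exact (Mp_child a b hp hne ha hb ht).1
  obtain ⟨h2a, h2s⟩ := h2 htpos
  rcases a with ⟨_ | a0, _ | a1, _ | a2⟩ <;> rcases b with ⟨_ | b0, _ | b1, _ | b2⟩ <;>
    simp only [pat, Option.isSome_some, Option.isSome_none, Prod.mk.injEq, Bool.true_eq_false, Bool.false_eq_true,
      and_true, true_and, and_false, false_and, ne_eq, not_true_eq_false, not_false_eq_true, and_self] at hp hne <;>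
    simp only [isDeepW, W3.ge, W3.add, wge_some, wge_none, wadd_some, wadd_none_l, wadd_none_r, Bool.and_eq_true, Bool.true_and,
      Bool.and_true, decide_eq_true_eq, Bool.and_eq_false_eq_eq_false_or_eq_false, decide_eq_false_iff_not, not_le,
      Bool.true_eq_false, or_false, false_or] at ha hb ht <;>
    simp only [Mp, settle, settleK, mval, nb3, W3.add, W3.sub, wadd_some, wadd_none_l, wadd_none_r, Option.map_some,
      Option.map_none, Option.some.injEq, reduceCtorEq, forall_eq'] at h2a h2s ht0 ht1 ⊢
  case some.some.some.some.some.some =>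
    subst h2a
    have e0 : 2 * (a0 + b0 - 3) = (2 * a0 + 2 * b0) - 6 := by omega
    have e1 : 3 * (a1 + b1 + 1 - 3) = (3 * a1 + 3 * b1) - 6 := by omega
    have e2 : 6 * (1 + b2 + 2 - 3) = (6 * 1 + 6 * b2) - 6 := by omega
    rw [e0, e1, e2, min3_sub] at h2s ht0 ht1 ⊢
    have hS0 : min (2 * a0 + 2 * b0) (min (3 * a1 + 3 * b1) (6 * 1 + 6 * b2)) ≤ 2 * a0 + 2 * b0 := Nat.min_le_left _ _
    have hS1 : min (2 * a0 + 2 * b0) (min (3 * a1 + 3 * b1) (6 * 1 + 6 * b2)) ≤ 3 * a1 + 3 * b1 :=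
      le_trans (Nat.min_le_right _ _) (Nat.min_le_left _ _)
    have hS2 : min (2 * a0 + 2 * b0) (min (3 * a1 + 3 * b1) (6 * 1 + 6 * b2)) ≤ 6 * 1 + 6 * b2 :=
      le_trans (Nat.min_le_right _ _) (Nat.min_le_right _ _)
    have hS6 : 6 ≤ min (2 * a0 + 2 * b0) (min (3 * a1 + 3 * b1) (6 * 1 + 6 * b2)) := le_min (by omega) (le_min (by omega) (by omega))
    generalize hS : min (2 * a0 + 2 * b0) (min (3 * a1 + 3 * b1) (6 * 1 + 6 * b2)) = S at hS0 hS1 hS2 hS6 h2s ht0 ht1 ⊢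
    rw [show 2 * (a0 + b0 - 3 - 3 * ((S - 6) / 6) - 2 * t) = (2 * a0 + 2 * b0 - 6 * (S / 6)) - 4 * t by omega,
      show 3 * (a1 + b1 + 1 - 3 - 2 * ((S - 6) / 6) - t) = (3 * a1 + 3 * b1 - 6 * (S / 6)) - 3 * t by omega,
      show 6 * (1 + b2 + 2 - 3 - (S - 6) / 6 - 0) = 0 by omega]
    exact M3_childT (2 * a0) (3 * a1) (6 * 1) (2 * b0) (3 * b1) (6 * b2) (by omega) (by omega) (by omega) (by omega) (by omega)
      (6 * (S / 6)) (by rw [hS]) _ _ rfl rfl (by omega) t (by omega) (by omega)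
  case some.none.some.some.none.some =>
    subst h2a
    have e0 : 2 * (a0 + b0 - 3) = (2 * a0 + 2 * b0) - 6 := by omega
    have e2 : 6 * (1 + b2 + 2 - 3) = (6 * 1 + 6 * b2) - 6 := by omega
    rw [e0, e2, min2_sub] at h2s ht0 ⊢
    have hS0 : min (2 * a0 + 2 * b0) (6 * 1 + 6 * b2) ≤ 2 * a0 + 2 * b0 := Nat.min_le_left _ _
    have hS2 : min (2 * a0 + 2 * b0) (6 * 1 + 6 * b2) ≤ 6 * 1 + 6 * b2 := Nat.min_le_right _ _
    have hS6 : 6 ≤ min (2 * a0 + 2 * b0) (6 * 1 + 6 * b2) := le_min (by omega) (by omega)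
    generalize hS : min (2 * a0 + 2 * b0) (6 * 1 + 6 * b2) = S at hS0 hS2 hS6 h2s ht0 ⊢
    rw [show 2 * (a0 + b0 - 3 - 3 * ((S - 6) / 6) - 2 * t) = (2 * a0 + 2 * b0 - 6 * (S / 6)) - 4 * t by omega,
      show 6 * (1 + b2 + 2 - 3 - (S - 6) / 6 - 0) = 0 by omega]
    exact M2_childT (2 * a0) (6 * 1) (2 * b0) (6 * b2) (by omega) (by omega) (by omega) (by omega)
      (6 * (S / 6)) (by rw [hS]) _ rfl (by omega) (4 * t) (by omega)
  case none.some.some.none.some.some =>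
    subst h2a
    have e1 : 3 * (a1 + b1 + 1 - 3) = (3 * a1 + 3 * b1) - 6 := by omega
    have e2 : 6 * (1 + b2 + 2 - 3) = (6 * 1 + 6 * b2) - 6 := by omega
    rw [e1, e2, min2_sub] at h2s ht1 ⊢
    have hS1 : min (3 * a1 + 3 * b1) (6 * 1 + 6 * b2) ≤ 3 * a1 + 3 * b1 := Nat.min_le_left _ _
    have hS2 : min (3 * a1 + 3 * b1) (6 * 1 + 6 * b2) ≤ 6 * 1 + 6 * b2 := Nat.min_le_right _ _
    have hS6 : 6 ≤ min (3 * a1 + 3 * b1) (6 * 1 + 6 * b2) := le_min (by omega) (by omega)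
    generalize hS : min (3 * a1 + 3 * b1) (6 * 1 + 6 * b2) = S at hS1 hS2 hS6 h2s ht1 ⊢
    rw [show 3 * (a1 + b1 + 1 - 3 - 2 * ((S - 6) / 6) - t) = (3 * a1 + 3 * b1 - 6 * (S / 6)) - 3 * t by omega,
      show 6 * (1 + b2 + 2 - 3 - (S - 6) / 6 - 0) = 0 by omega]
    exact M2_childT (3 * a1) (6 * 1) (3 * b1) (6 * b2) (by omega) (by omega) (by omega) (by omega)
      (6 * (S / 6)) (by rw [hS]) _ rfl (by omega) (3 * t) (by omega)
  case none.none.some.none.none.some => omega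

/-- T-SHIFTED SPLITTING INEQUALITY: `φ(a, T) + φ(S, b) + 1 ≤ φ(a, b)` for the settled newborn `S` of the top node `(a, b)` and its
T-shift `T = S − t·(2,1,0)` along a feasible run -/
theorem phi_splitT (a b : W3) (hp : pat a = pat b) (hne : pat a ≠ (false, false, false)) (ha : isDeepW a = false)
    (hb : isDeepW b = false) (ht : isDeepW (a.add b) = true) (t : ℕ)
    (h2 : 1 ≤ t → a.w2 = some 1 ∧ (settle (nb3 a b)).w2 = some 0)
    (ht0 : ∀ x, (settle (nb3 a b)).w0 = some x → 2 * t ≤ x) (ht1 : ∀ y, (settle (nb3 a b)).w1 = some y → t ≤ y) :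
    phi a ((settle (nb3 a b)).sub (2 * t) t 0) + phi (settle (nb3 a b)) b + 1 ≤ phi a b := by
  have h1 := Mp_childT a b hp hne ha hb ht t h2 ht0 ht1
  obtain ⟨_, h2'⟩ := Mp_child a b hp hne ha hb ht
  have p1 : 2 ^ (Mp a ((settle (nb3 a b)).sub (2 * t) t 0) + 1) ≤ 2 ^ Mp a b := Nat.pow_le_pow_right (by norm_num) h1
  have p2 : 2 ^ (Mp (settle (nb3 a b)) b + 1) ≤ 2 ^ Mp a b := Nat.pow_le_pow_right (by norm_num) h2'
  rw [Nat.pow_succ] at p1 p2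
  have q1 : 1 ≤ 2 ^ Mp a ((settle (nb3 a b)).sub (2 * t) t 0) := Nat.one_le_two_pow
  have q2 : 1 ≤ 2 ^ Mp (settle (nb3 a b)) b := Nat.one_le_two_pow
  unfold phi
  rw [if_pos ht]
  split_ifs <;> omega



/-! ## §T3. Chain potentials: `Φ` (node potential over settled weights), `PD` (pending deep accepts), `S0` (Σ w₀), `T` (Sing₂ tail measure). -/

/-- sum of `f` over the adjacent pairs of a list -/
def pairSum {α : Type} (f : α → α → ℕ) : List α → ℕ
  | [] => 0
  | [_] => 0
  | a :: b :: t => f a b + pairSum f (b :: t)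

theorem pairSum_cons_cons {α : Type} (f : α → α → ℕ) (a b : α) (t : List α) :
    pairSum f (a :: b :: t) = f a b + pairSum f (b :: t) := rfl

/-- cutting a list at an element splits the pair sum -/
theorem pairSum_cut {α : Type} (f : α → α → ℕ) (xs : List α) (a : α) (ys : List α) :
    pairSum f (xs ++ a :: ys) = pairSum f (xs ++ [a]) + pairSum f (a :: ys) := by
  induction xs with
  | nil => simp [pairSum]
  | cons x xs ih =>
    cases xs with
    | nil => simp [pairSum]
    | cons x' xs' =>
      simp only [List.cons_append] at ih ⊢
      rw [pairSum_cons_cons, pairSum_cons_cons, ih]; omega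

theorem pairSum_snoc {α : Type} (f : α → α → ℕ) (xs : List α) (p c : α) :
    pairSum f (xs ++ [p, c]) = pairSum f (xs ++ [p]) + f p c := by
  rw [pairSum_cut f xs p [c]]; simp [pairSum]

/-- replacing one element: the pair sum does not increase if the two new adjacent terms vanish -/
theorem pairSum_replace_le {α : Type} (f : α → α → ℕ) (xs : List α) (c c' : α) (ys : List α)
    (hl : ∀ xs' p, xs = xs' ++ [p] → f p c' = 0) (hr : ∀ q ys', ys = q :: ys' → f c' q = 0) :
    pairSum f (xs ++ c' :: ys) ≤ pairSum f (xs ++ c :: ys) := by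
  rw [pairSum_cut f xs c' ys, pairSum_cut f xs c ys]
  have h1 : pairSum f (xs ++ [c']) ≤ pairSum f (xs ++ [c]) := by
    rcases List.eq_nil_or_concat xs with rfl | ⟨xs', p, rfl⟩
    · simp [pairSum]
    · simp only [List.concat_eq_append, List.append_assoc, List.singleton_append]
      rw [pairSum_snoc, pairSum_snoc, hl xs' p (by simp)]; omega
  have h2 : pairSum f (c' :: ys) ≤ pairSum f (c :: ys) := by
    rcases ys with _ | ⟨q, ys'⟩
    · simp [pairSum]
    · rw [pairSum_cons_cons, pairSum_cons_cons, hr q ys' rfl]; omega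
  omega

/-- inserting one element `x` after `a`: the pair sum changes by `f a x + f x b − f a b` at an inner node -/
theorem pairSum_insert {α : Type} (f : α → α → ℕ) (xs : List α) (a x b : α) (ys : List α) :
    pairSum f (xs ++ a :: x :: b :: ys) + f a b = pairSum f (xs ++ a :: b :: ys) + f a x + f x b := by
  rw [pairSum_cut f xs a (x :: b :: ys), pairSum_cut f xs a (b :: ys), pairSum_cons_cons, pairSum_cons_cons,
    pairSum_cons_cons]; omega

/-- node potential of the chain, over the SETTLED weights -/
def Phi (ch : Chain) : ℕ := pairSum phi (ch.map fun c => settle c.w)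
/-- pending deep accepts -/
def PD (ch : Chain) : ℕ := (ch.map fun c => settleK c.w).sum
/-- `Σ w₀` over the finite ones -/
def S0 (ch : Chain) : ℕ := (ch.map fun c => c.w.w0.getD 0).sum
/-- tail term of a node: `o₁ + 1` at a Sing₂ point (`1` if `o₁ = ∞`), else 0 -/
def tterm (a b : Curve) : ℕ := if sing2N a b = true then (wadd a.w.w1 b.w.w1).getD 0 + 1 else 0
/-- the Sing₂ tail measure -/
def TT (ch : Chain) : ℕ := pairSum tterm ch

/-- the lexicographic potential -/
def pot (ch : Chain) : ℕ × ℕ × ℕ × ℕ := (Phi ch, PD ch, S0 ch, TT ch)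

/-- lexicographic order on `ℕ⁴` -/
def LT4 : ℕ × ℕ × ℕ × ℕ → ℕ × ℕ × ℕ × ℕ → Prop := Prod.Lex (· < ·) (Prod.Lex (· < ·) (Prod.Lex (· < ·) (· < ·)))

theorem LT4_wf : WellFounded LT4 := (Prod.lex Nat.lt_wfRel (Prod.lex Nat.lt_wfRel (Prod.lex Nat.lt_wfRel Nat.lt_wfRel))).wf

theorem LT4_of1 {a a' : ℕ} (b b' c c' d d' : ℕ) (h : a' < a) : LT4 (a', b', c', d') (a, b, c, d) := Prod.Lex.left _ _ h

theorem LT4_of2 {a a' b b' : ℕ} (c c' d d' : ℕ) (ha : a' ≤ a) (hb : b' < b) : LT4 (a', b', c', d') (a, b, c, d) := by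
  rcases Nat.lt_or_eq_of_le ha with h | rfl
  · exact Prod.Lex.left _ _ h
  · exact Prod.Lex.right _ (Prod.Lex.left _ _ hb)

theorem LT4_of3 {a a' b b' c c' : ℕ} (d d' : ℕ) (ha : a' ≤ a) (hb : b' ≤ b) (hc : c' < c) :
    LT4 (a', b', c', d') (a, b, c, d) := by
  rcases Nat.lt_or_eq_of_le ha with h | rfl
  · exact Prod.Lex.left _ _ h
  rcases Nat.lt_or_eq_of_le hb with h | rfl
  · exact Prod.Lex.right _ (Prod.Lex.left _ _ h)
  · exact Prod.Lex.right _ (Prod.Lex.right _ (Prod.Lex.left _ _ hc))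

theorem LT4_of4 {a a' b b' c c' d d' : ℕ} (ha : a' ≤ a) (hb : b' ≤ b) (hc : c' ≤ c) (hd : d' < d) :
    LT4 (a', b', c', d') (a, b, c, d) := by
  rcases Nat.lt_or_eq_of_le ha with h | rfl
  · exact Prod.Lex.left _ _ h
  rcases Nat.lt_or_eq_of_le hb with h | rfl
  · exact Prod.Lex.right _ (Prod.Lex.left _ _ h)
  rcases Nat.lt_or_eq_of_le hc with h | rfl
  · exact Prod.Lex.right _ (Prod.Lex.right _ (Prod.Lex.left _ _ h))
  · exact Prod.Lex.right _ (Prod.Lex.right _ (Prod.Lex.right _ hd))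

/-! ### list plumbing: a chain around a curve / a node, `modify` and `insertIdx` there -/

theorem split1 {ch : Chain} {k : ℕ} {c : Curve} (h : ch[k]? = some c) :
    ∃ xs ys : List Curve, ch = xs ++ c :: ys ∧ xs.length = k := by
  obtain ⟨hk, hc⟩ := List.getElem?_eq_some_iff.mp h
  refine ⟨ch.take k, ch.drop (k + 1), ?_, by rw [List.length_take]; exact Nat.min_eq_left (Nat.le_of_lt hk)⟩
  conv_lhs => rw [← List.take_append_drop k ch]
  rw [List.drop_eq_getElem_cons hk, hc]

theorem split2 {ch : Chain} {i : ℕ} {a b : Curve} (h : nodeAt ch i = some (a, b)) :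
    ∃ xs ys : List Curve, ch = xs ++ a :: b :: ys ∧ xs.length = i := by
  obtain ⟨ha, hb⟩ := nodeAt_some h
  obtain ⟨hi, ha'⟩ := List.getElem?_eq_some_iff.mp ha
  obtain ⟨hi1, hb'⟩ := List.getElem?_eq_some_iff.mp hb
  refine ⟨ch.take i, ch.drop (i + 2), ?_, by rw [List.length_take]; exact Nat.min_eq_left (Nat.le_of_lt hi)⟩
  conv_lhs => rw [← List.take_append_drop i ch]
  rw [List.drop_eq_getElem_cons hi, ha', List.drop_eq_getElem_cons hi1, hb']

theorem modify_split (xs : List Curve) (c : Curve) (ys : List Curve) (f : Curve → Curve) :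
    (xs ++ c :: ys).modify xs.length f = xs ++ f c :: ys := by
  induction xs with
  | nil => simp
  | cons x xs ih => simp [ih]

theorem insert_split (xs : List Curve) (a x : Curve) (ys : List Curve) :
    (xs ++ a :: ys).insertIdx (xs.length + 1) x = xs ++ a :: x :: ys := by
  induction xs with
  | nil => simp [List.insertIdx_succ_cons, List.insertIdx_zero]
  | cons y xs ih => simp [List.insertIdx_succ_cons, ih]

theorem nodeAt_split (xs : List Curve) (a b : Curve) (ys : List Curve) : nodeAt (xs ++ a :: b :: ys) xs.length = some (a, b) := by
  unfold nodeAt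
  rw [List.getElem?_append_right (by omega), List.getElem?_append_right (by omega), Nat.sub_self,
    show xs.length + 1 - xs.length = 1 by omega]
  simp

/-! ### the state hypotheses: one pattern of finite grades, residual branches never deep; the mode (`G_mult` or all-boundary) -/

/-- GOOD states: all curves have the same (non-empty) set of finite grades, and residual branches are not deep -/
def Good (ch : Chain) : Prop :=
  (∃ P : Bool × Bool × Bool, P ≠ (false, false, false) ∧ ∀ c ∈ ch, pat c.w = P) ∧ ∀ c ∈ ch, c.bd = false → isDeepW c.w = false

/-- the rule sets covered: `G_mult` (`topj ≥ 2`) for any chain, or any `topj` in mode `uv` (all curves boundary) -/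
def ModeOK (topj : ℕ) (ch : Chain) : Prop := 2 ≤ topj ∨ ∀ c ∈ ch, c.bd = true

theorem Good.pat_eq {ch : Chain} (hG : Good ch) {a b : Curve} (ha : a ∈ ch) (hb : b ∈ ch) : pat a.w = pat b.w := by
  obtain ⟨⟨P, _, hP⟩, _⟩ := hG; rw [hP a ha, hP b hb]

theorem Good.pat_ne {ch : Chain} (hG : Good ch) {a : Curve} (ha : a ∈ ch) : pat a.w ≠ (false, false, false) := by
  obtain ⟨⟨P, hne, hP⟩, _⟩ := hG; rw [hP a ha]; exact hne

/-! ### threshold arithmetic used by the step lemmas -/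

theorem notDeep_sub (a : W3) (d0 d1 d2 : ℕ) (h : isDeepW a = false) : isDeepW (a.sub d0 d1 d2) = false := by
  rcases a with ⟨_ | a0, _ | a1, _ | a2⟩ <;>
    simp only [isDeepW, W3.ge, W3.sub, wge_some, wge_none, Option.map_some, Option.map_none, Bool.and_eq_true, Bool.true_and,
      Bool.and_true, decide_eq_true_eq, Bool.and_eq_false_eq_eq_false_or_eq_false, decide_eq_false_iff_not, not_le,
      Bool.true_eq_false, or_false, false_or] at h ⊢ <;> omega

theorem notDeep_add_sub_left (a b : W3) (d0 d1 d2 : ℕ) (h : isDeepW (a.add b) = false) :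
    isDeepW ((a.sub d0 d1 d2).add b) = false := by
  rcases a with ⟨_ | a0, _ | a1, _ | a2⟩ <;> rcases b with ⟨_ | b0, _ | b1, _ | b2⟩ <;>
    simp only [isDeepW, W3.ge, W3.sub, W3.add, wadd_some, wadd_none_l, wadd_none_r, wge_some, wge_none, Option.map_some,
      Option.map_none, Bool.and_eq_true, Bool.true_and, Bool.and_true, decide_eq_true_eq, Bool.and_eq_false_eq_eq_false_or_eq_false,
      decide_eq_false_iff_not, not_le, Bool.true_eq_false, or_false, false_or] at h ⊢ <;> omega

theorem notDeep_add_sub_right (a b : W3) (d0 d1 d2 : ℕ) (h : isDeepW (a.add b) = false) :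
    isDeepW (a.add (b.sub d0 d1 d2)) = false := by
  rcases a with ⟨_ | a0, _ | a1, _ | a2⟩ <;> rcases b with ⟨_ | b0, _ | b1, _ | b2⟩ <;>
    simp only [isDeepW, W3.ge, W3.sub, W3.add, wadd_some, wadd_none_l, wadd_none_r, wge_some, wge_none, Option.map_some,
      Option.map_none, Bool.and_eq_true, Bool.true_and, Bool.and_true, decide_eq_true_eq, Bool.and_eq_false_eq_eq_false_or_eq_false,
      decide_eq_false_iff_not, not_le, Bool.true_eq_false, or_false, false_or] at h ⊢ <;> omega

/-- TOP = `o ≥ θ` at every node (the T-point clauses of Sing₂ are implied by `o ≥ θ`) -/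
theorem topN_eq (a b : Curve) : topN a b = isDeepW (a.w.add b.w) := by
  unfold topN sing2N resid
  rcases a with ⟨⟨_ | a0, _ | a1, _ | a2⟩, a3, _ | _⟩ <;> rcases b with ⟨⟨_ | b0, _ | b1, _ | b2⟩, b3, _ | _⟩ <;>
    simp [isDeepW, isSingW, W3.ge, W3.add, finPos, wge_some, wge_none, wadd_some, wadd_none_l, wadd_none_r, Nat.ble_eq] <;> omega

theorem notDeep_of_bd_kind {c : Curve} (hb : c.bd = true) (hk : kindOf c ≠ .deep) : isDeepW c.w = false := by
  unfold kindOf at hk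
  cases hD : isDeepW c.w <;> simp [hb, hD] at hk ⊢

/-- in a good state without deep curves (which is when curve/point moves are emitted) every curve is non-deep, hence settled -/
theorem member_notDeep {ch : Chain} (hG : Good ch) (hnd : ∀ j, kindAt ch j ≠ .deep) {c : Curve} (hc : c ∈ ch) :
    isDeepW c.w = false := by
  cases hb : c.bd
  · exact hG.2 c hc hb
  · obtain ⟨k, hk⟩ := List.mem_iff_getElem?.mp hc
    apply notDeep_of_bd_kind hb
    intro hd; apply hnd k
    unfold kindAt; rw [hk]; exact hd

/-- curve and point moves are emitted only when no curve is deep -/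
theorem legal_noDeep {topj : ℕ} {ch : Chain} {m : Move} (hm : m ∈ legalMoves topj ch) (hD : ∀ k, m ≠ Move.D k) (j : ℕ) :
    kindAt ch j ≠ .deep := by
  unfold legalMoves at hm
  dsimp only at hm
  generalize hf : List.filter (fun k => kindAt ch k == Kind.deep) (List.range ch.length) = fl at hm
  cases fl with
  | cons k' tl =>
    simp only [List.mem_singleton] at hm
    exact absurd hm (hD k')
  | nil =>
    intro hj
    have hlt : j < ch.length := by
      by_contra hlt
      unfold kindAt at hj
      rw [List.getElem?_eq_none_iff.mpr (by omega)] at hj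
      simp at hj
    have hmem : j ∈ List.filter (fun k => kindAt ch k == Kind.deep) (List.range ch.length) :=
      List.mem_filter.mpr ⟨List.mem_range.mpr hlt, by simp [hj]⟩
    rw [hf] at hmem
    simp at hmem

/-- the newborn of an exponent-2 point blow-up -/
def nb2 (a b : W3) : W3 := ⟨(a.add b).w0.map (· - 2), (a.add b).w1.map (· + 1 - 2), (a.add b).w2.map (· + 2 - 2)⟩

theorem nb2_facts (a b : W3) (x y : ℕ) (hx : a.w0 = some x) (hy : b.w0 = some y) (hxy : x + y = 2) :
    isDeepW (a.add (nb2 a b)) = false ∧ isDeepW ((nb2 a b).add b) = false ∧ settleK (nb2 a b) = 0 ∧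
      isDeepW (nb2 a b) = false ∧ (nb2 a b).w0 = some 0 := by
  rcases a with ⟨a0, _ | a1, _ | a2⟩ <;> rcases b with ⟨b0, _ | b1, _ | b2⟩ <;> simp only at hx hy <;> subst hx hy <;>
    simp only [isDeepW, W3.ge, W3.add, nb2, settleK, mval, wadd_some, wadd_none_l, wadd_none_r, wge_some, wge_none, Option.map_some,
      Option.map_none, Bool.and_eq_true, Bool.true_and, Bool.and_true, decide_eq_true_eq, Bool.and_eq_false_eq_eq_false_or_eq_false,
      decide_eq_false_iff_not, not_le, Bool.true_eq_false, or_false, false_or, Option.some.injEq, and_true, true_and] <;> omega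

/-- the tail measure strictly drops at an exponent-2 point blow-up (the isolated-Sing₂ `P` move at a non-top point): both branches are
unhandled (boundary branches are outside class 𝒞), the point has `o₀ = 2`, and the two new points carry less -/
theorem tterm_P2 (a b : Curve) (hp : pat a.w = pat b.w) (hs : sing2N a b = true) (ht : topN a b = false)
    (ha : a.bd = true → isCW a.w = false) (hb : b.bd = true → isCW b.w = false) (w3 : ℕ) :
    tterm a ⟨nb2 a.w b.w, w3, true⟩ + tterm ⟨nb2 a.w b.w, w3, true⟩ b < tterm a b := by
  obtain ⟨x, y, hx, hy, hxy⟩ := o0_of_sing2_not_top a b hs ht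
  unfold tterm
  rw [if_pos hs]
  unfold topN at ht
  unfold sing2N resid at *
  rcases a with ⟨⟨a0, _ | a1, _ | a2⟩, a3, _ | _⟩ <;> rcases b with ⟨⟨b0, _ | b1, _ | b2⟩, b3, _ | _⟩ <;> simp only at hx hy <;> subst hx hy <;>
    simp only [pat, Option.isSome_some, Option.isSome_none, Prod.mk.injEq, Bool.true_eq_false, Bool.false_eq_true, and_true, true_and,
      and_false, false_and] at hp <;>
    (split_ifs <;> (try simp only [nb2, Option.getD_some, Option.getD_none, true_implies, false_implies, forall_const, ble_false_iff, Nat.ble_eq, isDeepW, isSingW, isCW, W3.ge, W3.add, W3.sub, finPos, wge_some, wge_none, wadd_some, wadd_none_l, wadd_none_r, Option.map_some, Option.map_none, Option.map, Bool.and_eq_true, Bool.or_eq_true, Bool.not_eq_true', Bool.not_eq_eq_eq_not, Bool.not_true, Bool.not_false, Bool.and_eq_false_eq_eq_false_or_eq_false, decide_eq_true_eq, decide_eq_false_iff_not, not_le, Bool.true_and, Bool.and_true, true_and, and_true, Bool.false_eq_true, Bool.true_eq_false, false_or, or_false, Option.some.injEq, reduceCtorEq, false_and, and_false, or_true, true_or,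 exists_and_left, exists_and_right, exists_eq_left, exists_eq_left', exists_eq_right, exists_eq_right', exists_eq', exists_false, exists_const, false_iff, iff_false, not_false_eq_true, not_true_eq_false, ite_true, ite_false, if_true, if_false, Bool.true_or, Bool.or_true, Bool.false_or, Bool.or_false, imp_false, not_lt] at *) <;> omega)


/-! ## §T4. Every legal move strictly decreases the potential. -/

/-- deep accept: `Φ` unchanged, one pending deep accept used up -/
theorem pot_D {ch : Chain} (hG : Good ch) {k : ℕ} (hk : kindAt ch k = .deep) :
    Phi (applyMove ch (.D k)) = Phi ch ∧ PD (applyMove ch (.D k)) < PD ch := by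
  obtain ⟨c, hc, hκ⟩ := kindAt_some hk (by decide)
  obtain ⟨hbd, hdeep⟩ := kindOf_deep hκ
  obtain ⟨xs, ys, rfl, rfl⟩ := split1 hc
  have hne := hG.pat_ne (a := c) (by simp)
  obtain ⟨hs, hK⟩ := settle_deep c.w hne hdeep
  simp only [applyMove, modify_split, Phi, PD, List.map_append, List.map_cons, List.sum_append, List.sum_cons, hs]
  refine ⟨?_, ?_⟩
  · trivial
  · omega

/-- `α = 2` accept of a boundary curve with finite `w₀ ≥ 2` and no top point, in a state without deep curves: `Φ`, `PD` do not
increase and `S0` drops -/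
theorem pot_acc {ch : Chain} (hG : Good ch) (hnd : ∀ j, kindAt ch j ≠ .deep) {k : ℕ} {c : Curve} (hc : ch[k]? = some c)
    (hw0 : c.w.w0 = some 2) (hnotop : ∀ i ∈ ptsOf ch.length k, topAt ch i = false) :
    Phi (ch.modify k (fun c => { c with w := c.w.sub 2 1 0, w3 := c.w3 + 1 })) ≤ Phi ch ∧
      PD (ch.modify k (fun c => { c with w := c.w.sub 2 1 0, w3 := c.w3 + 1 })) ≤ PD ch ∧
        S0 (ch.modify k (fun c => { c with w := c.w.sub 2 1 0, w3 := c.w3 + 1 })) < S0 ch := by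
  have hcnd : isDeepW c.w = false := member_notDeep hG hnd (List.mem_of_getElem? hc)
  obtain ⟨xs, ys, hch, hlen⟩ := split1 hc
  have hleft : ∀ xs' p, xs = xs' ++ [p] → isDeepW (p.w.add c.w) = false ∧ isDeepW p.w = false := by
    intro xs' p hxs
    have hp : p ∈ ch := by rw [hch, hxs]; simp
    refine ⟨?_, member_notDeep hG hnd hp⟩
    have hi : k - 1 ∈ ptsOf ch.length k := mem_ptsOf_left (by rw [← hlen, hxs]; simp)
    have ht := hnotop (k - 1) hi
    have hn : nodeAt ch (k - 1) = some (p, c) := by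
      have : k - 1 = xs'.length := by rw [← hlen, hxs]; simp
      rw [this, hch, hxs, List.append_assoc, List.singleton_append]; exact nodeAt_split xs' p c ys
    unfold topAt at ht; rw [hn] at ht; simp only at ht; rw [topN_eq] at ht; exact ht
  have hright : ∀ q ys', ys = q :: ys' → isDeepW (c.w.add q.w) = false ∧ isDeepW q.w = false := by
    intro q ys' hys
    have hq : q ∈ ch := by rw [hch, hys]; simp
    refine ⟨?_, member_notDeep hG hnd hq⟩
    have hi : k ∈ ptsOf ch.length k := mem_ptsOf_right (by rw [hch, hys]; simp; omega)
    have ht := hnotop k hi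
    have hn : nodeAt ch k = some (c, q) := by rw [← hlen, hch, hys]; exact nodeAt_split xs c q ys'
    unfold topAt at ht; rw [hn] at ht; simp only at ht; rw [topN_eq] at ht; exact ht
  subst hch; subst hlen
  simp only [modify_split, Phi, PD, S0, List.map_append, List.map_cons, List.sum_append, List.sum_cons]
  refine ⟨?_, ?_, ?_⟩
  · apply pairSum_replace_le
    · intro Xs' p' hX
      -- the left neighbour, mapped
      rcases List.eq_nil_or_concat xs with hxs | ⟨xs', p, hxs⟩
      · rw [hxs] at hX; simp at hX
      · rw [List.concat_eq_append] at hxs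
        obtain ⟨h1, h2⟩ := hleft xs' p hxs
        rw [hxs, List.map_append, List.map_cons, List.map_nil] at hX
        obtain ⟨_, h2'⟩ := List.append_inj' hX rfl
        have hp' : p' = settle p.w := by simpa using h2'.symm
        subst hp'
        show phi (settle p.w) (settle (c.w.sub 2 1 0)) = 0
        rw [settle_of_not_deep p.w h2, settle_of_not_deep _ (notDeep_sub c.w 2 1 0 hcnd)]
        unfold phi; rw [if_neg]; rw [notDeep_add_sub_right p.w c.w 2 1 0 h1]; exact Bool.false_ne_true
    · intro q' Ys' hY
      rcases ys with _ | ⟨q, ys'⟩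
      · simp at hY
      · obtain ⟨h1, h2⟩ := hright q ys' rfl
        rw [List.map_cons] at hY
        obtain ⟨rfl, _⟩ := List.cons.inj hY
        show phi (settle (c.w.sub 2 1 0)) (settle q.w) = 0
        rw [settle_of_not_deep q.w h2, settle_of_not_deep _ (notDeep_sub c.w 2 1 0 hcnd)]
        unfold phi; rw [if_neg]; rw [notDeep_add_sub_left c.w q.w 2 1 0 h1]; exact Bool.false_ne_true
  · have := settleK_sub210_le c.w
    show (List.map (fun c => settleK c.w) xs).sum + (settleK (c.w.sub 2 1 0) + (List.map (fun c => settleK c.w) ys).sum) ≤ _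
    omega
  · show (List.map (fun c => c.w.w0.getD 0) xs).sum + ((c.w.sub 2 1 0).w0.getD 0 + (List.map (fun c => c.w.w0.getD 0) ys).sum) < _
    simp only [W3.sub, hw0, Option.map_some, Option.getD_some]
    omega

theorem node_of_topAt {ch : Chain} {i : ℕ} (ht : topAt ch i = true) : ∃ a b, nodeAt ch i = some (a, b) ∧ topN a b = true := by
  unfold topAt at ht
  cases hn : nodeAt ch i with
  | none => simp [hn] at ht
  | some ab => obtain ⟨a, b⟩ := ab; exact ⟨a, b, rfl, by simpa [hn] using ht⟩

/-- exponent-3 blow-up of a TOP point in a state without deep curves: `Φ` drops -/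
theorem pot_blowup3 {ch : Chain} (hG : Good ch) (hnd : ∀ j, kindAt ch j ≠ .deep) {i : ℕ} (ht : topAt ch i = true) :
    Phi (blowup ch i 3) < Phi ch := by
  obtain ⟨a, b, hn, htn⟩ := node_of_topAt ht
  obtain ⟨xs, ys, hch, hlen⟩ := split2 hn
  have ha : a ∈ ch := by rw [hch]; simp
  have hb : b ∈ ch := by rw [hch]; simp
  have hand : isDeepW a.w = false := member_notDeep hG hnd ha
  have hbnd : isDeepW b.w = false := member_notDeep hG hnd hb
  have hp : pat a.w = pat b.w := hG.pat_eq ha hb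
  have hne : pat a.w ≠ (false, false, false) := hG.pat_ne ha
  rw [topN_eq] at htn
  have key := phi_split a.w b.w hp hne hand hbnd htn
  unfold blowup; rw [hn]; simp only
  subst hlen; rw [hch, insert_split]
  simp only [Phi, List.map_append, List.map_cons]
  have := pairSum_insert phi (xs.map fun c => settle c.w) (settle a.w) (settle (nb3 a.w b.w)) (settle b.w) (ys.map fun c => settle c.w)
  change pairSum phi (List.map (fun c => settle c.w) xs ++ settle a.w :: settle (nb3 a.w b.w) :: settle b.w :: List.map (fun c => settle c.w) ys) <
    pairSum phi (List.map (fun c => settle c.w) xs ++ settle a.w :: settle b.w :: List.map (fun c => settle c.w) ys)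
  rw [settle_of_not_deep a.w hand, settle_of_not_deep b.w hbnd] at this ⊢
  omega

/-- exponent-2 blow-up of an isolated non-top Sing₂ point: `Φ`, `PD`, `S0` do not increase and the tail measure drops -/
theorem pot_blowup2 {topj : ℕ} {ch : Chain} (hG : Good ch) (hnd : ∀ j, kindAt ch j ≠ .deep) {i : ℕ}
    (hm : Move.P i ∈ legalMoves topj ch) (ht : topAt ch i = false) :
    Phi (blowup ch i 2) ≤ Phi ch ∧ PD (blowup ch i 2) ≤ PD ch ∧ S0 (blowup ch i 2) ≤ S0 ch ∧ TT (blowup ch i 2) < TT ch := by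
  obtain ⟨hs, hh1, hh2⟩ := P_mem_legalMoves topj ch i hm
  unfold sing2At at hs
  cases hn : nodeAt ch i with
  | none => simp [hn] at hs
  | some ab =>
    obtain ⟨a, b⟩ := ab
    simp only [hn] at hs
    have htn : topN a b = false := by unfold topAt at ht; simpa [hn] using ht
    obtain ⟨x, y, hx, hy, hxy⟩ := o0_of_sing2_not_top a b hs htn
    obtain ⟨d1, d2, dK, dnb, dw0⟩ := nb2_facts a.w b.w x y hx hy hxy
    obtain ⟨hia, hib⟩ := nodeAt_some hn
    obtain ⟨xs, ys, hch, hlen⟩ := split2 hn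
    have ha : a ∈ ch := by rw [hch]; simp
    have hb : b ∈ ch := by rw [hch]; simp
    have hand : isDeepW a.w = false := member_notDeep hG hnd ha
    have hbnd : isDeepW b.w = false := member_notDeep hG hnd hb
    have hp : pat a.w = pat b.w := hG.pat_eq ha hb
    have hlen' : i + 1 < ch.length := by rw [hch]; simp; omega
    have hca : a.bd = true → isCW a.w = false := by
      intro hbd
      cases hcw : isCW a.w
      · rfl
      · have := handled_of_CW_sing2 hia hbd hcw (mem_ptsOf_right hlen') (by unfold sing2At; rw [hn]; exact hs)
        rw [hh1] at this; exact absurd this Bool.false_ne_true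
    have hcb : b.bd = true → isCW b.w = false := by
      intro hbd
      cases hcw : isCW b.w
      · rfl
      · have := handled_of_CW_sing2 hib hbd hcw (mem_ptsOf_left rfl) (by unfold sing2At; rw [hn]; exact hs)
        rw [hh2] at this; exact absurd this Bool.false_ne_true
    have keyT := tterm_P2 a b hp hs htn hca hcb (a.w3 + b.w3 + 3 - 2)
    unfold blowup; rw [hn]; simp only
    subst hlen; rw [hch, insert_split]
    simp only [Phi, PD, S0, TT, List.map_append, List.map_cons, List.sum_append, List.sum_cons]
    have hPhi := pairSum_insert phi (xs.map fun c => settle c.w) (settle a.w) (settle (nb2 a.w b.w)) (settle b.w) (ys.map fun c => settle c.w)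
    rw [settle_of_not_deep a.w hand, settle_of_not_deep b.w hbnd, settle_of_not_deep _ dnb] at hPhi
    have hz1 : phi a.w (nb2 a.w b.w) = 0 := by unfold phi; rw [if_neg]; rw [d1]; exact Bool.false_ne_true
    have hz2 : phi (nb2 a.w b.w) b.w = 0 := by unfold phi; rw [if_neg]; rw [d2]; exact Bool.false_ne_true
    have hT := pairSum_insert tterm xs a ⟨nb2 a.w b.w, a.w3 + b.w3 + 3 - 2, true⟩ b ys
    refine ⟨?_, ?_, ?_, ?_⟩
    · change pairSum phi (List.map (fun c => settle c.w) xs ++ settle a.w :: settle (nb2 a.w b.w) :: settle b.w :: List.map (fun c => settle c.w) ys) ≤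
        pairSum phi (List.map (fun c => settle c.w) xs ++ settle a.w :: settle b.w :: List.map (fun c => settle c.w) ys)
      rw [settle_of_not_deep a.w hand, settle_of_not_deep b.w hbnd, settle_of_not_deep _ dnb]
      omega
    · change (List.map (fun c => settleK c.w) xs).sum + (settleK a.w + (settleK (nb2 a.w b.w) + (settleK b.w + (List.map (fun c => settleK c.w) ys).sum))) ≤
        (List.map (fun c => settleK c.w) xs).sum + (settleK a.w + (settleK b.w + (List.map (fun c => settleK c.w) ys).sum))
      rw [dK]; omega
    · change (List.map (fun c => c.w.w0.getD 0) xs).sum + (a.w.w0.getD 0 + ((nb2 a.w b.w).w0.getD 0 + (b.w.w0.getD 0 + (List.map (fun c => c.w.w0.getD 0) ys).sum))) ≤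
        (List.map (fun c => c.w.w0.getD 0) xs).sum + (a.w.w0.getD 0 + (b.w.w0.getD 0 + (List.map (fun c => c.w.w0.getD 0) ys).sum))
      rw [dw0]; simp only [Option.getD_some]; omega
    · change pairSum tterm (xs ++ a :: (⟨nb2 a.w b.w, a.w3 + b.w3 + 3 - 2, true⟩ : Curve) :: b :: ys) < pairSum tterm (xs ++ a :: b :: ys)
      omega

/-- what the mode gives: an accepted curve has no top point -/
theorem notop_of_mode {topj : ℕ} {ch : Chain} (hM : ModeOK topj ch) : AccFacts topj ch := by
  rcases hM with h | h
  · exact AccFacts_of_topj h ch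
  · exact AccFacts_of_bd topj ch h

/-- THE STEP: every legal move strictly decreases the potential (in a good state of a covered mode). -/
theorem pot_step {topj : ℕ} {ch : Chain} (hG : Good ch) (hM : ModeOK topj ch) {m : Move} (hm : m ∈ legalMoves topj ch) :
    LT4 (pot (applyMove ch m)) (pot ch) := by
  cases m with
  | D k =>
    obtain ⟨h1, h2⟩ := pot_D hG (D_mem_legalMoves topj ch k hm)
    exact LT4_of2 _ _ _ _ (le_of_eq h1) h2
  | A k =>
    have hnd := legal_noDeep hm (by intro k'; simp) 
    obtain ⟨hk, _⟩ := A_mem_legalMoves topj ch k hm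
    obtain ⟨c, hc, hκ⟩ := kindAt_some hk (by decide)
    have hw0 := w0_of_borderline c hκ
    have hnotop := notop_of_mode hM k (Or.inl hm)
    obtain ⟨h1, h2, h3⟩ := pot_acc hG hnd hc hw0 hnotop
    exact LT4_of3 _ _ h1 h2 h3
  | AL k =>
    have hnd := legal_noDeep hm (by intro k'; simp)
    obtain ⟨hk, hrel, hjs⟩ := AL_mem_legalMoves topj ch k hm
    obtain ⟨c, hc, hκ⟩ := kindAt_some hk (by decide)
    have hnotop := notop_of_mode hM k (Or.inr hm)
    obtain ⟨i, hi, hsi⟩ := List.any_eq_true.mp hrel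
    have hw0 : c.w.w0 = some 2 := (node_of_sing2_not_top hc (w0_of_light c hκ) hi hsi (hnotop i hi)).1
    obtain ⟨h1, h2, h3⟩ := pot_acc hG hnd hc hw0 hnotop
    exact LT4_of3 _ _ h1 h2 h3
  | I i =>
    have hnd := legal_noDeep hm (by intro k'; simp)
    have ht := I_mem_legalMoves topj ch i hm
    exact LT4_of1 _ _ _ _ _ _ (pot_blowup3 hG hnd ht)
  | P i =>
    have hnd := legal_noDeep hm (by intro k'; simp)
    cases ht : topAt ch i with
    | true =>
      have : applyMove ch (.P i) = blowup ch i 3 := by simp [applyMove, ht]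
      rw [this]
      exact LT4_of1 _ _ _ _ _ _ (pot_blowup3 hG hnd ht)
    | false =>
      have : applyMove ch (.P i) = blowup ch i 2 := by simp [applyMove, ht]
      rw [this]
      obtain ⟨h1, h2, h3, h4⟩ := pot_blowup2 hG hnd hm ht
      exact LT4_of4 h1 h2 h3 h4

/-! ### the hypotheses are invariants -/

theorem Good_applyMove {topj : ℕ} {ch : Chain} (hG : Good ch) {m : Move} (hm : m ∈ legalMoves topj ch) : Good (applyMove ch m) := by
  obtain ⟨⟨P, hPne, hP⟩, hres⟩ := hG
  -- accepts: one boundary curve modified by `sub`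
  have hmod : ∀ (k : ℕ) (d0 d1 d2 e : ℕ), (kindAt ch k = .deep ∨ kindAt ch k = .borderline ∨ kindAt ch k = .light) →
      Good (ch.modify k (fun c => { c with w := c.w.sub d0 d1 d2, w3 := c.w3 + e })) := by
    intro k d0 d1 d2 e hk
    have hbdk : ∀ c₀, ch[k]? = some c₀ → c₀.bd = true := by
      intro c₀ hc₀
      have hκ : kindAt ch k = kindOf c₀ := by unfold kindAt; rw [hc₀]
      rw [hκ] at hk
      rcases hk with h | h | h
      · exact (kindOf_deep h).1
      · exact kindOf_bd (Or.inl h)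
      · exact kindOf_bd (Or.inr h)
    refine ⟨⟨P, hPne, ?_⟩, ?_⟩
    · intro c hc
      rcases mem_modify_cases hc with hc | ⟨c₀, hc₀, rfl⟩
      · exact hP c hc
      · simp only [pat_sub]; exact hP c₀ (List.mem_of_getElem? hc₀)
    · intro c hc hb
      rcases mem_modify_cases hc with hc | ⟨c₀, hc₀, rfl⟩
      · exact hres c hc hb
      · simp only at hb; rw [hbdk c₀ hc₀] at hb; exact absurd hb (by decide)
  -- blow-ups: one boundary curve inserted, with the pattern of its branches
  have hbl : ∀ (i α : ℕ), Good (blowup ch i α) := by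
    intro i α
    unfold blowup
    cases hn : nodeAt ch i with
    | none => exact ⟨⟨P, hPne, hP⟩, hres⟩
    | some ab =>
      obtain ⟨a, b⟩ := ab
      simp only
      obtain ⟨hia, hib⟩ := nodeAt_some hn
      have hpa := hP a (List.mem_of_getElem? hia)
      have hpb := hP b (List.mem_of_getElem? hib)
      refine ⟨⟨P, hPne, ?_⟩, ?_⟩
      · intro c hc
        rcases List.eq_or_mem_of_mem_insertIdx hc with rfl | hc
        · simp only
          rw [← hpa]
          rw [← hpa] at hpb
          revert hpb
          rcases a with ⟨⟨_ | a0, _ | a1, _ | a2⟩, a3, abd⟩ <;> rcases b with ⟨⟨_ | b0, _ | b1, _ | b2⟩, b3, bbd⟩ <;>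
            simp [pat, W3.add, wadd_some, wadd_none_l, wadd_none_r]
        · exact hP c hc
      · intro c hc hb
        rcases List.eq_or_mem_of_mem_insertIdx hc with rfl | hc
        · simp at hb
        · exact hres c hc hb
  cases m with
  | D k =>
    have := hmod k 3 2 1 0 (Or.inl (D_mem_legalMoves topj ch k hm))
    simpa [applyMove] using this
  | A k => exact hmod k 2 1 0 1 (Or.inr (Or.inl (A_mem_legalMoves topj ch k hm).1))
  | AL k => exact hmod k 2 1 0 1 (Or.inr (Or.inr (AL_mem_legalMoves topj ch k hm).1))
  | I i => exact hbl i 3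
  | P i => exact hbl i _

theorem ModeOK_applyMove {topj : ℕ} {ch : Chain} (hM : ModeOK topj ch) (m : Move) : ModeOK topj (applyMove ch m) := by
  rcases hM with h | h
  · exact Or.inl h
  · exact Or.inr (bd_applyMove h m)

/-! ## §T5. TERMINATION: no infinite legal play; every legal play is bounded. -/

/-- the states along an infinite sequence of moves -/
def playState (ch : Chain) (f : ℕ → Move) : ℕ → Chain
  | 0 => ch
  | n + 1 => applyMove (playState ch f n) (f n)

/-- `f` is an INFINITE LEGAL PLAY from `ch`: every move is legal in the state it is played in -/
def IsInfinitePlay (topj : ℕ) (ch : Chain) (f : ℕ → Move) : Prop := ∀ n, f n ∈ legalMoves topj (playState ch f n)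

theorem playState_shift (ch : Chain) (f : ℕ → Move) (n : ℕ) :
    playState (applyMove ch (f 0)) (fun k => f (k + 1)) n = playState ch f (n + 1) := by
  induction n with
  | zero => rfl
  | succ n ih => simp only [playState, ih]

/-- THEOREM (S4, termination). Under `G_mult` (any `topj ≥ 2`), and in mode `uv` (all curves boundary) under any rule set, the
toric S-game admits NO INFINITE LEGAL PLAY from any good state (all curves with the same non-empty set of finite grades, residual
branches not deep) — in particular from every initial state of loop note §9 / the (T″) sheet, for ALL weights. -/
theorem no_infinite_play (topj : ℕ) (ch : Chain) (hG : Good ch) (hM : ModeOK topj ch) (f : ℕ → Move) :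
    ¬ IsInfinitePlay topj ch f := by
  suffices H : ∀ v, ∀ ch : Chain, pot ch = v → Good ch → ModeOK topj ch → ∀ f, ¬ IsInfinitePlay topj ch f from
    H _ ch rfl hG hM f
  intro v
  refine LT4_wf.induction
    (C := fun v => ∀ ch : Chain, pot ch = v → Good ch → ModeOK topj ch → ∀ f, ¬ IsInfinitePlay topj ch f) v ?_
  intro v ih ch hv hG hM f hf
  have h0 : f 0 ∈ legalMoves topj ch := hf 0
  have hlt : LT4 (pot (applyMove ch (f 0))) v := by rw [← hv]; exact pot_step hG hM h0
  refine ih _ hlt (applyMove ch (f 0)) rfl (Good_applyMove hG h0) (ModeOK_applyMove hM (f 0)) (fun k => f (k + 1)) ?_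
  intro n
  rw [playState_shift]
  exact hf (n + 1)

/-- the same in terms of finite plays: no sequence of moves all of whose finite prefixes are legal plays -/
theorem applyMoves_snoc (ch : Chain) (l : List Move) (m : Move) : applyMoves ch (l ++ [m]) = applyMove (applyMoves ch l) m := by
  simp [applyMoves, List.foldl_append]

theorem applyMoves_range (ch : Chain) (f : ℕ → Move) (n : ℕ) : applyMoves ch ((List.range n).map f) = playState ch f n := by
  induction n with
  | zero => rfl
  | succ n ih => rw [List.range_succ, List.map_append, List.map_singleton, applyMoves_snoc, ih]; rfl

theorem no_infinite_legal_prefixes (topj : ℕ) (ch : Chain) (hG : Good ch) (hM : ModeOK topj ch) (f : ℕ → Move) :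
    ¬ ∀ n, isLegalPlay topj ch ((List.range n).map f) = true := by
  intro h
  apply no_infinite_play topj ch hG hM f
  intro n
  have := h (n + 1)
  rw [List.range_succ, List.map_append, List.map_singleton] at this
  obtain ⟨_, h2⟩ := isLegalPlay_append _ _ ch this
  rw [applyMoves_range] at h2
  exact (isLegalPlay_cons h2).1

/-- one legal step between good states of the mode -/
def Step (topj : ℕ) (ch' ch : Chain) : Prop := Good ch ∧ ModeOK topj ch ∧ ∃ m ∈ legalMoves topj ch, ch' = applyMove ch m

theorem Step_wf (topj : ℕ) : WellFounded (Step topj) := by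
  refine Subrelation.wf ?_ (InvImage.wf pot LT4_wf)
  rintro ch' ch ⟨hG, hM, m, hm, rfl⟩
  exact pot_step hG hM hm

/-- THEOREM (S4, bounded form). From every good state of a covered mode the legal plays have BOUNDED LENGTH (König: finitely many legal
moves in each state and no infinite play). -/
theorem legalPlays_bounded (topj : ℕ) (ch : Chain) (hG : Good ch) (hM : ModeOK topj ch) :
    ∃ N, ∀ l : List Move, isLegalPlay topj ch l = true → l.length ≤ N := by
  revert hG hM
  refine (Step_wf topj).induction
    (C := fun ch => Good ch → ModeOK topj ch → ∃ N, ∀ l : List Move, isLegalPlay topj ch l = true → l.length ≤ N) ch ?_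
  intro ch ih hG hM
  -- a bound for each legal move, then the maximum over the finite list of legal moves
  have hb : ∀ L : List Move, (∀ m ∈ L, m ∈ legalMoves topj ch) →
      ∃ N, ∀ m ∈ L, ∀ l : List Move, isLegalPlay topj (applyMove ch m) l = true → l.length ≤ N := by
    intro L
    induction L with
    | nil => intro _; exact ⟨0, fun m hm => by simp at hm⟩
    | cons m L ihL =>
      intro hL
      obtain ⟨N₁, hN₁⟩ := ih (applyMove ch m) ⟨hG, hM, m, hL m (by simp), rfl⟩ (Good_applyMove hG (hL m (by simp)))
        (ModeOK_applyMove hM m)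
      obtain ⟨N₂, hN₂⟩ := ihL (fun m' hm' => hL m' (by simp [hm']))
      refine ⟨max N₁ N₂, ?_⟩
      intro m' hm' l hl
      rcases List.mem_cons.mp hm' with rfl | hm'
      · exact le_trans (hN₁ l hl) (le_max_left _ _)
      · exact le_trans (hN₂ m' hm' l hl) (le_max_right _ _)
  obtain ⟨N, hN⟩ := hb (legalMoves topj ch) (fun m hm => hm)
  refine ⟨N + 1, ?_⟩
  intro l hl
  cases l with
  | nil => simp
  | cons m l =>
    obtain ⟨hm, hl'⟩ := isLegalPlay_cons hl
    have := hN m hm l hl'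
    simp only [List.length_cons]; omega

/-! ### the initial states of the sheet -/

/-- mode `uv` initial state `V(t) — V(s)` (both boundary): good for every pair of weight vectors with the same non-empty pattern -/
theorem Good_init_uv (wt ws : W3) (w3t w3s : ℕ) (hp : pat wt = pat ws) (hne : pat wt ≠ (false, false, false)) :
    Good [⟨wt, w3t, true⟩, ⟨ws, w3s, true⟩] ∧ ∀ topj, ModeOK topj [⟨wt, w3t, true⟩, ⟨ws, w3s, true⟩] := by
  refine ⟨⟨⟨pat wt, hne, ?_⟩, ?_⟩, fun topj => Or.inr ?_⟩
  · intro c hc; simp at hc; rcases hc with rfl | rfl <;> simp [hp]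
  · intro c hc hb; simp at hc; rcases hc with rfl | rfl <;> simp at hb
  · intro c hc; simp at hc; rcases hc with rfl | rfl <;> rfl

/-- mode `u` initial state `R — V(s)` (`R` residual with exponents `c`, not deep): good, and covered under `G_mult` -/
theorem Good_init_u (c ws : W3) (w3s : ℕ) (hp : pat c = pat ws) (hne : pat c ≠ (false, false, false)) (hc : isDeepW c = false)
    (topj : ℕ) (htop : 2 ≤ topj) :
    Good [⟨c, 0, false⟩, ⟨ws, w3s, true⟩] ∧ ModeOK topj [⟨c, 0, false⟩, ⟨ws, w3s, true⟩] := by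
  refine ⟨⟨⟨pat c, hne, ?_⟩, ?_⟩, Or.inl htop⟩
  · intro x hx; simp at hx; rcases hx with rfl | rfl <;> simp [hp]
  · intro x hx hb; simp at hx; rcases hx with rfl | rfl
    · exact hc
    · simp at hb

/-- COROLLARY: the S-game of the (T″) sheet terminates from every initial state, for all weights — mode `uv`, any rule set. -/
theorem terminates_uv (topj : ℕ) (wt ws : W3) (w3t w3s : ℕ) (hp : pat wt = pat ws) (hne : pat wt ≠ (false, false, false))
    (f : ℕ → Move) : ¬ IsInfinitePlay topj [⟨wt, w3t, true⟩, ⟨ws, w3s, true⟩] f :=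
  no_infinite_play topj _ (Good_init_uv wt ws w3t w3s hp hne).1 ((Good_init_uv wt ws w3t w3s hp hne).2 topj) f

/-- COROLLARY: mode `u` under `G_mult` (`topj ≥ 2`), residual exponents not deep. -/
theorem terminates_u (topj : ℕ) (htop : 2 ≤ topj) (c ws : W3) (w3s : ℕ) (hp : pat c = pat ws) (hne : pat c ≠ (false, false, false))
    (hc : isDeepW c = false) (f : ℕ → Move) : ¬ IsInfinitePlay topj [⟨c, 0, false⟩, ⟨ws, w3s, true⟩] f :=
  no_infinite_play topj _ (Good_init_u c ws w3s hp hne hc topj htop).1 (Good_init_u c ws w3s hp hne hc topj htop).2 f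


/-! ## §T7. Mode `u` under the HISTORICAL rule sets: loop note rev 3 (`topj = 1`) and rev 2 (`topj = 0`).

In mode `u` the chain is `R :: K₁ :: ⋯` with `R` the residual branch (never a centre, never deep) and all other curves boundary; node 0 is the
T-point. Under `topj ≥ 2` an accepted curve has no top point (§T4). Under `topj ≤ 1` a BORDERLINE `K₁` may be accepted through a TOP non-jump
T-point (then `c₀ = 1`, `w₀(K₁) = 2`, and the point dies), and under `topj = 0` a relevant LIGHT `K₁` too; the latter either kills the point (tight
grade 0 or 1) or is a T-RUN step (`c₂ = 1`, `w₂(K₁) = 0`: the point stays top with `o₂ = 1`, is not a jump point, and `K₁` is light-accepted again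
until `w₀` or `w₁` is exhausted). The node potential `Φ` is NOT monotone along a T-run (`c = (100,1,1)`, `K₁ = (3,2,0)`: `M′` jumps 9 → 204 at the
first light accept); the T-SETTLED potential `Φ_T` evaluates node 0 at the END of the pending T-run (`trun`), and the remaining run length `PT`
joins the pending deep accepts. -/

/-! ### accepts, sharpened: no `w₀` hypothesis; the no-top condition at each point may hold before OR after the move -/

theorem pot_acc_le {ch : Chain} (hG : Good ch) (hnd : ∀ j, kindAt ch j ≠ .deep) {k : ℕ} {c : Curve} (hc : ch[k]? = some c)
    (hnotop : ∀ i ∈ ptsOf ch.length k, topAt ch i = false ∨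
      topAt (ch.modify k (fun c => { c with w := c.w.sub 2 1 0, w3 := c.w3 + 1 })) i = false) :
    Phi (ch.modify k (fun c => { c with w := c.w.sub 2 1 0, w3 := c.w3 + 1 })) ≤ Phi ch ∧
      PD (ch.modify k (fun c => { c with w := c.w.sub 2 1 0, w3 := c.w3 + 1 })) ≤ PD ch := by
  have hcnd : isDeepW c.w = false := member_notDeep hG hnd (List.mem_of_getElem? hc)
  obtain ⟨xs, ys, hch, hlen⟩ := split1 hc
  have hch' : ch.modify k (fun c => { c with w := c.w.sub 2 1 0, w3 := c.w3 + 1 }) =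
      xs ++ ({ c with w := c.w.sub 2 1 0, w3 := c.w3 + 1 } : Curve) :: ys := by
    rw [hch, ← hlen]; exact modify_split xs c ys _
  have hleft : ∀ xs' p, xs = xs' ++ [p] → isDeepW (p.w.add (c.w.sub 2 1 0)) = false ∧ isDeepW p.w = false := by
    intro xs' p hxs
    have hp : p ∈ ch := by rw [hch, hxs]; simp
    refine ⟨?_, member_notDeep hG hnd hp⟩
    have hi : k - 1 ∈ ptsOf ch.length k := mem_ptsOf_left (by rw [← hlen, hxs]; simp)
    have hk1 : k - 1 = xs'.length := by rw [← hlen, hxs]; simp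
    rcases hnotop (k - 1) hi with ht | ht
    · have hn : nodeAt ch (k - 1) = some (p, c) := by
        rw [hk1, hch, hxs, List.append_assoc, List.singleton_append]; exact nodeAt_split xs' p c ys
      unfold topAt at ht; rw [hn] at ht; simp only at ht; rw [topN_eq] at ht
      exact notDeep_add_sub_right p.w c.w 2 1 0 ht
    · have hn : nodeAt (ch.modify k (fun c => { c with w := c.w.sub 2 1 0, w3 := c.w3 + 1 })) (k - 1) =
          some (p, { c with w := c.w.sub 2 1 0, w3 := c.w3 + 1 }) := by
        rw [hch', hk1, hxs, List.append_assoc, List.singleton_append]; exact nodeAt_split xs' p _ ys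
      unfold topAt at ht; rw [hn] at ht; simp only at ht; rw [topN_eq] at ht
      exact ht
  have hright : ∀ q ys', ys = q :: ys' → isDeepW ((c.w.sub 2 1 0).add q.w) = false ∧ isDeepW q.w = false := by
    intro q ys' hys
    have hq : q ∈ ch := by rw [hch, hys]; simp
    refine ⟨?_, member_notDeep hG hnd hq⟩
    have hi : k ∈ ptsOf ch.length k := mem_ptsOf_right (by rw [hch, hys]; simp; omega)
    rcases hnotop k hi with ht | ht
    · have hn : nodeAt ch k = some (c, q) := by rw [← hlen, hch, hys]; exact nodeAt_split xs c q ys'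
      unfold topAt at ht; rw [hn] at ht; simp only at ht; rw [topN_eq] at ht
      exact notDeep_add_sub_left c.w q.w 2 1 0 ht
    · have hn : nodeAt (ch.modify k (fun c => { c with w := c.w.sub 2 1 0, w3 := c.w3 + 1 })) k =
          some ({ c with w := c.w.sub 2 1 0, w3 := c.w3 + 1 }, q) := by
        rw [hch', ← hlen, hys]; exact nodeAt_split xs _ q ys'
      unfold topAt at ht; rw [hn] at ht; simp only at ht; rw [topN_eq] at ht
      exact ht
  rw [hch']; rw [hch]
  simp only [Phi, PD, List.map_append, List.map_cons, List.sum_append, List.sum_cons]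
  refine ⟨?_, ?_⟩
  · apply pairSum_replace_le
    · intro Xs' p' hX
      rcases List.eq_nil_or_concat xs with hxs | ⟨xs', p, hxs⟩
      · rw [hxs] at hX; simp at hX
      · rw [List.concat_eq_append] at hxs
        obtain ⟨h1, h2⟩ := hleft xs' p hxs
        rw [hxs, List.map_append, List.map_cons, List.map_nil] at hX
        obtain ⟨_, h2'⟩ := List.append_inj' hX rfl
        have hp' : p' = settle p.w := by simpa using h2'.symm
        subst hp'
        show phi (settle p.w) (settle (c.w.sub 2 1 0)) = 0
        rw [settle_of_not_deep p.w h2, settle_of_not_deep _ (notDeep_sub c.w 2 1 0 hcnd)]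
        unfold phi; rw [if_neg]; rw [h1]; exact Bool.false_ne_true
    · intro q' Ys' hY
      rcases ys with _ | ⟨q, ys'⟩
      · simp at hY
      · obtain ⟨h1, h2⟩ := hright q ys' rfl
        rw [List.map_cons] at hY
        obtain ⟨rfl, _⟩ := List.cons.inj hY
        show phi (settle (c.w.sub 2 1 0)) (settle q.w) = 0
        rw [settle_of_not_deep q.w h2, settle_of_not_deep _ (notDeep_sub c.w 2 1 0 hcnd)]
        unfold phi; rw [if_neg]; rw [h1]; exact Bool.false_ne_true
  · have := settleK_sub210_le c.w
    show (List.map (fun c => settleK c.w) xs).sum + (settleK (c.w.sub 2 1 0) + (List.map (fun c => settleK c.w) ys).sum) ≤ _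
    omega

/-- an accept never increases `S0`, and decreases it if the accepted curve has finite `w₀ ≥ 1` -/
theorem S0_acc {ch : Chain} {k : ℕ} {c : Curve} (hc : ch[k]? = some c) :
    S0 (ch.modify k (fun c => { c with w := c.w.sub 2 1 0, w3 := c.w3 + 1 })) ≤ S0 ch ∧
      ∀ x, c.w.w0 = some x → 1 ≤ x → S0 (ch.modify k (fun c => { c with w := c.w.sub 2 1 0, w3 := c.w3 + 1 })) < S0 ch := by
  obtain ⟨xs, ys, hch, hlen⟩ := split1 hc
  subst hch; subst hlen
  simp only [modify_split, S0, List.map_append, List.map_cons, List.sum_append, List.sum_cons]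
  constructor
  · show (List.map (fun c => c.w.w0.getD 0) xs).sum + ((c.w.sub 2 1 0).w0.getD 0 + (List.map (fun c => c.w.w0.getD 0) ys).sum) ≤ _
    cases h : c.w.w0 with
    | none => simp [W3.sub, h]
    | some x => simp [W3.sub, h]
  · intro x hx h1
    show (List.map (fun c => c.w.w0.getD 0) xs).sum + ((c.w.sub 2 1 0).w0.getD 0 + (List.map (fun c => c.w.w0.getD 0) ys).sum) < _
    simp [W3.sub, hx]; omega

/-- replacing one element by one whose adjacent terms are not larger -/
theorem pairSum_replace_mono {α : Type} (f : α → α → ℕ) (xs : List α) (c c' : α) (ys : List α)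
    (hl : ∀ p, f p c' ≤ f p c) (hr : ∀ q, f c' q ≤ f c q) :
    pairSum f (xs ++ c' :: ys) ≤ pairSum f (xs ++ c :: ys) := by
  rw [pairSum_cut f xs c' ys, pairSum_cut f xs c ys]
  have h1 : pairSum f (xs ++ [c']) ≤ pairSum f (xs ++ [c]) := by
    rcases List.eq_nil_or_concat xs with rfl | ⟨xs', p, rfl⟩
    · simp [pairSum]
    · simp only [List.concat_eq_append, List.append_assoc, List.singleton_append]
      rw [pairSum_snoc, pairSum_snoc]; have := hl p; omega
  have h2 : pairSum f (c' :: ys) ≤ pairSum f (c :: ys) := by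
    rcases ys with _ | ⟨q, ys'⟩
    · simp [pairSum]
    · rw [pairSum_cons_cons, pairSum_cons_cons]; have := hr q; omega
  omega

/-! ### node arithmetic at 𝒟-nodes and at the T-node -/

theorem sing2N_bd {a b : Curve} (ha : a.bd = true) (hb : b.bd = true) : sing2N a b = isSingW (a.w.add b.w) := by
  unfold sing2N resid; simp [ha, hb]

theorem singW_add_sub_left (a b : W3) (d0 d1 d2 : ℕ) (h : isSingW ((a.sub d0 d1 d2).add b) = true) : isSingW (a.add b) = true := by
  rcases a with ⟨_ | a0, _ | a1, _ | a2⟩ <;> rcases b with ⟨_ | b0, _ | b1, _ | b2⟩ <;>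
    simp only [isSingW, W3.ge, W3.sub, W3.add, wadd_some, wadd_none_l, wadd_none_r, wge_some, wge_none, Option.map_some,
      Option.map_none, Bool.and_eq_true, Bool.true_and, Bool.and_true, decide_eq_true_eq] at h ⊢ <;> omega

/-- the tail term of a node does not increase when its (boundary) left branch is accepted -/
theorem tterm_acc_left (a b : Curve) (ha : a.bd = true) (e : ℕ) :
    tterm ({ a with w := a.w.sub 2 1 0, w3 := e } : Curve) b ≤ tterm a b := by
  have hm : (wadd (a.w.sub 2 1 0).w1 b.w.w1).getD 0 ≤ (wadd a.w.w1 b.w.w1).getD 0 := by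
    rcases a with ⟨⟨_, _ | a1, _⟩, _, _⟩ <;> rcases b with ⟨⟨_, _ | b1, _⟩, _, _⟩ <;>
      simp [W3.sub, wadd_some, wadd_none_l, wadd_none_r]
  unfold tterm
  split_ifs with h1 h2
  · exact Nat.add_le_add_right hm 1
  · have := sing2N_mono_left (a := a) (a' := { a with w := a.w.sub 2 1 0, w3 := e }) (b := b) ha ha 2 1 0 rfl (by simpa using h2)
    rw [this] at h1; exact absurd h1 Bool.false_ne_true
  · exact Nat.zero_le _
  · exact Nat.zero_le _

/-- a TOP point is in particular a Sing₂ point: its tail term is positive -/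
theorem tterm_pos_of_top (a b : Curve) (h : topN a b = true) : 1 ≤ tterm a b := by
  unfold topN at h; unfold tterm
  rw [if_pos (Bool.and_eq_true_iff.mp h).1]; omega

theorem notBad_of_notTop (c v : W3) (h : isDeepW (c.add v) = false) : badW c v = false := by
  unfold badW; rw [h]; simp

theorem notBad_of_w2 (c v : W3) (h : v.w2 ≠ some 0) : badW c v = false := by
  unfold badW; rw [Bool.eq_false_iff]; intro hb
  simp only [Bool.and_eq_true, beq_iff_eq] at hb
  exact h hb.1.1.1.2

theorem notBad_of_sing (c v : W3) (h : isSingW v = true) : badW c v = false := by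
  apply notBad_of_w2
  intro h0
  rcases v with ⟨v0, v1, v2⟩; simp only at h0; subst h0
  simp [isSingW, W3.ge, wge_some] at h

theorem notBad_of_notCW (c v : W3) (h : isCW v = false) : badW c v = false := by
  rw [Bool.eq_false_iff]; intro hb
  simp only [badW, Bool.and_eq_true, beq_iff_eq] at hb
  obtain ⟨⟨⟨⟨_, h2⟩, h0⟩, h1⟩, _⟩ := hb
  have : isCW v = true := by
    rcases v with ⟨v0, v1, v2⟩; simp only at h2; subst h2
    simp only [isCW, W3.ge, h0, h1, wge_some]; decide
  rw [h] at this; exact Bool.false_ne_true this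

theorem w2_sub (v : W3) (d0 d1 : ℕ) : (v.sub d0 d1 0).w2 = v.w2 := by
  rcases v with ⟨_, _, _ | v2⟩ <;> simp [W3.sub]

/-- a JUMP T-point is not a T-run configuration (`c₂ ≥ 1` forces `o₂ ≥ 2` there) -/
theorem notBad_of_jump (R K : Curve) (hR : R.bd = false) (hj : jumpN R K = true) : badW R.w K.w = false := by
  rw [Bool.eq_false_iff]; intro hb
  simp only [badW, Bool.and_eq_true, beq_iff_eq] at hb
  obtain ⟨⟨⟨⟨h2c, h2k⟩, _⟩, _⟩, _⟩ := hb
  unfold jumpN topN sing2N resid at hj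
  rcases R with ⟨⟨r0, r1, r2⟩, r3, rbd⟩; rcases K with ⟨⟨k0, k1, k2⟩, k3, kbd⟩
  simp only at hR h2c h2k; subst hR h2c h2k
  simp [isDeepW, isSingW, W3.ge, W3.add, finPos, wge_some, wge_none, wadd_some, wadd_none_l, wadd_none_r, Nat.ble_eq] at hj

/-- accepting a BORDERLINE `K₁` through a non-jump T-point kills the point -/
theorem A_T_after (R K : Curve) (hR : R.bd = false) (hs : isSingW K.w = true) (hj : jumpN R K = false) :
    isDeepW (R.w.add (K.w.sub 2 1 0)) = false := by
  unfold jumpN topN sing2N resid at hj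
  rcases R with ⟨⟨_ | r0, _ | r1, _ | r2⟩, r3, rbd⟩ <;> rcases K with ⟨⟨_ | k0, _ | k1, _ | k2⟩, k3, kbd⟩ <;> simp only at hR <;> subst hR <;>
    simp only [ble_false_iff, Nat.ble_eq, isDeepW, isSingW, isCW, W3.ge, W3.add, W3.sub, finPos, wge_some, wge_none, wadd_some, wadd_none_l, wadd_none_r, Option.map_some, Option.map_none, Option.map, Bool.and_eq_true, Bool.or_eq_true, Bool.not_eq_true', Bool.not_eq_eq_eq_not, Bool.not_true, Bool.not_false, Bool.and_eq_false_eq_eq_false_or_eq_false, decide_eq_true_eq, decide_eq_false_iff_not, not_le, Bool.true_and, Bool.and_true, true_and, and_true, Bool.false_eq_true, Bool.true_eq_false, false_or, or_false, Option.some.injEq, reduceCtorEq, false_and, and_false, or_true, true_or, exists_and_left, exists_and_right, exists_eq_left, exists_eq_left', exists_eq_right, exists_eq_right', exists_eq', exists_false, exists_const, false_iff, iff_false, not_false_eq_true, not_true_eq_false, ite_true, ite_false, if_true, if_false, Bool.true_or, Bool.or_true, Bool.false_or, Bool.or_false, imp_false, not_lt, beq_iff_eq, badW, Bool.or_eq_false_iff,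 Bool.not_eq_false', Bool.and_eq_false_iff] at hs hj ⊢ <;> omega

/-- accepting a LIGHT `K₁` through a TOP non-jump T-point that is not a T-run configuration kills the point; moreover either `w₀(K₁) = 2`
(tight grade 0) or the point even leaves Sing₂ (tight grade 1) -/
theorem AL_T_after (R K : Curve) (hR : R.bd = false) (hRnd : isDeepW R.w = false) (hK : K.bd = true) (hcw : isCW K.w = true)
    (ht : topN R K = true) (hj : jumpN R K = false) (hnb : badW R.w K.w = false) (e : ℕ) :
    isDeepW (R.w.add (K.w.sub 2 1 0)) = false ∧
      (K.w.w0 = some 2 ∨ sing2N R ({ K with w := K.w.sub 2 1 0, w3 := e } : Curve) = false) := by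
  unfold jumpN at hj; rw [ht] at hj; unfold resid at hj
  unfold topN sing2N resid at ht
  unfold sing2N resid
  rcases R with ⟨⟨_ | r0, _ | r1, _ | r2⟩, r3, rbd⟩ <;> rcases K with ⟨⟨_ | k0, _ | k1, _ | k2⟩, k3, kbd⟩ <;> simp only at hR hK <;> subst hR hK <;>
    simp only [ble_false_iff, Nat.ble_eq, isDeepW, isSingW, isCW, W3.ge, W3.add, W3.sub, finPos, wge_some, wge_none, wadd_some, wadd_none_l, wadd_none_r, Option.map_some, Option.map_none, Option.map, Bool.and_eq_true, Bool.or_eq_true, Bool.not_eq_true', Bool.not_eq_eq_eq_not, Bool.not_true, Bool.not_false, Bool.and_eq_false_eq_eq_false_or_eq_false, decide_eq_true_eq, decide_eq_false_iff_not, not_le, Bool.true_and, Bool.and_true, true_and, and_true, Bool.false_eq_true, Bool.true_eq_false, false_or, or_false, Option.some.injEq, reduceCtorEq, false_and, and_false, or_true, true_or, exists_and_left, exists_and_right, exists_eq_left, exists_eq_left', exists_eq_right, exists_eq_right', exists_eq', exists_false, exists_const, false_iff, iff_false, not_false_eq_true, not_true_eq_false, ite_true, ite_false, if_true, if_false, Bool.true_or,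 Bool.or_true, Bool.false_or, Bool.or_false, imp_false, not_lt, beq_iff_eq, beq_eq_false_iff_ne, ne_eq, badW, Bool.or_eq_false_iff, Bool.not_eq_false', Bool.and_eq_false_iff] at hRnd hcw ht hj hnb ⊢ <;> omega


theorem w2_ne_zero_of_sing {w : W3} (h : isSingW w = true) : w.w2 ≠ some 0 := by
  intro h0
  rcases w with ⟨w0, w1, w2⟩; simp only at h0; subst h0
  revert h; simp [isSingW, W3.ge, wge_some]

/-! ### mode-`u` states: the residual branch first, boundary curves after -/

/-- the states of mode `u`: good, the residual branch `R` first, all other curves boundary -/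
def GoodU (ch : Chain) : Prop := Good ch ∧ ∃ R t, ch = R :: t ∧ R.bd = false ∧ ∀ c ∈ t, c.bd = true

theorem Good.tail {a : Curve} {t : Chain} (h : Good (a :: t)) : Good t := by
  obtain ⟨⟨P, hne, hP⟩, hres⟩ := h
  exact ⟨⟨P, hne, fun c hc => hP c (List.mem_cons_of_mem a hc)⟩, fun c hc hb => hres c (List.mem_cons_of_mem a hc) hb⟩

theorem kindAt_zero_resid {R : Curve} (t : Chain) (hR : R.bd = false) : kindAt (R :: t) 0 = .resid := by
  unfold kindAt kindOf; simp [hR]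

theorem kindAt_succ (R : Curve) (t : Chain) (j : ℕ) : kindAt (R :: t) (j + 1) = kindAt t j := by
  unfold kindAt; simp

theorem nodeAt_succ (R : Curve) (t : Chain) (i : ℕ) : nodeAt (R :: t) (i + 1) = nodeAt t i := by
  unfold nodeAt; simp

theorem topAt_succ (R : Curve) (t : Chain) (i : ℕ) : topAt (R :: t) (i + 1) = topAt t i := by
  unfold topAt; rw [nodeAt_succ]

theorem nodeAt_zero (R K : Curve) (t : Chain) : nodeAt (R :: K :: t) 0 = some (R, K) := by
  unfold nodeAt; simp

theorem topAt_zero (R K : Curve) (t : Chain) : topAt (R :: K :: t) 0 = topN R K := by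
  unfold topAt; rw [nodeAt_zero]

theorem jumpAt_zero (R K : Curve) (t : Chain) : jumpAt (R :: K :: t) 0 = jumpN R K := by
  unfold jumpAt; rw [nodeAt_zero]

theorem sing2At_zero (R K : Curve) (t : Chain) : sing2At (R :: K :: t) 0 = sing2N R K := by
  unfold sing2At; rw [nodeAt_zero]

/-- an accepted curve is never the residual branch -/
theorem acc_index {R : Curve} {t : Chain} (hR : R.bd = false) {k : ℕ}
    (hk : kindAt (R :: t) k = .deep ∨ kindAt (R :: t) k = .borderline ∨ kindAt (R :: t) k = .light) : ∃ k', k = k' + 1 := by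
  cases k with
  | zero => rw [kindAt_zero_resid t hR] at hk; simp at hk
  | succ k' => exact ⟨k', rfl⟩

theorem blowup_succ (R : Curve) (t : Chain) (i α : ℕ) : blowup (R :: t) (i + 1) α = R :: blowup t i α := by
  unfold blowup; rw [nodeAt_succ]
  cases nodeAt t i with
  | none => rfl
  | some ab => obtain ⟨a, b⟩ := ab; simp only [List.insertIdx_succ_cons]

theorem blowup_zero (R K : Curve) (t : Chain) (α : ℕ) : blowup (R :: K :: t) 0 α =
    R :: (⟨⟨(R.w.add K.w).w0.map (· - α), (R.w.add K.w).w1.map (· + 1 - α), (R.w.add K.w).w2.map (· + 2 - α)⟩, R.w3 + K.w3 + 3 - α, true⟩ : Curve)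
      :: K :: t := by
  unfold blowup; rw [nodeAt_zero]; simp only [List.insertIdx_succ_cons, List.insertIdx_zero]

/-- the head of a blown-up nonempty chain stays in place -/
theorem blowup_head (K : Curve) (t : Chain) (i α : ℕ) : ∃ t', blowup (K :: t) i α = K :: t' := by
  unfold blowup
  cases nodeAt (K :: t) i with
  | none => exact ⟨t, rfl⟩
  | some ab => obtain ⟨a, b⟩ := ab; simp only [List.insertIdx_succ_cons]; exact ⟨_, rfl⟩

/-- a top (or Sing₂) point needs two branches: the chain behind the residual branch is nonempty -/
theorem tail_of_nodeAt {R : Curve} {t : Chain} {i : ℕ} {ab : Curve × Curve} (h : nodeAt (R :: t) i = some ab) : ∃ K t', t = K :: t' := by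
  cases t with
  | nil =>
    unfold nodeAt at h
    cases i <;> simp at h
  | cons K t' => exact ⟨K, t', rfl⟩

theorem bd_of_getElem_succ {R : Curve} {t : Chain} (hbt : ∀ c ∈ t, c.bd = true) {j : ℕ} {a : Curve} (h : (R :: t)[j + 1]? = some a) :
    a.bd = true := hbt a (List.mem_of_getElem? (by simpa using h))

/-- at a 𝒟-node (both branches boundary) TOP = JUMP -/
theorem topAt_eq_jumpAt {ch : Chain} {i : ℕ} {a b : Curve} (hn : nodeAt ch i = some (a, b)) (ha : a.bd = true) (hb : b.bd = true) :
    topAt ch i = jumpAt ch i := by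
  unfold topAt jumpAt; rw [hn]; simp only; rw [jumpN_of_bd ha hb]

/-- in a mode-`u` state every point `i ≥ 1` is a 𝒟-node: there TOP = JUMP -/
theorem topAt_eq_jumpAt_succ {R : Curve} {t : Chain} (hbt : ∀ c ∈ t, c.bd = true) (j : ℕ) :
    topAt (R :: t) (j + 1) = jumpAt (R :: t) (j + 1) := by
  cases hn : nodeAt (R :: t) (j + 1) with
  | none => unfold topAt jumpAt; rw [hn]
  | some ab =>
    obtain ⟨a, b⟩ := ab
    obtain ⟨ha, hb⟩ := nodeAt_some hn
    exact topAt_eq_jumpAt hn (bd_of_getElem_succ hbt ha) (bd_of_getElem_succ hbt hb)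

/-- GOOD-U is an invariant of legal play -/
theorem GoodU_applyMove {topj : ℕ} {ch : Chain} (hG : GoodU ch) {m : Move} (hm : m ∈ legalMoves topj ch) : GoodU (applyMove ch m) := by
  obtain ⟨hg, R, t, rfl, hR, hbt⟩ := hG
  refine ⟨Good_applyMove hg hm, ?_⟩
  have hmod : ∀ (k : ℕ) (f : Curve → Curve), (kindAt (R :: t) k = .deep ∨ kindAt (R :: t) k = .borderline ∨ kindAt (R :: t) k = .light) →
      (∀ c, (f c).bd = c.bd) → ∃ R' t', (R :: t).modify k f = R' :: t' ∧ R'.bd = false ∧ ∀ c ∈ t', c.bd = true := by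
    intro k f hk hf
    obtain ⟨k', rfl⟩ := acc_index hR hk
    refine ⟨R, t.modify k' f, rfl, hR, ?_⟩
    intro c hc
    rcases mem_modify_cases hc with hc | ⟨c₀, hc₀, rfl⟩
    · exact hbt c hc
    · rw [hf]; exact hbt c₀ (List.mem_of_getElem? hc₀)
  have hbl : ∀ i α : ℕ, ∃ R' t', blowup (R :: t) i α = R' :: t' ∧ R'.bd = false ∧ ∀ c ∈ t', c.bd = true := by
    intro i α
    cases i with
    | succ i' =>
      rw [blowup_succ]
      refine ⟨R, blowup t i' α, rfl, hR, ?_⟩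
      intro c hc
      unfold blowup at hc
      cases hn : nodeAt t i' with
      | none => rw [hn] at hc; exact hbt c hc
      | some ab =>
        obtain ⟨a, b⟩ := ab
        rw [hn] at hc; simp only at hc
        rcases List.eq_or_mem_of_mem_insertIdx hc with rfl | hc
        · rfl
        · exact hbt c hc
    | zero =>
      cases t with
      | nil => refine ⟨R, [], ?_, hR, by simp⟩; unfold blowup nodeAt; simp
      | cons K t' =>
        rw [blowup_zero]
        refine ⟨R, _, rfl, hR, ?_⟩
        intro c hc
        simp only [List.mem_cons] at hc
        rcases hc with rfl | rfl | hc
        · rfl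
        · exact hbt _ (by simp)
        · exact hbt c (by simp [hc])
  cases m with
  | D k =>
    have := hmod k (fun c => { c with w := c.w.sub 3 2 1 }) (Or.inl (D_mem_legalMoves topj _ k hm)) (fun c => rfl)
    simpa [applyMove] using this
  | A k => exact hmod k _ (Or.inr (Or.inl (A_mem_legalMoves topj _ k hm).1)) (fun c => rfl)
  | AL k => exact hmod k _ (Or.inr (Or.inr (AL_mem_legalMoves topj _ k hm).1)) (fun c => rfl)
  | I i => exact hbl i 3
  | P i => exact hbl i _

/-! ### the T-settled potential `pot₀ = (Φ_T, PD + PT, S0, T)` -/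

/-- node-0 term of `Φ_T`: the residual exponents against the T-SETTLED weight of `K₁` -/
def headT : Chain → ℕ
  | R :: K :: _ => phi R.w (trun R.w (settle K.w))
  | _ => 0
/-- node-0 term of `Φ` -/
def headS : Chain → ℕ
  | R :: K :: _ => phi (settle R.w) (settle K.w)
  | _ => 0
/-- pending T-run length at node 0 -/
def PT : Chain → ℕ
  | R :: K :: _ => tlen R.w (settle K.w)
  | _ => 0
/-- the T-settled node potential `Φ_T`: `Φ` with the node-0 term T-settled -/
def PhiT (ch : Chain) : ℕ := Phi ch - headS ch + headT ch
/-- the potential for `topj = 0` -/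
def pot0 (ch : Chain) : ℕ × ℕ × ℕ × ℕ := (PhiT ch, PD ch + PT ch, S0 ch, TT ch)

theorem Phi_cons_cons (R K : Curve) (t : Chain) : Phi (R :: K :: t) = phi (settle R.w) (settle K.w) + Phi (K :: t) := by
  simp only [Phi, List.map_cons, pairSum_cons_cons]

theorem PhiT_cons_cons (R K : Curve) (t : Chain) : PhiT (R :: K :: t) = phi R.w (trun R.w (settle K.w)) + Phi (K :: t) := by
  unfold PhiT; rw [Phi_cons_cons]; simp only [headS, headT]; omega

theorem PD_cons (R : Curve) (t : Chain) : PD (R :: t) = settleK R.w + PD t := by simp [PD]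
theorem S0_cons (R : Curve) (t : Chain) : S0 (R :: t) = R.w.w0.getD 0 + S0 t := by simp [S0]
theorem TT_cons_cons (R K : Curve) (t : Chain) : TT (R :: K :: t) = tterm R K + TT (K :: t) := by
  simp only [TT, pairSum_cons_cons]
theorem TT_single (K : Curve) : TT [K] = 0 := rfl
theorem PT_cons_cons (R K : Curve) (t : Chain) : PT (R :: K :: t) = tlen R.w (settle K.w) := rfl

/-- `Φ_T` and `PT` see `K₁` only through its settled weight; away from node 0 `Φ_T` moves with `Φ` -/
theorem PhiT_congr (R K K' : Curve) (t₁ t₂ : Chain) (hs : settle K'.w = settle K.w) :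
    PhiT (R :: K' :: t₂) + Phi (R :: K :: t₁) = PhiT (R :: K :: t₁) + Phi (R :: K' :: t₂) ∧ PT (R :: K' :: t₂) = PT (R :: K :: t₁) := by
  rw [PhiT_cons_cons, PhiT_cons_cons, Phi_cons_cons, Phi_cons_cons, PT_cons_cons, PT_cons_cons, hs]; exact ⟨by omega, rfl⟩

/-- when node 0 is not a T-run configuration (and `R`, `K₁` are settled) the two node potentials agree and no T-run is pending -/
theorem PhiT_eq_Phi (R K : Curve) (t : Chain) (hR : isDeepW R.w = false) (hK : isDeepW K.w = false) (hnb : badW R.w K.w = false) :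
    PhiT (R :: K :: t) = Phi (R :: K :: t) ∧ PT (R :: K :: t) = 0 := by
  obtain ⟨e1, e2⟩ := trun_of_not_bad R.w K.w hnb
  rw [PhiT_cons_cons, Phi_cons_cons, PT_cons_cons, settle_of_not_deep R.w hR, settle_of_not_deep K.w hK, e1, e2]; exact ⟨rfl, rfl⟩

/-- under `topj = 0` a handled-curve point blow-up `I i` happens only at a JUMP point -/
theorem I_mem_legalMoves0 (ch : Chain) (i : ℕ) (h : Move.I i ∈ legalMoves 0 ch) : jumpAt ch i = true := by
  unfold legalMoves at h
  dsimp only at h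
  split at h
  · simp at h
  · simp only [List.mem_append, List.mem_flatMap, List.mem_map, List.mem_filter, List.mem_range] at h
    rcases h with ⟨k', hk', hm⟩ | ⟨j, hj, hji⟩
    · split at hm
      · split at hm
        · simp at hm
        · simp only [List.mem_map, List.mem_filter, Move.I.injEq] at hm
          obtain ⟨i', ⟨_, hc⟩, rfl⟩ := hm
          simpa [Nat.ble_eq] using hc
      · split at hm
        · split at hm
          · simp at hm
          · simp only [List.mem_map, List.mem_filter, Move.I.injEq] at hm
            obtain ⟨i', ⟨_, hc⟩, rfl⟩ := hm
            simpa [Nat.ble_eq] using hc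
        · simp at hm
      · simp at hm
    · simp at hji

/-- exponent-3 blow-up of a top point in a mode-`u` state, node 0 not a T-run configuration: `Φ_T` drops (the T-shifted splitting at node 0) -/
theorem PhiT_blowup3 {R : Curve} {t : Chain} (hg : Good (R :: t)) (hR : R.bd = false) (hbt : ∀ c ∈ t, c.bd = true)
    (hnd : ∀ j, kindAt (R :: t) j ≠ .deep) {i : ℕ} (ht : topAt (R :: t) i = true)
    (hnb : ∀ K t', t = K :: t' → i = 0 → badW R.w K.w = false) :
    PhiT (blowup (R :: t) i 3) < PhiT (R :: t) ∧ ∃ K t'', t = K :: t'' ∧ ∃ t''', blowup (R :: t) i 3 = R :: t''' := by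
  have hPhi := pot_blowup3 hg hnd ht
  obtain ⟨a, b, hn, htn⟩ := node_of_topAt ht
  obtain ⟨K, t', rfl⟩ := tail_of_nodeAt hn
  have hRnd : isDeepW R.w = false := hg.2 R (by simp) hR
  have hKnd : isDeepW K.w = false := member_notDeep hg hnd (by simp)
  refine ⟨?_, K, t', rfl, ?_⟩
  swap
  · cases i with
    | zero => rw [blowup_zero]; exact ⟨_, rfl⟩
    | succ i' => rw [blowup_succ]; exact ⟨_, rfl⟩
  cases i with
  | succ i' =>
    rw [blowup_succ] at hPhi ⊢
    obtain ⟨t'', ht''⟩ := blowup_head K t' i' 3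
    rw [ht''] at hPhi ⊢
    have := (PhiT_congr R K K t' t'' rfl).1
    omega
  | zero =>
    have htn' : isDeepW (R.w.add K.w) = true := by rw [topAt_zero, topN_eq] at ht; exact ht
    have hp : pat R.w = pat K.w := hg.pat_eq (by simp) (by simp)
    have hne : pat R.w ≠ (false, false, false) := hg.pat_ne (by simp)
    have eN : (⟨⟨(R.w.add K.w).w0.map (· - 3), (R.w.add K.w).w1.map (· + 1 - 3), (R.w.add K.w).w2.map (· + 2 - 3)⟩, R.w3 + K.w3 + 3 - 3, true⟩ : Curve) =
        ⟨nb3 R.w K.w, R.w3 + K.w3 + 3 - 3, true⟩ := rfl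
    rw [blowup_zero, eN, PhiT_cons_cons, Phi_cons_cons, PhiT_cons_cons, settle_of_not_deep K.w hKnd, (trun_of_not_bad R.w K.w (hnb K t' rfl rfl)).1]
    dsimp only
    have hpn : pat R.w = pat (settle (nb3 R.w K.w)) := by rw [pat_settle, pat_nb3 R.w K.w hp]
    obtain ⟨e1, f0, f1, f2⟩ := trun_spec R.w hRnd _ (settle (nb3 R.w K.w)) le_rfl hpn
    have key := phi_splitT R.w K.w hp hne hRnd hKnd htn' (tlen R.w (settle (nb3 R.w K.w))) f2 f0 f1
    rw [e1]; omega

/-- THE STEP under `topj = 0` (loop note rev 2), mode `u`: every legal move strictly decreases `pot₀`. -/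
theorem pot0_step {ch : Chain} (hG : GoodU ch) {m : Move} (hm : m ∈ legalMoves 0 ch) : LT4 (pot0 (applyMove ch m)) (pot0 ch) := by
  obtain ⟨hg, R, t, rfl, hR, hbt⟩ := hG
  have hRnd : isDeepW R.w = false := hg.2 R (by simp) hR
  cases m with
  | D k =>
    have hk := D_mem_legalMoves 0 _ k hm
    obtain ⟨h1, h2⟩ := pot_D hg hk
    obtain ⟨k', rfl⟩ := acc_index hR (Or.inl hk)
    obtain ⟨c, hc, hκ⟩ := kindAt_some hk (by decide)
    obtain ⟨K, t', rfl⟩ : ∃ K t', t = K :: t' := by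
      cases t with
      | nil => simp at hc
      | cons K t' => exact ⟨K, t', rfl⟩
    have happ : applyMove (R :: K :: t') (.D (k' + 1)) = R :: (K :: t').modify k' (fun c => { c with w := c.w.sub 3 2 1 }) := rfl
    rw [happ] at h1 h2 ⊢
    cases k' with
    | zero =>
      rw [List.modify_zero_cons] at h1 h2 ⊢
      have hKd : isDeepW K.w = true := by
        rw [kindAt_succ] at hk; unfold kindAt at hk; simp only [List.getElem?_cons_zero] at hk; exact (kindOf_deep hk).2
      have hs := (settle_deep K.w (hg.pat_ne (by simp)) hKd).1
      obtain ⟨e1, e2⟩ := PhiT_congr R K { K with w := K.w.sub 3 2 1 } t' t' hs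
      unfold pot0; rw [e2]
      exact LT4_of2 _ _ _ _ (by omega) (by omega)
    | succ k'' =>
      rw [List.modify_succ_cons] at h1 h2 ⊢
      obtain ⟨e1, e2⟩ := PhiT_congr R K K t' (t'.modify k'' (fun c => { c with w := c.w.sub 3 2 1 })) rfl
      unfold pot0; rw [e2]
      exact LT4_of2 _ _ _ _ (by omega) (by omega)
  | A k =>
    have hnd := legal_noDeep hm (by intro k'; simp)
    obtain ⟨hk, hjs⟩ := A_mem_legalMoves 0 _ k hm
    have hjs' : ∀ i ∈ ptsOf (R :: t).length k, jumpAt (R :: t) i = false := fun i hi => by simpa [Nat.ble_eq] using hjs i hi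
    obtain ⟨c, hc, hκ⟩ := kindAt_some hk (by decide)
    obtain ⟨hcbd, hcs, hcnd⟩ := kindOf_borderline hκ
    have hw0 := w0_of_borderline c hκ
    obtain ⟨k', rfl⟩ := acc_index hR (Or.inr (Or.inl hk))
    obtain ⟨K, t', rfl⟩ : ∃ K t', t = K :: t' := by
      cases t with
      | nil => simp at hc
      | cons K t' => exact ⟨K, t', rfl⟩
    -- every point of the curve is non-top before the move or (the T-point of `K₁`) after it
    have hnotop : ∀ i ∈ ptsOf (R :: K :: t').length (k' + 1), topAt (R :: K :: t') i = false ∨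
        topAt ((R :: K :: t').modify (k' + 1) (fun c => { c with w := c.w.sub 2 1 0, w3 := c.w3 + 1 })) i = false := by
      intro i hi
      rcases mem_ptsOf hi with ⟨_, hik⟩ | ⟨_, rfl⟩
      · have hik' : i = k' := by omega
        subst hik'
        cases i with
        | succ j => left; rw [topAt_eq_jumpAt_succ (by simpa using hbt) j]; exact hjs' _ hi
        | zero =>
          right
          simp only [zero_add, List.modify_succ_cons, List.modify_zero_cons]
          have hcK : c = K := by simpa using hc.symm
          subst hcK
          rw [topAt_zero, topN_eq]
          have hj0 := hjs' 0 hi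
          rw [jumpAt_zero] at hj0
          exact A_T_after R c hR hcs hj0
      · left; rw [topAt_eq_jumpAt_succ (by simpa using hbt) k']; exact hjs' _ hi
    obtain ⟨h1, h2⟩ := pot_acc_le hg hnd hc hnotop
    have h3 := (S0_acc hc).2 2 hw0 (by omega)
    have happ : applyMove (R :: K :: t') (.A (k' + 1)) =
        (R :: K :: t').modify (k' + 1) (fun c => { c with w := c.w.sub 2 1 0, w3 := c.w3 + 1 }) := rfl
    rw [happ]
    revert h1 h2 h3
    cases k' with
    | zero =>
      simp only [zero_add, List.modify_succ_cons, List.modify_zero_cons]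
      intro h1 h2 h3
      have hcK : c = K := by simpa using hc.symm
      subst hcK
      have hKnd' : isDeepW (c.w.sub 2 1 0) = false := notDeep_sub c.w 2 1 0 hcnd
      obtain ⟨p1, q1⟩ := PhiT_eq_Phi R c t' hRnd hcnd (notBad_of_sing R.w c.w hcs)
      obtain ⟨p2, q2⟩ := PhiT_eq_Phi R { c with w := c.w.sub 2 1 0, w3 := c.w3 + 1 } t' hRnd hKnd'
        (notBad_of_w2 R.w (c.w.sub 2 1 0) (by rw [w2_sub]; exact w2_ne_zero_of_sing hcs))
      unfold pot0; rw [p1, q1, p2, q2]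
      exact LT4_of3 _ _ h1 (by omega) h3
    | succ k'' =>
      simp only [List.modify_succ_cons]
      intro h1 h2 h3
      obtain ⟨e1, e2⟩ := PhiT_congr R K K t' (t'.modify k'' (fun c => { c with w := c.w.sub 2 1 0, w3 := c.w3 + 1 })) rfl
      unfold pot0; rw [e2]
      exact LT4_of3 _ _ (by omega) (by omega) h3
  | AL k =>
    have hnd := legal_noDeep hm (by intro k'; simp)
    obtain ⟨hk, hrel, hjs⟩ := AL_mem_legalMoves 0 _ k hm
    have hjs' : ∀ i ∈ ptsOf (R :: t).length k, jumpAt (R :: t) i = false := fun i hi => by simpa [Nat.ble_eq] using hjs i hi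
    obtain ⟨c, hc, hκ⟩ := kindAt_some hk (by decide)
    obtain ⟨hcbd, hcw, hcns⟩ := kindOf_light hκ
    have hcnd : isDeepW c.w = false := member_notDeep hg hnd (List.mem_of_getElem? hc)
    obtain ⟨k', rfl⟩ := acc_index hR (Or.inr (Or.inr hk))
    obtain ⟨K, t', rfl⟩ : ∃ K t', t = K :: t' := by
      cases t with
      | nil => simp at hc
      | cons K t' => exact ⟨K, t', rfl⟩
    have happ : applyMove (R :: K :: t') (.AL (k' + 1)) =
        (R :: K :: t').modify (k' + 1) (fun c => { c with w := c.w.sub 2 1 0, w3 := c.w3 + 1 }) := rfl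
    rw [happ]
    by_cases hT : k' = 0 ∧ topAt (R :: K :: t') 0 = true
    · -- the light `K₁` is accepted through a TOP (non-jump) T-point
      obtain ⟨rfl, ht0⟩ := hT
      have hcK : c = K := by simpa using hc.symm
      subst hcK
      simp only [zero_add, List.modify_succ_cons, List.modify_zero_cons]
      rw [topAt_zero] at ht0
      have hj0 := hjs' 0 (mem_ptsOf_left rfl)
      rw [jumpAt_zero] at hj0
      have hsK : settle c.w = c.w := settle_of_not_deep c.w hcnd
      have hKnd' : isDeepW (c.w.sub 2 1 0) = false := notDeep_sub c.w 2 1 0 hcnd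
      have hsK' : settle (c.w.sub 2 1 0) = c.w.sub 2 1 0 := settle_of_not_deep _ hKnd'
      -- the tail chain `K₁ :: t'` and the accept seen from it (its only point is node 1, a non-top 𝒟-node)
      have hgT : Good (c :: t') := hg.tail
      have hndT : ∀ j, kindAt (c :: t') j ≠ .deep := fun j => by rw [← kindAt_succ R]; exact hnd (j + 1)
      have hnotopT : ∀ i ∈ ptsOf (c :: t').length 0, topAt (c :: t') i = false ∨
          topAt ((c :: t').modify 0 (fun c => { c with w := c.w.sub 2 1 0, w3 := c.w3 + 1 })) i = false := by
        intro i hi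
        rcases mem_ptsOf hi with ⟨h, _⟩ | ⟨hlt, rfl⟩
        · omega
        · left
          rw [← topAt_succ R, topAt_eq_jumpAt_succ (by simpa using hbt) 0]
          exact hjs' 1 (mem_ptsOf_right (by simpa using hlt))
      obtain ⟨hT1, hT2⟩ := pot_acc_le hgT hndT (c := c) rfl hnotopT
      rw [List.modify_zero_cons] at hT1 hT2
      by_cases hb : badW R.w c.w = true
      · -- a T-RUN step: `Φ_T` does not increase, the pending T-run shortens
        have hf := tfuel_lt_of_bad R.w c.w hb hRnd (hg.pat_eq (by simp) (by simp))
        obtain ⟨r1, r2⟩ := trun_bad R.w c.w hb hf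
        unfold pot0
        rw [PhiT_cons_cons, PhiT_cons_cons, PT_cons_cons, PT_cons_cons, PD_cons R, PD_cons R]
        dsimp only
        rw [hsK, hsK', ← r1, r2]
        exact LT4_of2 _ _ _ _ (by omega) (by omega)
      · -- the point dies: tight grade 0 (`w₀(K₁) = 2`, `S0` drops) or tight grade 1 (the point leaves Sing₂, `T` drops)
        have hnb : badW R.w c.w = false := by simpa using hb
        obtain ⟨hd', hor⟩ := AL_T_after R c hR hRnd hcbd hcw ht0 hj0 hnb (c.w3 + 1)
        have hnotop : ∀ i ∈ ptsOf (R :: c :: t').length (0 + 1), topAt (R :: c :: t') i = false ∨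
            topAt ((R :: c :: t').modify (0 + 1) (fun c => { c with w := c.w.sub 2 1 0, w3 := c.w3 + 1 })) i = false := by
          intro i hi
          rcases mem_ptsOf hi with ⟨_, hik⟩ | ⟨_, rfl⟩
          · have hi0 : i = 0 := by omega
            subst hi0
            right
            simp only [zero_add, List.modify_succ_cons, List.modify_zero_cons]
            rw [topAt_zero, topN_eq]; exact hd'
          · left; rw [zero_add, topAt_eq_jumpAt_succ (by simpa using hbt) 0]; exact hjs' _ hi
        obtain ⟨h1, h2⟩ := pot_acc_le hg hnd hc hnotop
        obtain ⟨h3le, h3lt⟩ := S0_acc hc (k := 0 + 1)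
        simp only [zero_add, List.modify_succ_cons, List.modify_zero_cons] at h1 h2 h3le h3lt
        obtain ⟨p1, q1⟩ := PhiT_eq_Phi R c t' hRnd hcnd hnb
        obtain ⟨p2, q2⟩ := PhiT_eq_Phi R { c with w := c.w.sub 2 1 0, w3 := c.w3 + 1 } t' hRnd hKnd' (notBad_of_notTop _ _ hd')
        unfold pot0; rw [p1, q1, p2, q2]
        rcases hor with hw0 | hns
        · exact LT4_of3 _ _ h1 (by omega) (h3lt 2 hw0 (by omega))
        · refine LT4_of4 h1 (by omega) h3le ?_
          -- the tail measure drops at node 0 and does not increase at node 1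
          have ht0' := tterm_pos_of_top R c ht0
          have hz : tterm R { c with w := c.w.sub 2 1 0, w3 := c.w3 + 1 } = 0 := by unfold tterm; rw [hns]; simp
          rw [TT_cons_cons, TT_cons_cons, hz]
          have hmono : TT (({ c with w := c.w.sub 2 1 0, w3 := c.w3 + 1 } : Curve) :: t') ≤ TT (c :: t') := by
            cases t' with
            | nil => simp [TT_single]
            | cons K₂ t'' => rw [TT_cons_cons, TT_cons_cons]; have := tterm_acc_left c K₂ hcbd (c.w3 + 1); omega
          omega
    · -- all points of the accepted curve are non-top (standard case)
      have hnotop : ∀ i ∈ ptsOf (R :: K :: t').length (k' + 1), topAt (R :: K :: t') i = false := by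
        intro i hi
        rcases mem_ptsOf hi with ⟨_, hik⟩ | ⟨_, rfl⟩
        · have hik' : i = k' := by omega
          subst hik'
          cases i with
          | succ j => rw [topAt_eq_jumpAt_succ (by simpa using hbt) j]; exact hjs' _ hi
          | zero =>
            cases h0 : topAt (R :: K :: t') 0
            · rfl
            · exact absurd ⟨rfl, h0⟩ hT
        · rw [topAt_eq_jumpAt_succ (by simpa using hbt) k']; exact hjs' _ hi
      obtain ⟨i, hi, hsi⟩ := List.any_eq_true.mp hrel
      have hw0 : c.w.w0 = some 2 := (node_of_sing2_not_top hc (w0_of_light c hκ) hi hsi (hnotop i hi)).1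
      obtain ⟨h1, h2, h3⟩ := pot_acc hg hnd hc hw0 hnotop
      revert h1 h2 h3
      cases k' with
      | zero =>
        simp only [zero_add, List.modify_succ_cons, List.modify_zero_cons]
        intro h1 h2 h3
        have hcK : c = K := by simpa using hc.symm
        subst hcK
        have ht0 : isDeepW (R.w.add c.w) = false := by
          have := hnotop 0 (mem_ptsOf_left rfl); rw [topAt_zero, topN_eq] at this; exact this
        have hKnd' : isDeepW (c.w.sub 2 1 0) = false := notDeep_sub c.w 2 1 0 hcnd
        obtain ⟨p1, q1⟩ := PhiT_eq_Phi R c t' hRnd hcnd (notBad_of_notTop _ _ ht0)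
        obtain ⟨p2, q2⟩ := PhiT_eq_Phi R { c with w := c.w.sub 2 1 0, w3 := c.w3 + 1 } t' hRnd hKnd'
          (notBad_of_notTop _ _ (notDeep_add_sub_right R.w c.w 2 1 0 ht0))
        unfold pot0; rw [p1, q1, p2, q2]
        exact LT4_of3 _ _ h1 (by omega) h3
      | succ k'' =>
        simp only [List.modify_succ_cons]
        intro h1 h2 h3
        obtain ⟨e1, e2⟩ := PhiT_congr R K K t' (t'.modify k'' (fun c => { c with w := c.w.sub 2 1 0, w3 := c.w3 + 1 })) rfl
        unfold pot0; rw [e2]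
        exact LT4_of3 _ _ (by omega) (by omega) h3
  | I i =>
    have hnd := legal_noDeep hm (by intro k'; simp)
    have ht := I_mem_legalMoves 0 _ i hm
    have hj := I_mem_legalMoves0 _ i hm
    have hnb : ∀ K t', t = K :: t' → i = 0 → badW R.w K.w = false := by
      rintro K t' rfl rfl
      rw [jumpAt_zero] at hj
      exact notBad_of_jump R K hR hj
    obtain ⟨h1, K, t'', rfl, t''', he⟩ := PhiT_blowup3 hg hR hbt hnd ht hnb
    show LT4 (pot0 (blowup (R :: K :: t'') i 3)) _
    unfold pot0
    exact LT4_of1 _ _ _ _ _ _ h1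
  | P i =>
    have hnd := legal_noDeep hm (by intro k'; simp)
    obtain ⟨hs, hh1, hh2⟩ := P_mem_legalMoves 0 _ i hm
    cases ht : topAt (R :: t) i with
    | true =>
      have happ : applyMove (R :: t) (.P i) = blowup (R :: t) i 3 := by simp [applyMove, ht]
      rw [happ]
      have hnb : ∀ K t', t = K :: t' → i = 0 → badW R.w K.w = false := by
        rintro K t' rfl rfl
        apply notBad_of_notCW
        cases hcw : isCW K.w
        · rfl
        · have := handled_of_CW_sing2 (ch := R :: K :: t') (k := 1) (c := K) rfl (hbt K (by simp)) hcw (mem_ptsOf_left rfl) hs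
          rw [hh2] at this; exact absurd this Bool.false_ne_true
      obtain ⟨h1, K, t'', rfl, t''', he⟩ := PhiT_blowup3 hg hR hbt hnd ht hnb
      unfold pot0
      exact LT4_of1 _ _ _ _ _ _ h1
    | false =>
      have happ : applyMove (R :: t) (.P i) = blowup (R :: t) i 2 := by simp [applyMove, ht]
      rw [happ]
      obtain ⟨h1, h2, h3, h4⟩ := pot_blowup2 hg hnd hm ht
      unfold sing2At at hs
      cases hn : nodeAt (R :: t) i with
      | none => rw [hn] at hs; exact absurd hs Bool.false_ne_true
      | some ab =>
        obtain ⟨K, t', rfl⟩ := tail_of_nodeAt hn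
        revert h1 h2 h3 h4
        cases i with
        | succ i' =>
          rw [blowup_succ]
          obtain ⟨t'', ht''⟩ := blowup_head K t' i' 2
          rw [ht'']
          intro h1 h2 h3 h4
          obtain ⟨e1, e2⟩ := PhiT_congr R K K t' t'' rfl
          unfold pot0; rw [e2]
          exact LT4_of4 (by omega) (by omega) h3 h4
        | zero =>
          rw [nodeAt_zero] at hs; simp only at hs
          have htn : topN R K = false := by rw [topAt_zero] at ht; exact ht
          obtain ⟨x, y, hx, hy, hxy⟩ := o0_of_sing2_not_top R K hs htn
          obtain ⟨d1, d2, dK, dnb, dw0⟩ := nb2_facts R.w K.w x y hx hy hxy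
          have hKnd : isDeepW K.w = false := member_notDeep hg hnd (by simp)
          have eN : (⟨⟨(R.w.add K.w).w0.map (· - 2), (R.w.add K.w).w1.map (· + 1 - 2), (R.w.add K.w).w2.map (· + 2 - 2)⟩, R.w3 + K.w3 + 3 - 2, true⟩ : Curve) =
              ⟨nb2 R.w K.w, R.w3 + K.w3 + 3 - 2, true⟩ := rfl
          rw [blowup_zero, eN]
          intro h1 h2 h3 h4
          unfold pot0
          rw [PhiT_cons_cons, PT_cons_cons, PhiT_cons_cons, PT_cons_cons, Phi_cons_cons, PD_cons R (_ :: K :: t'), PD_cons R (K :: t'),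
            PD_cons _ (K :: t'), settle_of_not_deep K.w hKnd]
          dsimp only
          rw [settle_of_not_deep _ dnb, (trun_of_not_bad R.w _ (notBad_of_notTop _ _ d1)).1, (trun_of_not_bad R.w _ (notBad_of_notTop _ _ d1)).2, dK]
          have z1 : phi R.w (nb2 R.w K.w) = 0 := by unfold phi; rw [if_neg]; rw [d1]; exact Bool.false_ne_true
          have z2 : phi (nb2 R.w K.w) K.w = 0 := by unfold phi; rw [if_neg]; rw [d2]; exact Bool.false_ne_true
          rw [z1, z2]
          exact LT4_of4 (by omega) (by omega) h3 h4

/-- THE STEP under `topj = 1` (loop note rev 3), mode `u`: every legal move strictly decreases the STANDARD potential (the only non-`G_mult`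
event is the accept of a borderline `K₁` through a top non-jump T-point, which kills the point). -/
theorem pot_step_u1 {ch : Chain} (hG : GoodU ch) {m : Move} (hm : m ∈ legalMoves 1 ch) : LT4 (pot (applyMove ch m)) (pot ch) := by
  obtain ⟨hg, R, t, rfl, hR, hbt⟩ := hG
  cases m with
  | D k =>
    obtain ⟨h1, h2⟩ := pot_D hg (D_mem_legalMoves 1 _ k hm)
    exact LT4_of2 _ _ _ _ (le_of_eq h1) h2
  | A k =>
    have hnd := legal_noDeep hm (by intro k'; simp)
    obtain ⟨hk, hjs⟩ := A_mem_legalMoves 1 _ k hm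
    have hjs' : ∀ i ∈ ptsOf (R :: t).length k, jumpAt (R :: t) i = false := fun i hi => by simpa [Nat.ble_eq] using hjs i hi
    obtain ⟨c, hc, hκ⟩ := kindAt_some hk (by decide)
    obtain ⟨hcbd, hcs, hcnd⟩ := kindOf_borderline hκ
    have hw0 := w0_of_borderline c hκ
    obtain ⟨k', rfl⟩ := acc_index hR (Or.inr (Or.inl hk))
    obtain ⟨K, t', rfl⟩ : ∃ K t', t = K :: t' := by
      cases t with
      | nil => simp at hc
      | cons K t' => exact ⟨K, t', rfl⟩
    have hnotop : ∀ i ∈ ptsOf (R :: K :: t').length (k' + 1), topAt (R :: K :: t') i = false ∨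
        topAt ((R :: K :: t').modify (k' + 1) (fun c => { c with w := c.w.sub 2 1 0, w3 := c.w3 + 1 })) i = false := by
      intro i hi
      rcases mem_ptsOf hi with ⟨_, hik⟩ | ⟨_, rfl⟩
      · have hik' : i = k' := by omega
        subst hik'
        cases i with
        | succ j => left; rw [topAt_eq_jumpAt_succ (by simpa using hbt) j]; exact hjs' _ hi
        | zero =>
          right
          simp only [zero_add, List.modify_succ_cons, List.modify_zero_cons]
          have hcK : c = K := by simpa using hc.symm
          subst hcK
          rw [topAt_zero, topN_eq]
          have hj0 := hjs' 0 hi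
          rw [jumpAt_zero] at hj0
          exact A_T_after R c hR hcs hj0
      · left; rw [topAt_eq_jumpAt_succ (by simpa using hbt) k']; exact hjs' _ hi
    obtain ⟨h1, h2⟩ := pot_acc_le hg hnd hc hnotop
    have h3 := (S0_acc hc).2 2 hw0 (by omega)
    exact LT4_of3 _ _ h1 h2 h3
  | AL k =>
    have hnd := legal_noDeep hm (by intro k'; simp)
    obtain ⟨hk, hrel, hjs⟩ := AL_mem_legalMoves 1 _ k hm
    obtain ⟨c, hc, hκ⟩ := kindAt_some hk (by decide)
    have hnotop : ∀ i ∈ ptsOf (R :: t).length k, topAt (R :: t) i = false := by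
      intro i hi
      have := hjs i hi
      have h' : jumpAt (R :: t) i = false ∧ topAt (R :: t) i = false := by simpa [Nat.ble_eq] using this
      exact h'.2
    obtain ⟨i, hi, hsi⟩ := List.any_eq_true.mp hrel
    have hw0 : c.w.w0 = some 2 := (node_of_sing2_not_top hc (w0_of_light c hκ) hi hsi (hnotop i hi)).1
    obtain ⟨h1, h2, h3⟩ := pot_acc hg hnd hc hw0 hnotop
    exact LT4_of3 _ _ h1 h2 h3
  | I i =>
    have hnd := legal_noDeep hm (by intro k'; simp)
    exact LT4_of1 _ _ _ _ _ _ (pot_blowup3 hg hnd (I_mem_legalMoves 1 _ i hm))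
  | P i =>
    have hnd := legal_noDeep hm (by intro k'; simp)
    cases ht : topAt (R :: t) i with
    | true =>
      have : applyMove (R :: t) (.P i) = blowup (R :: t) i 3 := by simp [applyMove, ht]
      rw [this]
      exact LT4_of1 _ _ _ _ _ _ (pot_blowup3 hg hnd ht)
    | false =>
      have : applyMove (R :: t) (.P i) = blowup (R :: t) i 2 := by simp [applyMove, ht]
      rw [this]
      obtain ⟨h1, h2, h3, h4⟩ := pot_blowup2 hg hnd hm ht
      exact LT4_of4 h1 h2 h3 h4

/-! ### TERMINATION in mode `u` under the historical rule sets -/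

/-- THEOREM (S4 (iii), historical rule sets). In mode `u` the toric S-game admits NO INFINITE LEGAL PLAY under rule set rev 3 (`topj = 1`)
and under rule set rev 2 (`topj = 0`), from every mode-`u` state (residual branch first and not deep, one pattern of finite grades), for ALL
weights. -/
theorem no_infinite_play_u (topj : ℕ) (htopj : topj ≤ 1) (ch : Chain) (hG : GoodU ch) (f : ℕ → Move) : ¬ IsInfinitePlay topj ch f := by
  rcases Nat.le_one_iff_eq_zero_or_eq_one.mp htopj with rfl | rfl
  · suffices H : ∀ v, ∀ ch : Chain, pot0 ch = v → GoodU ch → ∀ f, ¬ IsInfinitePlay 0 ch f from H _ ch rfl hG f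
    intro v
    refine LT4_wf.induction (C := fun v => ∀ ch : Chain, pot0 ch = v → GoodU ch → ∀ f, ¬ IsInfinitePlay 0 ch f) v ?_
    intro v ih ch hv hG f hf
    have h0 : f 0 ∈ legalMoves 0 ch := hf 0
    have hlt : LT4 (pot0 (applyMove ch (f 0))) v := by rw [← hv]; exact pot0_step hG h0
    refine ih _ hlt (applyMove ch (f 0)) rfl (GoodU_applyMove hG h0) (fun k => f (k + 1)) ?_
    intro n; rw [playState_shift]; exact hf (n + 1)
  · suffices H : ∀ v, ∀ ch : Chain, pot ch = v → GoodU ch → ∀ f, ¬ IsInfinitePlay 1 ch f from H _ ch rfl hG f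
    intro v
    refine LT4_wf.induction (C := fun v => ∀ ch : Chain, pot ch = v → GoodU ch → ∀ f, ¬ IsInfinitePlay 1 ch f) v ?_
    intro v ih ch hv hG f hf
    have h0 : f 0 ∈ legalMoves 1 ch := hf 0
    have hlt : LT4 (pot (applyMove ch (f 0))) v := by rw [← hv]; exact pot_step_u1 hG h0
    refine ih _ hlt (applyMove ch (f 0)) rfl (GoodU_applyMove hG h0) (fun k => f (k + 1)) ?_
    intro n; rw [playState_shift]; exact hf (n + 1)

/-- one legal step between mode-`u` states -/
def StepU (topj : ℕ) (ch' ch : Chain) : Prop := GoodU ch ∧ ∃ m ∈ legalMoves topj ch, ch' = applyMove ch m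

theorem StepU_wf (topj : ℕ) (htopj : topj ≤ 1) : WellFounded (StepU topj) := by
  rcases Nat.le_one_iff_eq_zero_or_eq_one.mp htopj with rfl | rfl
  · refine Subrelation.wf ?_ (InvImage.wf pot0 LT4_wf)
    rintro ch' ch ⟨hG, m, hm, rfl⟩
    exact pot0_step hG hm
  · refine Subrelation.wf ?_ (InvImage.wf pot LT4_wf)
    rintro ch' ch ⟨hG, m, hm, rfl⟩
    exact pot_step_u1 hG hm

/-- THEOREM (S4 (iii), bounded form). From every mode-`u` state the legal plays under `topj ≤ 1` have BOUNDED LENGTH. -/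
theorem legalPlays_bounded_u (topj : ℕ) (htopj : topj ≤ 1) (ch : Chain) (hG : GoodU ch) :
    ∃ N, ∀ l : List Move, isLegalPlay topj ch l = true → l.length ≤ N := by
  revert hG
  refine (StepU_wf topj htopj).induction
    (C := fun ch => GoodU ch → ∃ N, ∀ l : List Move, isLegalPlay topj ch l = true → l.length ≤ N) ch ?_
  intro ch ih hG
  have hb : ∀ L : List Move, (∀ m ∈ L, m ∈ legalMoves topj ch) →
      ∃ N, ∀ m ∈ L, ∀ l : List Move, isLegalPlay topj (applyMove ch m) l = true → l.length ≤ N := by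
    intro L
    induction L with
    | nil => intro _; exact ⟨0, fun m hm => by simp at hm⟩
    | cons m L ihL =>
      intro hL
      obtain ⟨N₁, hN₁⟩ := ih (applyMove ch m) ⟨hG, m, hL m (by simp), rfl⟩ (GoodU_applyMove hG (hL m (by simp)))
      obtain ⟨N₂, hN₂⟩ := ihL (fun m' hm' => hL m' (by simp [hm']))
      refine ⟨max N₁ N₂, ?_⟩
      intro m' hm' l hl
      rcases List.mem_cons.mp hm' with rfl | hm'
      · exact le_trans (hN₁ l hl) (le_max_left _ _)
      · exact le_trans (hN₂ m' hm' l hl) (le_max_right _ _)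
  obtain ⟨N, hN⟩ := hb (legalMoves topj ch) (fun m hm => hm)
  refine ⟨N + 1, ?_⟩
  intro l hl
  cases l with
  | nil => simp
  | cons m l =>
    obtain ⟨hm, hl'⟩ := isLegalPlay_cons hl
    have := hN m hm l hl'
    simp only [List.length_cons]; omega

/-- the initial state `R — V(s)` of mode `u` is a mode-`u` state -/
theorem GoodU_init (c ws : W3) (w3s : ℕ) (hp : pat c = pat ws) (hne : pat c ≠ (false, false, false)) (hc : isDeepW c = false) :
    GoodU [⟨c, 0, false⟩, ⟨ws, w3s, true⟩] := by
  refine ⟨⟨⟨pat c, hne, ?_⟩, ?_⟩, ⟨c, 0, false⟩, [⟨ws, w3s, true⟩], rfl, rfl, ?_⟩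
  · intro x hx; simp at hx; rcases hx with rfl | rfl <;> simp [hp]
  · intro x hx hb; simp at hx; rcases hx with rfl | rfl
    · exact hc
    · simp at hb
  · intro x hx; simp at hx; subst hx; rfl

/-- COROLLARY: mode `u` under the historical rule sets rev 2 / rev 3 (`topj ≤ 1`), residual exponents not deep, for ALL weights. Together with
`terminates_u` (`topj ≥ 2`) and `terminates_uv` (any `topj`): the toric S-game terminates in every mode under every rule set of the loop note. -/
theorem terminates_u_hist (topj : ℕ) (htopj : topj ≤ 1) (c ws : W3) (w3s : ℕ) (hp : pat c = pat ws) (hne : pat c ≠ (false, false, false))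
    (hc : isDeepW c = false) (f : ℕ → Move) : ¬ IsInfinitePlay topj [⟨c, 0, false⟩, ⟨ws, w3s, true⟩] f :=
  no_infinite_play_u topj htopj _ (GoodU_init c ws w3s hp hne hc) f

/-- COROLLARY: mode `u`, every rule set. -/
theorem terminates_u_all (topj : ℕ) (c ws : W3) (w3s : ℕ) (hp : pat c = pat ws) (hne : pat c ≠ (false, false, false))
    (hc : isDeepW c = false) (f : ℕ → Move) : ¬ IsInfinitePlay topj [⟨c, 0, false⟩, ⟨ws, w3s, true⟩] f := by
  rcases Nat.lt_or_ge topj 2 with h | h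
  · exact terminates_u_hist topj (by omega) c ws w3s hp hne hc f
  · exact terminates_u topj h c ws w3s hp hne hc f

end Summit.ResolutionOfSingularities.ResolutionOfSingularities.Cruxes.DescentPerfectToAll.ToricSGame.Termination
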